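import Mathlib
import Literature.Analysis.FluidPDE.PlanarPolarCoords
import Literature.Analysis.FluidPDE.GaussianVortexKernelRadial
import Literature.Analysis.FluidPDE.BiotSavart2DSymmetry
import Literature.Analysis.FluidPDE.PineauVicolWeightedIdentity
import Literature.Analysis.FunctionSpaces.BMOLogProofs
import Literature.Analysis.Potential.CircleLogKernel
import Literature.Analysis.FluidPDE.PlanarLogPotential
import Literature.Analysis.FluidPDE.GaussWeightedBiotSavartBounds
import Literature.Analysis.FluidPDE.PlanarBiotSavartDivFree
import Literature.Analysis.FluidPDE.GaussianVortexArnoldModeOne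
import HarnessLib

/-!
# Arnold coercivity of the Gaussian vortex, file 2 of 3: the angular mode splitting and the logarithmic-potential toolkit (re-homed proofs)

**T. Gallay, V. Šverák, *Arnold's variational principle and its application to the stability of planar vortices*, arXiv:2110.13739
(Anal. PDE, 2024), Theorem 2.5 with Remark 2.7 and §4.1 (the Gaussian weight) [GallaySverak2021]: Arnold-type coercivity of the
quadratic form of the Oseen (Gaussian) vortex — for continuous, odd densities of Gaussian class with vanishing first moments,
`γ ∫ Φ⁻¹ ω² ≤ ∫ Φ⁻¹ ω² + ∫ ω ψ_ω` with `ψ_ω = (2π)⁻¹ log|·| ∗ ω` and some `γ > 0`.**  The named fact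
`Literature.Analysis.FluidPDE.GallaySverak2021_thm25_gaussian` (`ArnoldCoercivityGaussianVortex.lean`) is PROVED in the tree by the
Navier–Stokes / anomalous-dissipation cells (the angular Fourier splitting `ω = a(r) cos θ + b(r) sin θ + ω_r`, a one-dimensional
constrained coercivity for the `n = ±1` modes, an explicit coercivity for the modes `|n| ≥ 2`, and the logarithmic-potential
toolkit: Green's function, decay, energy identities, Hardy–Wirtinger) — until now Summits-side only (`stub_gallaySverak2021` in
`Summits/NavierStokesRegularity/NavierStokesRegularity/Theorems/FilamentSkeletonRssCoreLinearInvertibilityArnoldGaussian.lean`).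
RE-HOMED into `Literature/` by the Hodge foundations lane (`lit-hodgefound`, prover p20, generation 39) as THREE files: verbatim
DECLARATION-LEVEL ports (the 200 theorems the discharge needs, in dependency order; each Part header lists the declarations of its
source module that are NOT carried) of 33 Summits modules `Summits/NavierStokesRegularity/NavierStokesRegularity/Theorems/FilamentSkeletonRssCoreLinearInvertibility*.lean`
and `Summits/AnomalousDissipation/AnomalousDissipation/Theorems/MarginalStabilityChainStretchedVortexRowsStub*.lean`, namespaces
`Summit.NavierStokesRegularity.NavierStokesRegularity.Theorems{,.…}` → `Literature.Analysis.GaussianVortexArnold{,.…}` and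
`Summit.AnomalousDissipation.AnomalousDissipation.Theorems.MarginalStabilityChainStretchedVortexRows` → `Literature.Analysis.GaussianVortexArnold.StretchedVortexRows`
(a root outside `Literature.Analysis.FluidPDE` on purpose: namespace-prefix resolution would otherwise shadow the cone's lemmas by
same-named `FluidPDE` lemmas); theorems only (kernel path), imports from `Literature/` and Mathlib only; no `sorry`, no new axiom, NO
named fact (D-0026).  PROVENANCE CONVENTION: docstrings byte-for-byte; the cell's cites kept; `[folklore]`-tagged and untagged cell
lemmas carry the Part's tag `[cite: GallaySverak2021, <loc> (source of the ARGUMENT implemented / context; this declaration is the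
cell's own lemma, NOT a printed statement)]`, because the gate does not admit a public Literature theorem without a cite tag.

THIS FILE (2 of 3) ports: FilamentSkeletonRssCoreLinearInvertibilityArnoldModeSplitToolsA, FilamentSkeletonRssCoreLinearInvertibilityArnoldModeSplitToolsB, MarginalStabilityChainStretchedVortexRowsStubLogPotentialTools, FilamentSkeletonRssCoreLinearInvertibilityArnoldModeSplitToolsC, FilamentSkeletonRssCoreLinearInvertibilityOddArnoldToolsB, FilamentSkeletonRssCoreLinearInvertibilityArnoldModeSplitToolsD, FilamentSkeletonRssCoreLinearInvertibilityArnoldModeSplit, MarginalStabilityChainStretchedVortexRowsStubLogPotentialGradient, MarginalStabilityChainStretchedVortexRowsStubLogPotentialGreen, MarginalStabilityChainStretchedVortexRowsStubLogPotentialDecay.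
-/

noncomputable section

/-!
## Part 1 — port of `Summits/NavierStokesRegularity/NavierStokesRegularity/Theorems/FilamentSkeletonRssCoreLinearInvertibilityArnoldModeSplitToolsA.lean` (25 declarations kept)

# Tools for stub `stub_arnoldModeSplit` (crux `CoreLinearInvertibility`, stmt-NavierStokesRegularity-17973,
# route `FilamentSkeletonRss`, line `Sketch`) — part A: the `k = ±1` circle coefficients

For a continuous planar density `ω` of Gaussian class (`|ω(x)| ≤ C(1+|x|)^N e^{−|x|²/4}`) put, on the
circle of radius `r` (`circlePt r θ = (r cos θ, r sin θ)` of `PlanarPolarCoords`),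
`a(r) = π⁻¹ ∫_{-π}^{π} ω(circlePt r θ) cos θ dθ`, `b(r) = π⁻¹ ∫_{-π}^{π} ω(circlePt r θ) sin θ dθ`
(the real `k = ±1` angular Fourier coefficients), the `k = ±1` part
`ω₁(x) = (a(|x|) x₀ + b(|x|) x₁)/|x|` (`= a(r) cos θ + b(r) sin θ` on the circle of radius `r > 0`,
`0` at the origin) and the remainder `ω_r = ω − ω₁`.  Proved here (elementary):

* the trigonometric integrals over a full turn (`∫ cos² = ∫ sin² = π`, `∫ sin cos = ∫ cos = ∫ sin = 0`);
* `a`, `b` are continuous, vanish at `r = 0`, and are of Gaussian class on `[0, ∞)`;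
* `ω₁` is continuous (at the origin because `a(0) = b(0) = 0`), odd, of Gaussian class, and equals
  `a(r) cos θ + b(r) sin θ` on circles; `ω_r` is continuous, odd (for odd `ω`), of Gaussian class;
* the `k = ±1` circle coefficients of `ω_r` vanish: `∫ ω_r(circlePt r θ) cos θ dθ = ∫ ω_r(circlePt r θ) sin θ dθ = 0`
  for `r > 0`.

Reference for the decomposition: Th. Gallay, V. Šverák, arXiv:2110.13739, §3 (proof of Thm. 2.5:
Fourier decomposition in the angular variable, (Jk), (Bkdef)). Everything in this file is folklore.

Not carried from this source module (not needed by the declarations re-homed here; their consumers are Summits-side): `stub_arnoldModeSplitToolsA`.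
-/

section Part1

namespace Literature.Analysis.GaussianVortexArnold

open _root_.Set _root_.Function _root_.Filter _root_.MeasureTheory _root_.Topology
open Literature.Analysis.FluidPDE
open scoped _root_.Real

/-! ### Trigonometric integrals over a full turn -/

/-- `∫_{-π}^{π} cos² = π`. [folklore]
[cite: GallaySverak2021, §2 proof of Thm 2.5, the angular Fourier splitting (source of the ARGUMENT implemented; this declaration is the cell’s own lemma, NOT a printed statement)] -/
theorem modeSplit_integral_cos_sq : ∫ θ in (-π)..π, Real.cos θ ^ 2 = π := by
  rw [integral_cos_sq]
  simp [Real.sin_neg]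

/-- `∫_{-π}^{π} sin² = π`. [folklore]
[cite: GallaySverak2021, §2 proof of Thm 2.5, the angular Fourier splitting (source of the ARGUMENT implemented; this declaration is the cell’s own lemma, NOT a printed statement)] -/
theorem modeSplit_integral_sin_sq : ∫ θ in (-π)..π, Real.sin θ ^ 2 = π := by
  rw [integral_sin_sq]
  simp [Real.sin_neg]

/-- `∫_{-π}^{π} sin θ cos θ dθ = 0`. [folklore]
[cite: GallaySverak2021, §2 proof of Thm 2.5, the angular Fourier splitting (source of the ARGUMENT implemented; this declaration is the cell’s own lemma, NOT a printed statement)] -/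
theorem modeSplit_integral_sin_mul_cos : ∫ θ in (-π)..π, Real.sin θ * Real.cos θ = 0 := by
  rw [integral_sin_mul_cos₁]
  simp [Real.sin_neg]

/-- `∫_{-π}^{π} cos = 0`. [folklore]
[cite: GallaySverak2021, §2 proof of Thm 2.5, the angular Fourier splitting (source of the ARGUMENT implemented; this declaration is the cell’s own lemma, NOT a printed statement)] -/
theorem modeSplit_integral_cos : ∫ θ in (-π)..π, Real.cos θ = 0 := by
  rw [integral_cos]
  simp [Real.sin_neg]

/-- `∫_{-π}^{π} sin = 0`. [folklore]
[cite: GallaySverak2021, §2 proof of Thm 2.5, the angular Fourier splitting (source of the ARGUMENT implemented; this declaration is the cell’s own lemma, NOT a printed statement)] -/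
theorem modeSplit_integral_sin : ∫ θ in (-π)..π, Real.sin θ = 0 := by
  rw [integral_sin]
  simp [Real.cos_neg]

/-! ### Circle integrals `∫ ω(circlePt r θ) w(θ) dθ` of a continuous density -/

/-- `r ↦ ∫_{-π}^{π} ω(circlePt r θ) w(θ) dθ` is continuous for continuous `ω`, `w` (parametric interval
integral of a continuous integrand). [folklore]
[cite: GallaySverak2021, §2 proof of Thm 2.5, the angular Fourier splitting (source of the ARGUMENT implemented; this declaration is the cell’s own lemma, NOT a printed statement)] -/
theorem modeSplit_continuous_circleInt {om : EuclideanSpace ℝ (Fin 2) → ℝ} (hom : Continuous om) {w : ℝ → ℝ}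
    (hw : Continuous w) : Continuous fun r => ∫ θ in (-π)..π, om (circlePt r θ) * w θ :=
  intervalIntegral.continuous_parametric_intervalIntegral_of_continuous'
    (f := fun r θ => om (circlePt r θ) * w θ)
    ((hom.comp continuous_circlePt_uncurry).mul (hw.comp continuous_snd)) _ _

/-- On the circle of radius `0` the integral is `ω(0) ∫ w = 0` when `∫_{-π}^{π} w = 0`. [folklore]
[cite: GallaySverak2021, §2 proof of Thm 2.5, the angular Fourier splitting (source of the ARGUMENT implemented; this declaration is the cell’s own lemma, NOT a printed statement)] -/
theorem modeSplit_circleInt_zero (om : EuclideanSpace ℝ (Fin 2) → ℝ) {w : ℝ → ℝ} (hw0 : ∫ θ in (-π)..π, w θ = 0) :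
    ∫ θ in (-π)..π, om (circlePt 0 θ) * w θ = 0 := by
  simp only [circlePt_zero_left]
  rw [intervalIntegral.integral_const_mul, hw0, mul_zero]

/-- `θ ↦ ω(circlePt r θ) w(θ)` is interval integrable for continuous `ω`, `w`. [folklore]
[cite: GallaySverak2021, §2 proof of Thm 2.5, the angular Fourier splitting (source of the ARGUMENT implemented; this declaration is the cell’s own lemma, NOT a printed statement)] -/
theorem modeSplit_intervalIntegrable_circle {om : EuclideanSpace ℝ (Fin 2) → ℝ} (hom : Continuous om) {w : ℝ → ℝ}
    (hw : Continuous w) (r c d : ℝ) :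
    IntervalIntegrable (fun θ => om (circlePt r θ) * w θ) volume c d :=
  ((hom.comp (continuous_circlePt r)).mul hw).intervalIntegrable _ _

/-- **Gaussian bound for circle integrals**: `|∫_{-π}^{π} ω(circlePt r θ) w(θ) dθ| ≤ 2π C(1+|r|)^N e^{−r²/4}`
when `|ω(x)| ≤ C(1+|x|)^N e^{−|x|²/4}` and `|w| ≤ 1` (`|circlePt r θ| = |r|`). [folklore]
[cite: GallaySverak2021, §2 proof of Thm 2.5, the angular Fourier splitting (source of the ARGUMENT implemented; this declaration is the cell’s own lemma, NOT a printed statement)] -/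
theorem modeSplit_abs_circleInt_le {om : EuclideanSpace ℝ (Fin 2) → ℝ} {C : ℝ} {N : ℕ}
    (hC : ∀ x, |om x| ≤ C * (1 + ‖x‖) ^ N * Real.exp (-(‖x‖ ^ 2 / 4)))
    {w : ℝ → ℝ} (hw : ∀ θ, |w θ| ≤ 1) (r : ℝ) :
    |∫ θ in (-π)..π, om (circlePt r θ) * w θ| ≤
      2 * π * (C * (1 + |r|) ^ N * Real.exp (-(r ^ 2 / 4))) := by
  have hC0 : 0 ≤ C := arnold_gc_const_nonneg hC
  have h := intervalIntegral.norm_integral_le_of_norm_le_const (a := -π) (b := π)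
    (C := C * (1 + |r|) ^ N * Real.exp (-(r ^ 2 / 4))) (f := fun θ => om (circlePt r θ) * w θ)
    (fun θ _ => by
      rw [Real.norm_eq_abs, abs_mul]
      have h1 := hC (circlePt r θ)
      rw [norm_circlePt, sq_abs] at h1
      calc |om (circlePt r θ)| * |w θ| ≤ C * (1 + |r|) ^ N * Real.exp (-(r ^ 2 / 4)) * 1 :=
            mul_le_mul h1 (hw θ) (abs_nonneg _) (by positivity)
        _ = _ := mul_one _)
  rw [Real.norm_eq_abs, sub_neg_eq_add, ← two_mul, abs_of_pos Real.two_pi_pos] at h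
  linarith

/-! ### The coefficients `a`, `b` -/

section Coeff

variable {om : EuclideanSpace ℝ (Fin 2) → ℝ} {a b : ℝ → ℝ}

/-- `a` (or `b`) is continuous. [folklore]
[cite: GallaySverak2021, §2 proof of Thm 2.5, the angular Fourier splitting (source of the ARGUMENT implemented; this declaration is the cell’s own lemma, NOT a printed statement)] -/
theorem modeSplit_continuous_coeff (hom : Continuous om) {w : ℝ → ℝ} (hw : Continuous w)
    (ha : ∀ r, a r = (1 / Real.pi) * ∫ θ in (-Real.pi)..Real.pi, om (circlePt r θ) * w θ) :
    Continuous a := by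
  rw [show a = fun r => (1 / Real.pi) * ∫ θ in (-Real.pi)..Real.pi, om (circlePt r θ) * w θ from
    funext ha]
  exact continuous_const.mul (modeSplit_continuous_circleInt hom hw)

/-- `a(0) = 0` (resp. `b(0) = 0`): `∫ cos = ∫ sin = 0`. [folklore]
[cite: GallaySverak2021, §2 proof of Thm 2.5, the angular Fourier splitting (source of the ARGUMENT implemented; this declaration is the cell’s own lemma, NOT a printed statement)] -/
theorem modeSplit_coeff_zero {w : ℝ → ℝ} (hw0 : ∫ θ in (-π)..π, w θ = 0)
    (ha : ∀ r, a r = (1 / Real.pi) * ∫ θ in (-Real.pi)..Real.pi, om (circlePt r θ) * w θ) :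
    a 0 = 0 := by
  rw [ha, modeSplit_circleInt_zero om hw0, mul_zero]

/-- `∫ ω(circlePt r θ) w θ dθ = π a(r)`. [folklore]
[cite: GallaySverak2021, §2 proof of Thm 2.5, the angular Fourier splitting (source of the ARGUMENT implemented; this declaration is the cell’s own lemma, NOT a printed statement)] -/
theorem modeSplit_circleInt_eq_pi_mul {w : ℝ → ℝ}
    (ha : ∀ r, a r = (1 / Real.pi) * ∫ θ in (-Real.pi)..Real.pi, om (circlePt r θ) * w θ) (r : ℝ) :
    ∫ θ in (-π)..π, om (circlePt r θ) * w θ = π * a r := by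
  rw [ha r]
  field_simp

/-- **`a`, `b` are of Gaussian class**: `|a(r)| ≤ 2C(1+|r|)^N e^{−r²/4}` for every `r` when
`|ω(x)| ≤ C(1+|x|)^N e^{−|x|²/4}` and `|w| ≤ 1`. [folklore]
[cite: GallaySverak2021, §2 proof of Thm 2.5, the angular Fourier splitting (source of the ARGUMENT implemented; this declaration is the cell’s own lemma, NOT a printed statement)] -/
theorem modeSplit_abs_coeff_le {C : ℝ} {N : ℕ}
    (hC : ∀ x, |om x| ≤ C * (1 + ‖x‖) ^ N * Real.exp (-(‖x‖ ^ 2 / 4)))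
    {w : ℝ → ℝ} (hw : ∀ θ, |w θ| ≤ 1)
    (ha : ∀ r, a r = (1 / Real.pi) * ∫ θ in (-Real.pi)..Real.pi, om (circlePt r θ) * w θ) (r : ℝ) :
    |a r| ≤ 2 * C * (1 + |r|) ^ N * Real.exp (-(r ^ 2 / 4)) := by
  have h := modeSplit_abs_circleInt_le hC hw r
  rw [ha r, abs_mul, abs_of_pos (by positivity : (0 : ℝ) < 1 / Real.pi)]
  calc 1 / π * |∫ θ in (-π)..π, om (circlePt r θ) * w θ|
      ≤ 1 / π * (2 * π * (C * (1 + |r|) ^ N * Real.exp (-(r ^ 2 / 4)))) :=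
        mul_le_mul_of_nonneg_left h (by positivity)
    _ = 2 * C * (1 + |r|) ^ N * Real.exp (-(r ^ 2 / 4)) := by
        field_simp

/-- The Gaussian-class bound of `a`, `b` on `[0, ∞)` in the registered form. [folklore]
[cite: GallaySverak2021, §2 proof of Thm 2.5, the angular Fourier splitting (source of the ARGUMENT implemented; this declaration is the cell’s own lemma, NOT a printed statement)] -/
theorem modeSplit_coeff_gaussClass
    (hgc : ∃ (C : ℝ) (N : ℕ), ∀ x, |om x| ≤ C * (1 + ‖x‖) ^ N * Real.exp (-(‖x‖ ^ 2 / 4)))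
    (ha : ∀ r, a r = (1 / Real.pi) * ∫ θ in (-Real.pi)..Real.pi, om (circlePt r θ) * Real.cos θ)
    (hb : ∀ r, b r = (1 / Real.pi) * ∫ θ in (-Real.pi)..Real.pi, om (circlePt r θ) * Real.sin θ) :
    ∃ (C : ℝ) (N : ℕ), ∀ r : ℝ, 0 ≤ r →
      |a r| ≤ C * (1 + r) ^ N * Real.exp (-(r ^ 2 / 4)) ∧
      |b r| ≤ C * (1 + r) ^ N * Real.exp (-(r ^ 2 / 4)) := by
  obtain ⟨C, N, hC⟩ := hgc
  refine ⟨2 * C, N, fun r hr => ?_⟩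
  have h1 := modeSplit_abs_coeff_le hC Real.abs_cos_le_one ha r
  have h2 := modeSplit_abs_coeff_le hC Real.abs_sin_le_one hb r
  rw [abs_of_nonneg hr] at h1 h2
  exact ⟨h1, h2⟩

end Coeff

/-! ### The `k = ±1` part `ω₁` and the remainder `ω_r` -/

section ModeOne

variable {om : EuclideanSpace ℝ (Fin 2) → ℝ} {a b : ℝ → ℝ} {om₁ omr : EuclideanSpace ℝ (Fin 2) → ℝ}

/-- On the circle of radius `r > 0`: `ω₁(circlePt r θ) = a(r) cos θ + b(r) sin θ`. [folklore]
[cite: GallaySverak2021, §2 proof of Thm 2.5, the angular Fourier splitting (source of the ARGUMENT implemented; this declaration is the cell’s own lemma, NOT a printed statement)] -/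
theorem modeSplit_om₁_circlePt (hom₁ : ∀ x, om₁ x = (a ‖x‖ * x 0 + b ‖x‖ * x 1) / ‖x‖) {r : ℝ}
    (hr : 0 < r) (θ : ℝ) : om₁ (circlePt r θ) = a r * Real.cos θ + b r * Real.sin θ := by
  rw [hom₁, norm_circlePt, abs_of_pos hr, circlePt_apply_zero, circlePt_apply_one]
  field_simp

/-- `|ω₁(x)| ≤ |a(|x|)| + |b(|x|)|` (`|x_j| ≤ |x|`). [folklore]
[cite: GallaySverak2021, §2 proof of Thm 2.5, the angular Fourier splitting (source of the ARGUMENT implemented; this declaration is the cell’s own lemma, NOT a printed statement)] -/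
theorem modeSplit_abs_om₁_le (hom₁ : ∀ x, om₁ x = (a ‖x‖ * x 0 + b ‖x‖ * x 1) / ‖x‖) (x : EuclideanSpace ℝ (Fin 2)) :
    |om₁ x| ≤ |a ‖x‖| + |b ‖x‖| := by
  rw [hom₁]
  rcases eq_or_ne x 0 with rfl | hx
  · simp only [norm_zero, div_zero, abs_zero]
    positivity
  · have hn : 0 < ‖x‖ := norm_pos_iff.2 hx
    have h0 : |x 0| ≤ ‖x‖ := by simpa using PiLp.norm_apply_le x 0
    have h1 : |x 1| ≤ ‖x‖ := by simpa using PiLp.norm_apply_le x 1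
    rw [abs_div, abs_of_pos hn, div_le_iff₀ hn]
    calc |a ‖x‖ * x 0 + b ‖x‖ * x 1| ≤ |a ‖x‖| * |x 0| + |b ‖x‖| * |x 1| := by
          simpa only [abs_mul] using abs_add_le (a ‖x‖ * x 0) (b ‖x‖ * x 1)
      _ ≤ |a ‖x‖| * ‖x‖ + |b ‖x‖| * ‖x‖ := by gcongr
      _ = (|a ‖x‖| + |b ‖x‖|) * ‖x‖ := by ring

/-- `ω₁(0) = 0`. [folklore]
[cite: GallaySverak2021, §2 proof of Thm 2.5, the angular Fourier splitting (source of the ARGUMENT implemented; this declaration is the cell’s own lemma, NOT a printed statement)] -/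
theorem modeSplit_om₁_zero (hom₁ : ∀ x, om₁ x = (a ‖x‖ * x 0 + b ‖x‖ * x 1) / ‖x‖) : om₁ 0 = 0 := by
  rw [hom₁]; simp

/-- **`ω₁` is continuous**: off the origin by the formula, at the origin because
`|ω₁(x)| ≤ |a(|x|)| + |b(|x|)| → |a(0)| + |b(0)| = 0`. [folklore]
[cite: GallaySverak2021, §2 proof of Thm 2.5, the angular Fourier splitting (source of the ARGUMENT implemented; this declaration is the cell’s own lemma, NOT a printed statement)] -/
theorem modeSplit_continuous_om₁ (hac : Continuous a) (hbc : Continuous b) (ha0 : a 0 = 0)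
    (hb0 : b 0 = 0) (hom₁ : ∀ x, om₁ x = (a ‖x‖ * x 0 + b ‖x‖ * x 1) / ‖x‖) : Continuous om₁ := by
  have heq : om₁ = fun x => (a ‖x‖ * x 0 + b ‖x‖ * x 1) / ‖x‖ := funext hom₁
  have hnum : Continuous fun x : EuclideanSpace ℝ (Fin 2) => a ‖x‖ * x 0 + b ‖x‖ * x 1 :=
    ((hac.comp continuous_norm).mul (PiLp.continuous_apply 2 _ 0)).add
      ((hbc.comp continuous_norm).mul (PiLp.continuous_apply 2 _ 1))
  refine continuous_iff_continuousAt.2 fun x => ?_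
  rcases eq_or_ne x 0 with rfl | hx
  · change Tendsto om₁ (𝓝 0) (𝓝 (om₁ 0))
    rw [modeSplit_om₁_zero hom₁]
    have hg : Tendsto (fun x : EuclideanSpace ℝ (Fin 2) => |a ‖x‖| + |b ‖x‖|) (𝓝 0) (𝓝 0) := by
      have hc : Continuous fun x : EuclideanSpace ℝ (Fin 2) => |a ‖x‖| + |b ‖x‖| :=
        (continuous_abs.comp (hac.comp continuous_norm)).add
          (continuous_abs.comp (hbc.comp continuous_norm))
      simpa [ha0, hb0] using hc.tendsto 0
    exact squeeze_zero_norm (fun x => by rw [Real.norm_eq_abs]; exact modeSplit_abs_om₁_le hom₁ x) hg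
  · rw [heq]
    exact hnum.continuousAt.div continuous_norm.continuousAt (norm_ne_zero_iff.2 hx)

/-- `ω₁` is odd. [folklore]
[cite: GallaySverak2021, §2 proof of Thm 2.5, the angular Fourier splitting (source of the ARGUMENT implemented; this declaration is the cell’s own lemma, NOT a printed statement)] -/
theorem modeSplit_om₁_odd (hom₁ : ∀ x, om₁ x = (a ‖x‖ * x 0 + b ‖x‖ * x 1) / ‖x‖) (x : EuclideanSpace ℝ (Fin 2)) :
    om₁ (-x) = -om₁ x := by
  rw [hom₁, hom₁ x, norm_neg, PiLp.neg_apply, PiLp.neg_apply]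
  ring

/-- **`ω₁` is of Gaussian class** (`|ω₁| ≤ |a| + |b| ≤ 4C(1+|x|)^N e^{−|x|²/4}`). [folklore]
[cite: GallaySverak2021, §2 proof of Thm 2.5, the angular Fourier splitting (source of the ARGUMENT implemented; this declaration is the cell’s own lemma, NOT a printed statement)] -/
theorem modeSplit_om₁_gaussClass {C : ℝ} {N : ℕ}
    (hC : ∀ x, |om x| ≤ C * (1 + ‖x‖) ^ N * Real.exp (-(‖x‖ ^ 2 / 4)))
    (ha : ∀ r, a r = (1 / Real.pi) * ∫ θ in (-Real.pi)..Real.pi, om (circlePt r θ) * Real.cos θ)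
    (hb : ∀ r, b r = (1 / Real.pi) * ∫ θ in (-Real.pi)..Real.pi, om (circlePt r θ) * Real.sin θ)
    (hom₁ : ∀ x, om₁ x = (a ‖x‖ * x 0 + b ‖x‖ * x 1) / ‖x‖) (x : EuclideanSpace ℝ (Fin 2)) :
    |om₁ x| ≤ 4 * C * (1 + ‖x‖) ^ N * Real.exp (-(‖x‖ ^ 2 / 4)) := by
  have h1 := modeSplit_abs_coeff_le hC Real.abs_cos_le_one ha ‖x‖
  have h2 := modeSplit_abs_coeff_le hC Real.abs_sin_le_one hb ‖x‖
  rw [abs_norm] at h1 h2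
  have h := modeSplit_abs_om₁_le hom₁ x
  linarith

/-- `ω_r = ω − ω₁` is continuous. [folklore]
[cite: GallaySverak2021, §2 proof of Thm 2.5, the angular Fourier splitting (source of the ARGUMENT implemented; this declaration is the cell’s own lemma, NOT a printed statement)] -/
theorem modeSplit_continuous_omr (hom : Continuous om) (hom₁c : Continuous om₁)
    (homr : ∀ x, omr x = om x - om₁ x) : Continuous omr := by
  rw [show omr = fun x => om x - om₁ x from funext homr]
  exact hom.sub hom₁c

/-- `ω_r` is odd when `ω` is. [folklore]
[cite: GallaySverak2021, §2 proof of Thm 2.5, the angular Fourier splitting (source of the ARGUMENT implemented; this declaration is the cell’s own lemma, NOT a printed statement)] -/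
theorem modeSplit_omr_odd (hodd : ∀ x, om (-x) = -om x)
    (hom₁ : ∀ x, om₁ x = (a ‖x‖ * x 0 + b ‖x‖ * x 1) / ‖x‖) (homr : ∀ x, omr x = om x - om₁ x)
    (x : EuclideanSpace ℝ (Fin 2)) : omr (-x) = -omr x := by
  rw [homr, homr x, hodd, modeSplit_om₁_odd hom₁]
  ring

/-- **`ω_r` is of Gaussian class** (`|ω_r| ≤ |ω| + |ω₁| ≤ 5C(1+|x|)^N e^{−|x|²/4}`). [folklore]
[cite: GallaySverak2021, §2 proof of Thm 2.5, the angular Fourier splitting (source of the ARGUMENT implemented; this declaration is the cell’s own lemma, NOT a printed statement)] -/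
theorem modeSplit_omr_gaussClass {C : ℝ} {N : ℕ}
    (hC : ∀ x, |om x| ≤ C * (1 + ‖x‖) ^ N * Real.exp (-(‖x‖ ^ 2 / 4)))
    (ha : ∀ r, a r = (1 / Real.pi) * ∫ θ in (-Real.pi)..Real.pi, om (circlePt r θ) * Real.cos θ)
    (hb : ∀ r, b r = (1 / Real.pi) * ∫ θ in (-Real.pi)..Real.pi, om (circlePt r θ) * Real.sin θ)
    (hom₁ : ∀ x, om₁ x = (a ‖x‖ * x 0 + b ‖x‖ * x 1) / ‖x‖) (homr : ∀ x, omr x = om x - om₁ x)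
    (x : EuclideanSpace ℝ (Fin 2)) : |omr x| ≤ 5 * C * (1 + ‖x‖) ^ N * Real.exp (-(‖x‖ ^ 2 / 4)) := by
  have h1 := modeSplit_om₁_gaussClass hC ha hb hom₁ x
  have h2 := hC x
  rw [homr]
  have h := abs_sub (om x) (om₁ x)
  linarith

/-- **The `k = ±1` circle coefficients of `ω_r` vanish**: for `r > 0`,
`∫_{-π}^{π} ω_r(circlePt r θ) cos θ dθ = 0` (`∫ ω cos = π a`, `∫ cos² = π`, `∫ sin cos = 0`). [folklore]
[cite: GallaySverak2021, §2 proof of Thm 2.5, the angular Fourier splitting (source of the ARGUMENT implemented; this declaration is the cell’s own lemma, NOT a printed statement)] -/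
theorem modeSplit_omr_circle_cos (hom : Continuous om)
    (ha : ∀ r, a r = (1 / Real.pi) * ∫ θ in (-Real.pi)..Real.pi, om (circlePt r θ) * Real.cos θ)
    (hom₁ : ∀ x, om₁ x = (a ‖x‖ * x 0 + b ‖x‖ * x 1) / ‖x‖) (homr : ∀ x, omr x = om x - om₁ x)
    {r : ℝ} (hr : 0 < r) : ∫ θ in (-π)..π, omr (circlePt r θ) * Real.cos θ = 0 := by
  have h1 : ∀ θ, omr (circlePt r θ) * Real.cos θ = om (circlePt r θ) * Real.cos θ -
      a r * Real.cos θ ^ 2 - b r * (Real.sin θ * Real.cos θ) := by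
    intro θ; rw [homr, modeSplit_om₁_circlePt hom₁ hr]; ring
  simp_rw [h1]
  have i1 := modeSplit_intervalIntegrable_circle hom Real.continuous_cos r (-π) π
  have i2 : IntervalIntegrable (fun θ => a r * Real.cos θ ^ 2) volume (-π) π :=
    (continuous_const.mul (Real.continuous_cos.pow 2)).intervalIntegrable _ _
  have i3 : IntervalIntegrable (fun θ => b r * (Real.sin θ * Real.cos θ)) volume (-π) π :=
    (continuous_const.mul (Real.continuous_sin.mul Real.continuous_cos)).intervalIntegrable _ _
  rw [intervalIntegral.integral_sub (i1.sub i2) i3, intervalIntegral.integral_sub i1 i2,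
    intervalIntegral.integral_const_mul, intervalIntegral.integral_const_mul,
    modeSplit_integral_cos_sq, modeSplit_integral_sin_mul_cos, modeSplit_circleInt_eq_pi_mul ha r]
  ring

/-- The same with `sin`: `∫_{-π}^{π} ω_r(circlePt r θ) sin θ dθ = 0` for `r > 0`. [folklore]
[cite: GallaySverak2021, §2 proof of Thm 2.5, the angular Fourier splitting (source of the ARGUMENT implemented; this declaration is the cell’s own lemma, NOT a printed statement)] -/
theorem modeSplit_omr_circle_sin (hom : Continuous om)
    (hb : ∀ r, b r = (1 / Real.pi) * ∫ θ in (-Real.pi)..Real.pi, om (circlePt r θ) * Real.sin θ)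
    (hom₁ : ∀ x, om₁ x = (a ‖x‖ * x 0 + b ‖x‖ * x 1) / ‖x‖) (homr : ∀ x, omr x = om x - om₁ x)
    {r : ℝ} (hr : 0 < r) : ∫ θ in (-π)..π, omr (circlePt r θ) * Real.sin θ = 0 := by
  have h1 : ∀ θ, omr (circlePt r θ) * Real.sin θ = om (circlePt r θ) * Real.sin θ -
      a r * (Real.sin θ * Real.cos θ) - b r * Real.sin θ ^ 2 := by
    intro θ; rw [homr, modeSplit_om₁_circlePt hom₁ hr]; ring
  simp_rw [h1]
  have i1 := modeSplit_intervalIntegrable_circle hom Real.continuous_sin r (-π) π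
  have i2 : IntervalIntegrable (fun θ => a r * (Real.sin θ * Real.cos θ)) volume (-π) π :=
    (continuous_const.mul (Real.continuous_sin.mul Real.continuous_cos)).intervalIntegrable _ _
  have i3 : IntervalIntegrable (fun θ => b r * Real.sin θ ^ 2) volume (-π) π :=
    (continuous_const.mul (Real.continuous_sin.pow 2)).intervalIntegrable _ _
  rw [intervalIntegral.integral_sub (i1.sub i2) i3, intervalIntegral.integral_sub i1 i2,
    intervalIntegral.integral_const_mul, intervalIntegral.integral_const_mul,
    modeSplit_integral_sin_sq, modeSplit_integral_sin_mul_cos, modeSplit_circleInt_eq_pi_mul hb r]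
  ring

end ModeOne

/-! ### The registered tools stub -/

end Literature.Analysis.GaussianVortexArnold

end Part1

/-!
## Part 2 — port of `Summits/NavierStokesRegularity/NavierStokesRegularity/Theorems/FilamentSkeletonRssCoreLinearInvertibilityArnoldModeSplitToolsB.lean` (5 declarations kept)

# Tools for stub `stub_arnoldModeSplit` (crux `CoreLinearInvertibility`, stmt-NavierStokesRegularity-17973,
# route `FilamentSkeletonRss`, line `Sketch`) — part B: polar coordinates

With the notation of part A (`a`, `b` the `k = ±1` circle coefficients of a continuous Gaussian-class
density `ω`, `ω₁` its `k = ±1` part, `ω_r = ω − ω₁`), polar coordinates on `ℝ²`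
(`integral_eq_integral_circlePt` of `PlanarPolarCoords`) give:

* the first moments `∫ x₀ ω = π ∫₀^∞ r² a(r) dr`, `∫ x₁ ω = π ∫₀^∞ r² b(r) dr`;
* **orthogonality in `L²(Φ⁻¹)`** (`Φ = kerWeight`):
  `∫ Φ⁻¹ ω² = π ∫₀^∞ Φ(r)⁻¹ (a² + b²) r dr + ∫ Φ⁻¹ ω_r²` (circle by circle, the cross term
  `∫ (a cos θ + b sin θ) ω_r(circlePt r θ) dθ` vanishes and `∫ (a cos θ + b sin θ)² dθ = π(a² + b²)`).

Reference: Th. Gallay, V. Šverák, arXiv:2110.13739, §3 (proof of Thm. 2.5). Folklore.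

Not carried from this source module (not needed by the declarations re-homed here; their consumers are Summits-side): `stub_arnoldModeSplitToolsB`.
-/

section Part2

namespace Literature.Analysis.GaussianVortexArnold

open _root_.Set _root_.Function _root_.Filter _root_.MeasureTheory _root_.Topology
open Literature.Analysis.FluidPDE
open scoped _root_.Real

section Polar

variable {om : EuclideanSpace ℝ (Fin 2) → ℝ} {a b : ℝ → ℝ} {om₁ omr : EuclideanSpace ℝ (Fin 2) → ℝ}

/-! ### First moments in polar coordinates -/

/-- **`∫ x₀ ω = π ∫₀^∞ r² a(r) dr`** (polar coordinates; `a = π⁻¹ ∫ ω(circlePt r θ) cos θ dθ`). [folklore]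
[cite: GallaySverak2021, §2 proof of Thm 2.5, the angular Fourier splitting (source of the ARGUMENT implemented; this declaration is the cell’s own lemma, NOT a printed statement)] -/
theorem modeSplit_integral_coord_zero_mul (hom : Continuous om)
    (hgc : ∃ (C : ℝ) (N : ℕ), ∀ x, |om x| ≤ C * (1 + ‖x‖) ^ N * Real.exp (-(‖x‖ ^ 2 / 4)))
    (ha : ∀ r, a r = (1 / Real.pi) * ∫ θ in (-Real.pi)..Real.pi, om (circlePt r θ) * Real.cos θ) :
    ∫ x : EuclideanSpace ℝ (Fin 2), x 0 * om x = π * ∫ r in Ioi (0 : ℝ), r ^ 2 * a r := by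
  have hπ : -π ≤ π := by linarith [Real.pi_pos]
  have hint : Integrable fun x : EuclideanSpace ℝ (Fin 2) => x 0 * om x :=
    (arnold_integrable_of_gc hom.aestronglyMeasurable hgc).2.2 0
  rw [integral_eq_integral_circlePt hint, ← integral_const_mul]
  refine setIntegral_congr_fun measurableSet_Ioi fun ρ _ => ?_
  have h1 : ∀ θ : ℝ, ρ • (circlePt ρ θ 0 * om (circlePt ρ θ)) =
      ρ ^ 2 * (om (circlePt ρ θ) * Real.cos θ) := fun θ => by
    rw [circlePt_apply_zero, smul_eq_mul]; ring
  simp_rw [h1]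
  rw [integral_const_mul, ← intervalIntegral.integral_of_le hπ, modeSplit_circleInt_eq_pi_mul ha ρ]
  ring

/-- **`∫ x₁ ω = π ∫₀^∞ r² b(r) dr`**. [folklore]
[cite: GallaySverak2021, §2 proof of Thm 2.5, the angular Fourier splitting (source of the ARGUMENT implemented; this declaration is the cell’s own lemma, NOT a printed statement)] -/
theorem modeSplit_integral_coord_one_mul (hom : Continuous om)
    (hgc : ∃ (C : ℝ) (N : ℕ), ∀ x, |om x| ≤ C * (1 + ‖x‖) ^ N * Real.exp (-(‖x‖ ^ 2 / 4)))
    (hb : ∀ r, b r = (1 / Real.pi) * ∫ θ in (-Real.pi)..Real.pi, om (circlePt r θ) * Real.sin θ) :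
    ∫ x : EuclideanSpace ℝ (Fin 2), x 1 * om x = π * ∫ r in Ioi (0 : ℝ), r ^ 2 * b r := by
  have hπ : -π ≤ π := by linarith [Real.pi_pos]
  have hint : Integrable fun x : EuclideanSpace ℝ (Fin 2) => x 1 * om x :=
    (arnold_integrable_of_gc hom.aestronglyMeasurable hgc).2.2 1
  rw [integral_eq_integral_circlePt hint, ← integral_const_mul]
  refine setIntegral_congr_fun measurableSet_Ioi fun ρ _ => ?_
  have h1 : ∀ θ : ℝ, ρ • (circlePt ρ θ 1 * om (circlePt ρ θ)) =
      ρ ^ 2 * (om (circlePt ρ θ) * Real.sin θ) := fun θ => by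
    rw [circlePt_apply_one, smul_eq_mul]; ring
  simp_rw [h1]
  rw [integral_const_mul, ← intervalIntegral.integral_of_le hπ, modeSplit_circleInt_eq_pi_mul hb ρ]
  ring

/-- **The moment constraints on `a`, `b`**: `∫ x_j ω = 0` gives `∫₀^∞ r² a = 0`, `∫₀^∞ r² b = 0`.
[folklore]
[cite: GallaySverak2021, §2 proof of Thm 2.5, the angular Fourier splitting (source of the ARGUMENT implemented; this declaration is the cell’s own lemma, NOT a printed statement)] -/
theorem modeSplit_moment_constraints (hom : Continuous om)
    (hgc : ∃ (C : ℝ) (N : ℕ), ∀ x, |om x| ≤ C * (1 + ‖x‖) ^ N * Real.exp (-(‖x‖ ^ 2 / 4)))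
    (hm0 : ∫ x : EuclideanSpace ℝ (Fin 2), x 0 * om x = 0) (hm1 : ∫ x : EuclideanSpace ℝ (Fin 2), x 1 * om x = 0)
    (ha : ∀ r, a r = (1 / Real.pi) * ∫ θ in (-Real.pi)..Real.pi, om (circlePt r θ) * Real.cos θ)
    (hb : ∀ r, b r = (1 / Real.pi) * ∫ θ in (-Real.pi)..Real.pi, om (circlePt r θ) * Real.sin θ) :
    ∫ r in Ioi (0 : ℝ), r ^ 2 * a r = 0 ∧ ∫ r in Ioi (0 : ℝ), r ^ 2 * b r = 0 := by
  have h0 := modeSplit_integral_coord_zero_mul hom hgc ha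
  have h1 := modeSplit_integral_coord_one_mul hom hgc hb
  rw [hm0] at h0
  rw [hm1] at h1
  have hπ : (π : ℝ) ≠ 0 := Real.pi_pos.ne'
  exact ⟨(mul_eq_zero.1 h0.symm).resolve_left hπ, (mul_eq_zero.1 h1.symm).resolve_left hπ⟩

/-! ### Orthogonality in `L²(Φ⁻¹)` -/

/-- On the circle of radius `ρ > 0`: `∫ (a cos θ + b sin θ + ω_r)² − ω_r² dθ`-type identity, i.e.
`∫_{(-π,π]} ρ Φ(ρ)⁻¹ (ω² − ω_r²)(circlePt ρ θ) dθ = π Φ(ρ)⁻¹ (a² + b²) ρ`. [folklore]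
[cite: GallaySverak2021, §2 proof of Thm 2.5, the angular Fourier splitting (source of the ARGUMENT implemented; this declaration is the cell’s own lemma, NOT a printed statement)] -/
theorem modeSplit_circle_weighted_sq (hom : Continuous om)
    (ha : ∀ r, a r = (1 / Real.pi) * ∫ θ in (-Real.pi)..Real.pi, om (circlePt r θ) * Real.cos θ)
    (hb : ∀ r, b r = (1 / Real.pi) * ∫ θ in (-Real.pi)..Real.pi, om (circlePt r θ) * Real.sin θ)
    (hom₁ : ∀ x, om₁ x = (a ‖x‖ * x 0 + b ‖x‖ * x 1) / ‖x‖) (homr : ∀ x, omr x = om x - om₁ x)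
    (homrc : Continuous omr) {ρ : ℝ} (hρ : 0 < ρ) :
    ∫ θ in Ioc (-π) π, ρ • ((kerWeight ‖circlePt ρ θ‖)⁻¹ *
        (om (circlePt ρ θ) ^ 2 - omr (circlePt ρ θ) ^ 2)) =
      π * ((kerWeight ρ)⁻¹ * (a ρ ^ 2 + b ρ ^ 2) * ρ) := by
  have hπ : -π ≤ π := by linarith [Real.pi_pos]
  have key : ∀ θ : ℝ, ρ • ((kerWeight ‖circlePt ρ θ‖)⁻¹ *
      (om (circlePt ρ θ) ^ 2 - omr (circlePt ρ θ) ^ 2)) =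
      ρ * (kerWeight ρ)⁻¹ * (a ρ ^ 2 * Real.cos θ ^ 2 + b ρ ^ 2 * Real.sin θ ^ 2 +
        2 * (a ρ * b ρ) * (Real.sin θ * Real.cos θ) + 2 * a ρ * (omr (circlePt ρ θ) * Real.cos θ) +
        2 * b ρ * (omr (circlePt ρ θ) * Real.sin θ)) := by
    intro θ
    rw [norm_circlePt, abs_of_pos hρ, smul_eq_mul]
    have hom_eq : om (circlePt ρ θ) = a ρ * Real.cos θ + b ρ * Real.sin θ + omr (circlePt ρ θ) := by
      rw [homr, modeSplit_om₁_circlePt hom₁ hρ]; ring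
    rw [hom_eq]; ring
  simp_rw [key]
  rw [integral_const_mul, ← intervalIntegral.integral_of_le hπ]
  have i1 : IntervalIntegrable (fun θ => a ρ ^ 2 * Real.cos θ ^ 2) volume (-π) π :=
    (continuous_const.mul (Real.continuous_cos.pow 2)).intervalIntegrable _ _
  have i2 : IntervalIntegrable (fun θ => b ρ ^ 2 * Real.sin θ ^ 2) volume (-π) π :=
    (continuous_const.mul (Real.continuous_sin.pow 2)).intervalIntegrable _ _
  have i3 : IntervalIntegrable (fun θ => 2 * (a ρ * b ρ) * (Real.sin θ * Real.cos θ)) volume (-π) π :=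
    (continuous_const.mul (Real.continuous_sin.mul Real.continuous_cos)).intervalIntegrable _ _
  have i4 : IntervalIntegrable (fun θ => 2 * a ρ * (omr (circlePt ρ θ) * Real.cos θ)) volume (-π) π :=
    (modeSplit_intervalIntegrable_circle homrc Real.continuous_cos ρ _ _).const_mul _
  have i5 : IntervalIntegrable (fun θ => 2 * b ρ * (omr (circlePt ρ θ) * Real.sin θ)) volume (-π) π :=
    (modeSplit_intervalIntegrable_circle homrc Real.continuous_sin ρ _ _).const_mul _
  rw [intervalIntegral.integral_add (((i1.add i2).add i3).add i4) i5,
    intervalIntegral.integral_add ((i1.add i2).add i3) i4,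
    intervalIntegral.integral_add (i1.add i2) i3, intervalIntegral.integral_add i1 i2,
    intervalIntegral.integral_const_mul, intervalIntegral.integral_const_mul,
    intervalIntegral.integral_const_mul, intervalIntegral.integral_const_mul,
    intervalIntegral.integral_const_mul, modeSplit_integral_cos_sq, modeSplit_integral_sin_sq,
    modeSplit_integral_sin_mul_cos, modeSplit_omr_circle_cos hom ha hom₁ homr hρ,
    modeSplit_omr_circle_sin hom hb hom₁ homr hρ]
  ring

/-- **Orthogonality of the `k = ±1` part and the remainder in `L²(Φ⁻¹)`**:
`∫ Φ⁻¹ ω² = π ∫₀^∞ Φ(r)⁻¹ (a² + b²) r dr + ∫ Φ⁻¹ ω_r²`. [folklore]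
[cite: GallaySverak2021, §2 proof of Thm 2.5, the angular Fourier splitting (source of the ARGUMENT implemented; this declaration is the cell’s own lemma, NOT a printed statement)] -/
theorem modeSplit_weighted_sq_split (hom : Continuous om)
    (hgc : ∃ (C : ℝ) (N : ℕ), ∀ x, |om x| ≤ C * (1 + ‖x‖) ^ N * Real.exp (-(‖x‖ ^ 2 / 4)))
    (ha : ∀ r, a r = (1 / Real.pi) * ∫ θ in (-Real.pi)..Real.pi, om (circlePt r θ) * Real.cos θ)
    (hb : ∀ r, b r = (1 / Real.pi) * ∫ θ in (-Real.pi)..Real.pi, om (circlePt r θ) * Real.sin θ)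
    (hom₁ : ∀ x, om₁ x = (a ‖x‖ * x 0 + b ‖x‖ * x 1) / ‖x‖) (homr : ∀ x, omr x = om x - om₁ x) :
    ∫ x, (kerWeight ‖x‖)⁻¹ * om x ^ 2 =
      Real.pi * (∫ r in Set.Ioi (0 : ℝ), (kerWeight r)⁻¹ * (a r ^ 2 + b r ^ 2) * r) +
        ∫ x, (kerWeight ‖x‖)⁻¹ * omr x ^ 2 := by
  obtain ⟨C, N, hC⟩ := hgc
  have hac : Continuous a := modeSplit_continuous_coeff hom Real.continuous_cos ha
  have hbc : Continuous b := modeSplit_continuous_coeff hom Real.continuous_sin hb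
  have hom₁c : Continuous om₁ := modeSplit_continuous_om₁ hac hbc
    (modeSplit_coeff_zero modeSplit_integral_cos ha) (modeSplit_coeff_zero modeSplit_integral_sin hb) hom₁
  have homrc : Continuous omr := modeSplit_continuous_omr hom hom₁c homr
  have h1 : Integrable fun x : EuclideanSpace ℝ (Fin 2) => (kerWeight ‖x‖)⁻¹ * om x ^ 2 :=
    arnold_integrable_inv_kerWeight_mul_sq hom.aestronglyMeasurable ⟨C, N, hC⟩
  have h2 : Integrable fun x : EuclideanSpace ℝ (Fin 2) => (kerWeight ‖x‖)⁻¹ * omr x ^ 2 :=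
    arnold_integrable_inv_kerWeight_mul_sq homrc.aestronglyMeasurable
      ⟨5 * C, N, modeSplit_omr_gaussClass hC ha hb hom₁ homr⟩
  have h12 : Integrable fun x : EuclideanSpace ℝ (Fin 2) => (kerWeight ‖x‖)⁻¹ * (om x ^ 2 - omr x ^ 2) :=
    (h1.sub h2).congr (Eventually.of_forall fun x => by simp only [Pi.sub_apply]; ring)
  have hdiff : (∫ x, (kerWeight ‖x‖)⁻¹ * om x ^ 2) - ∫ x, (kerWeight ‖x‖)⁻¹ * omr x ^ 2 =
      ∫ x, (kerWeight ‖x‖)⁻¹ * (om x ^ 2 - omr x ^ 2) := by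
    rw [← integral_sub h1 h2]
    exact integral_congr_ae (Eventually.of_forall fun x => by ring)
  suffices h : ∫ x, (kerWeight ‖x‖)⁻¹ * (om x ^ 2 - omr x ^ 2) =
      π * ∫ r in Set.Ioi (0 : ℝ), (kerWeight r)⁻¹ * (a r ^ 2 + b r ^ 2) * r by linarith
  rw [integral_eq_integral_circlePt h12, ← integral_const_mul]
  exact setIntegral_congr_fun measurableSet_Ioi fun ρ hρ =>
    modeSplit_circle_weighted_sq hom ha hb hom₁ homr homrc hρ

end Polar

/-! ### The registered tools stub -/

end Literature.Analysis.GaussianVortexArnold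

end Part2

/-!
## Part 3 — port of `Summits/AnomalousDissipation/AnomalousDissipation/Theorems/MarginalStabilityChainStretchedVortexRowsStubLogPotentialTools.lean` (8 declarations kept)

# Helper `logPotential_contDiff_one` toward stub `stub_coreInverse` of the line
# `braid-closed-large-circulation-gluing` (crux stmt-AnomalousDissipation-3009, `MarginalStabilityChain.StretchedVortexRows`)

Toolkit for the logarithmic potential `ψ = N ∗ g`, `N(z) = (2π)⁻¹ log ‖z‖`, of a `C¹` density `g` of Gaussian
class on `ℝ² = EuclideanSpace ℝ (Fin 2)` (wave 3, helper `logPotential_neutral_energy`):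

* majorants of the logarithmic kernel (`|log ‖ξ − η‖| ≤ L₀(ξ − η) + log(1 + ‖ξ‖) + ‖η‖`, `L₀ = 𝟙_{‖z‖<1}(−log ‖z‖) ∈ L¹`),
  Gaussian shifts `e^{−‖ξ−η‖²/8} ≤ e^{‖ξ‖²/8} e^{−‖η‖²/16}`, integrability of `|log ‖η‖| e^{−‖η‖²/16}`;
* reduction of the Gaussian-class hypothesis `|g| + ‖Dg‖ ≤ A(1+‖η‖)^k G` to `|g|, ‖Dg‖ ≤ B e^{−‖η‖²/8}`;
* **`ψ ∈ C¹` with the derivative falling on `g`**: `ψ(ξ) = ∫ N(η) g(ξ − η) dη` (translation invariance), differentiation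
  under the integral sign (dominating function `|N(η)| B e^{(‖ξ₀‖+1)²/8} e^{−‖η‖²/16}` on the unit ball about `ξ₀`),
  continuity of the derivative by dominated convergence, `Dψ(ξ)[v] = ∫ N(ξ − η) Dg(η)[v] dη`;
* the crude growth bound `|ψ(ξ)| ≤ C (1 + log(1 + ‖ξ‖))`.

Not carried from this source module (not needed by the declarations re-homed here; their consumers are Summits-side): `exp_neg_norm_sub_sq_le`, `integrable_abs_log_norm_mul_exp`, `exists_one_add_norm_pow_mul_gaussVortexProfile_le`, `gaussClass_reduce`, `integral_logKernel_comm`, `gaussBound_shift_le`, `norm_logKernel_smul_fderiv_le`, `aestronglyMeasurable_logKernel_smul_fderiv`, `hasFDerivAt_logPotential`, `contDiff_one_logPotential_of_gaussBound`, `logPotential_contDiff_one`.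
-/

section Part3

open scoped RealInnerProductSpace _root_.Topology
open _root_.MeasureTheory WithLp _root_.Function _root_.Metric _root_.Filter _root_.Set

namespace Literature.Analysis.GaussianVortexArnold.StretchedVortexRows

open Literature.Analysis.FluidPDE

/-! ### Majorants of the logarithmic kernel -/
/-- The local logarithmic majorant `L₀ = 𝟙_{‖z‖<1} (−log ‖z‖)` is nonnegative. [folklore]
[cite: GallaySverak2021, §2 and §4.1 (context: potential theory of the planar Biot–Savart / logarithmic potential used in the proof of Thm 2.5; this declaration is the cell’s own lemma, NOT a printed statement)] -/
theorem indicator_neg_log_norm_nonneg (z : EuclideanSpace ℝ (Fin 2)) :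
    0 ≤ (ball (0 : EuclideanSpace ℝ (Fin 2)) 1).indicator (fun z => -Real.log ‖z‖) z := by
  refine indicator_nonneg (fun z hz => ?_) z
  rw [mem_ball_zero_iff] at hz
  have := Real.log_nonpos (norm_nonneg z) hz.le
  linarith

/-- `L₀ = 𝟙_{‖z‖<1} (−log ‖z‖)` is integrable on `ℝ²` (`log ‖z‖ ∈ L¹(B(0,1))` by polar coordinates). [folklore]
[cite: GallaySverak2021, §2 and §4.1 (context: potential theory of the planar Biot–Savart / logarithmic potential used in the proof of Thm 2.5; this declaration is the cell’s own lemma, NOT a printed statement)] -/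
theorem integrable_indicator_neg_log_norm :
    Integrable ((ball (0 : EuclideanSpace ℝ (Fin 2)) 1).indicator fun z => -Real.log ‖z‖) :=
  ((Literature.Analysis.FunctionSpaces.BMOLog.integrableOn_log_norm_ball
    (E := EuclideanSpace ℝ (Fin 2)) 1).neg).integrable_indicator measurableSet_ball

/-- `|log ‖z‖| ≤ L₀(z) + log(1 + ‖z‖)`. [folklore]
[cite: GallaySverak2021, §2 and §4.1 (context: potential theory of the planar Biot–Savart / logarithmic potential used in the proof of Thm 2.5; this declaration is the cell’s own lemma, NOT a printed statement)] -/
theorem abs_log_norm_le (z : EuclideanSpace ℝ (Fin 2)) :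
    |Real.log ‖z‖| ≤ (ball (0 : EuclideanSpace ℝ (Fin 2)) 1).indicator (fun z => -Real.log ‖z‖) z +
      Real.log (1 + ‖z‖) := by
  have h1 : 0 ≤ Real.log (1 + ‖z‖) := Real.log_nonneg (by linarith [norm_nonneg z])
  by_cases hz : ‖z‖ < 1
  · rw [indicator_of_mem (mem_ball_zero_iff.2 hz)]
    have := Real.log_nonpos (norm_nonneg z) hz.le
    rw [abs_of_nonpos this]
    linarith
  · rw [indicator_of_notMem (by rwa [mem_ball_zero_iff]), zero_add]
    rw [not_lt] at hz
    rw [abs_of_nonneg (Real.log_nonneg hz)]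
    exact Real.log_le_log (by linarith) (by linarith)

/-- `log(1 + ‖ξ − η‖) ≤ log(1 + ‖ξ‖) + ‖η‖`. [folklore]
[cite: GallaySverak2021, §2 and §4.1 (context: potential theory of the planar Biot–Savart / logarithmic potential used in the proof of Thm 2.5; this declaration is the cell’s own lemma, NOT a printed statement)] -/
theorem log_one_add_norm_sub_le (ξ η : EuclideanSpace ℝ (Fin 2)) :
    Real.log (1 + ‖ξ - η‖) ≤ Real.log (1 + ‖ξ‖) + ‖η‖ := by
  have h0 : 0 < 1 + ‖ξ‖ := by positivity
  have h1 : 0 < 1 + ‖η‖ := by positivity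
  have h2 : Real.log (1 + ‖η‖) ≤ ‖η‖ := by
    have := Real.log_le_sub_one_of_pos h1
    linarith
  calc Real.log (1 + ‖ξ - η‖) ≤ Real.log ((1 + ‖ξ‖) * (1 + ‖η‖)) := by
        refine Real.log_le_log (by positivity) ?_
        nlinarith [norm_sub_le ξ η, norm_nonneg ξ, norm_nonneg η]
    _ = Real.log (1 + ‖ξ‖) + Real.log (1 + ‖η‖) := Real.log_mul h0.ne' h1.ne'
    _ ≤ Real.log (1 + ‖ξ‖) + ‖η‖ := by linarith

/-- The three-term majorant `|log ‖ξ − η‖| ≤ L₀(ξ − η) + log(1 + ‖ξ‖) + ‖η‖`. [folklore]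
[cite: GallaySverak2021, §2 and §4.1 (context: potential theory of the planar Biot–Savart / logarithmic potential used in the proof of Thm 2.5; this declaration is the cell’s own lemma, NOT a printed statement)] -/
theorem abs_log_norm_sub_le (ξ η : EuclideanSpace ℝ (Fin 2)) :
    |Real.log ‖ξ - η‖| ≤ (ball (0 : EuclideanSpace ℝ (Fin 2)) 1).indicator (fun z => -Real.log ‖z‖) (ξ - η) +
      Real.log (1 + ‖ξ‖) + ‖η‖ := by
  have h1 := abs_log_norm_le (ξ - η)
  have h2 := log_one_add_norm_sub_le ξ η
  linarith

/-! ### Gaussian weights -/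
/-- Polynomial moments of the Gaussian `e^{−‖η‖²/16}` are finite. [folklore]
[cite: GallaySverak2021, §2 and §4.1 (context: potential theory of the planar Biot–Savart / logarithmic potential used in the proof of Thm 2.5; this declaration is the cell’s own lemma, NOT a printed statement)] -/
theorem integrable_one_add_norm_pow_mul_exp_sixteenth (N : ℕ) :
    Integrable fun η : EuclideanSpace ℝ (Fin 2) => (1 + ‖η‖) ^ N * Real.exp (-(1 / 16) * ‖η‖ ^ 2) :=
  PineauVicol2026.integrable_one_add_norm_pow_mul_exp_neg_mul_sq (by norm_num) N
/-- Polynomial moments of the Gaussian `e^{−‖η‖²/8}` are finite. [folklore]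
[cite: GallaySverak2021, §2 and §4.1 (context: potential theory of the planar Biot–Savart / logarithmic potential used in the proof of Thm 2.5; this declaration is the cell’s own lemma, NOT a printed statement)] -/
theorem integrable_one_add_norm_pow_mul_exp_eighth (N : ℕ) :
    Integrable fun η : EuclideanSpace ℝ (Fin 2) => (1 + ‖η‖) ^ N * Real.exp (-(1 / 8) * ‖η‖ ^ 2) :=
  PineauVicol2026.integrable_one_add_norm_pow_mul_exp_neg_mul_sq (by norm_num) N

section Potential

variable {B : ℝ} {g : EuclideanSpace ℝ (Fin 2) → ℝ} (hg : ContDiff ℝ 1 g)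
  (hg0 : ∀ η, |g η| ≤ B * Real.exp (-(1 / 8) * ‖η‖ ^ 2))
  (hg1 : ∀ η, ‖fderiv ℝ g η‖ ≤ B * Real.exp (-(1 / 8) * ‖η‖ ^ 2))

include hg0 in
/-- **Crude growth bound**: `|ψ(ξ)| ≤ C (1 + log(1 + ‖ξ‖))` for a density with `|g| ≤ B e^{−‖η‖²/8}`
(`|log ‖ξ−η‖| ≤ L₀(ξ−η) + log(1+‖ξ‖) + ‖η‖`, `L₀ ∈ L¹`, Gaussian moments). [folklore]
[cite: GallaySverak2021, §2 and §4.1 (context: potential theory of the planar Biot–Savart / logarithmic potential used in the proof of Thm 2.5; this declaration is the cell’s own lemma, NOT a printed statement)] -/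
theorem abs_logPotential_le :
    ∃ C : ℝ, 0 ≤ C ∧ ∀ ξ : EuclideanSpace ℝ (Fin 2),
      |∫ η, (2 * Real.pi)⁻¹ * Real.log ‖ξ - η‖ * g η| ≤ C * (1 + Real.log (1 + ‖ξ‖)) := by
  have hB : 0 ≤ B := (abs_nonneg _).trans ((hg0 0).trans (le_of_eq (by simp)))
  set I₀ : ℝ := ∫ z, (ball (0 : EuclideanSpace ℝ (Fin 2)) 1).indicator (fun z => -Real.log ‖z‖) z with hI₀def
  set I₂ : ℝ := ∫ η : EuclideanSpace ℝ (Fin 2), (1 + ‖η‖) ^ 1 * Real.exp (-(1 / 8) * ‖η‖ ^ 2) with hI₂def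
  have hI₀ : 0 ≤ I₀ := integral_nonneg indicator_neg_log_norm_nonneg
  have hI₂ : 0 ≤ I₂ := integral_nonneg fun η => by positivity
  refine ⟨(2 * Real.pi)⁻¹ * B * (I₀ + I₂), by positivity, fun ξ => ?_⟩
  have hc : (0:ℝ) ≤ (2 * Real.pi)⁻¹ := by positivity
  have hL : 0 ≤ Real.log (1 + ‖ξ‖) := Real.log_nonneg (by linarith [norm_nonneg ξ])
  have hi0 : Integrable fun η : EuclideanSpace ℝ (Fin 2) =>
      (ball (0 : EuclideanSpace ℝ (Fin 2)) 1).indicator (fun z => -Real.log ‖z‖) (ξ - η) :=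
    integrable_indicator_neg_log_norm.comp_sub_left ξ
  have hi2 := integrable_one_add_norm_pow_mul_exp_eighth 1
  set F : EuclideanSpace ℝ (Fin 2) → ℝ := fun η => (2 * Real.pi)⁻¹ * B *
    ((ball (0 : EuclideanSpace ℝ (Fin 2)) 1).indicator (fun z => -Real.log ‖z‖) (ξ - η) +
      Real.log (1 + ‖ξ‖) * ((1 + ‖η‖) ^ 1 * Real.exp (-(1 / 8) * ‖η‖ ^ 2)) +
      (1 + ‖η‖) ^ 1 * Real.exp (-(1 / 8) * ‖η‖ ^ 2)) with hF
  have hi1 : Integrable fun η : EuclideanSpace ℝ (Fin 2) =>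
      Real.log (1 + ‖ξ‖) * ((1 + ‖η‖) ^ 1 * Real.exp (-(1 / 8) * ‖η‖ ^ 2)) := hi2.const_mul _
  have hi01 : Integrable fun η : EuclideanSpace ℝ (Fin 2) =>
      (ball (0 : EuclideanSpace ℝ (Fin 2)) 1).indicator (fun z => -Real.log ‖z‖) (ξ - η) +
        Real.log (1 + ‖ξ‖) * ((1 + ‖η‖) ^ 1 * Real.exp (-(1 / 8) * ‖η‖ ^ 2)) := hi0.add hi1
  have hFint : Integrable F := (hi01.add hi2).const_mul _
  have hFI : ∫ η, F η = (2 * Real.pi)⁻¹ * B * (I₀ + Real.log (1 + ‖ξ‖) * I₂ + I₂) := by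
    simp only [hF]
    rw [integral_const_mul, integral_add hi01 hi2, integral_add hi0 hi1, integral_const_mul,
      integral_sub_left_eq_self
        ((ball (0 : EuclideanSpace ℝ (Fin 2)) 1).indicator (fun z => -Real.log ‖z‖)) volume ξ]
  have hpt : ∀ η, ‖(2 * Real.pi)⁻¹ * Real.log ‖ξ - η‖ * g η‖ ≤ F η := by
    intro η
    rw [Real.norm_eq_abs, abs_mul, abs_mul, abs_of_nonneg hc]
    have h1 := abs_log_norm_sub_le ξ η
    have h2 := hg0 η
    have h3 : Real.exp (-(1 / 8) * ‖η‖ ^ 2) ≤ 1 := Real.exp_le_one_iff.2 (by nlinarith [norm_nonneg η])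
    have h4 := indicator_neg_log_norm_nonneg (ξ - η)
    have h5 : (0:ℝ) ≤ Real.exp (-(1 / 8) * ‖η‖ ^ 2) := (Real.exp_pos _).le
    set L0 := (ball (0 : EuclideanSpace ℝ (Fin 2)) 1).indicator (fun z => -Real.log ‖z‖) (ξ - η) with hL0
    set e := Real.exp (-(1 / 8) * ‖η‖ ^ 2) with he
    have h6 : 0 ≤ L0 + Real.log (1 + ‖ξ‖) + ‖η‖ := by positivity
    have i1 : L0 * e ≤ L0 := mul_le_of_le_one_right h4 h3
    have i2 : Real.log (1 + ‖ξ‖) * e ≤ Real.log (1 + ‖ξ‖) * ((1 + ‖η‖) ^ 1 * e) :=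
      mul_le_mul_of_nonneg_left (by rw [pow_one]; nlinarith [norm_nonneg η]) hL
    have i3 : ‖η‖ * e ≤ (1 + ‖η‖) ^ 1 * e := by rw [pow_one]; nlinarith
    calc (2 * Real.pi)⁻¹ * |Real.log ‖ξ - η‖| * |g η|
        ≤ (2 * Real.pi)⁻¹ * (L0 + Real.log (1 + ‖ξ‖) + ‖η‖) * (B * e) :=
          mul_le_mul (mul_le_mul_of_nonneg_left h1 hc) h2 (abs_nonneg _) (mul_nonneg hc h6)
      _ = (2 * Real.pi)⁻¹ * B * (L0 * e + Real.log (1 + ‖ξ‖) * e + ‖η‖ * e) := by ring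
      _ ≤ (2 * Real.pi)⁻¹ * B * (L0 + Real.log (1 + ‖ξ‖) * ((1 + ‖η‖) ^ 1 * e) + (1 + ‖η‖) ^ 1 * e) :=
          mul_le_mul_of_nonneg_left (by linarith) (mul_nonneg hc hB)
      _ = F η := by simp only [hF, hL0, he]
  calc |∫ η, (2 * Real.pi)⁻¹ * Real.log ‖ξ - η‖ * g η|
      = ‖∫ η, (2 * Real.pi)⁻¹ * Real.log ‖ξ - η‖ * g η‖ := (Real.norm_eq_abs _).symm
    _ ≤ ∫ η, F η := norm_integral_le_of_norm_le hFint (Eventually.of_forall hpt)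
    _ = (2 * Real.pi)⁻¹ * B * (I₀ + Real.log (1 + ‖ξ‖) * I₂ + I₂) := hFI
    _ ≤ (2 * Real.pi)⁻¹ * B * ((I₀ + I₂) * (1 + Real.log (1 + ‖ξ‖))) :=
        mul_le_mul_of_nonneg_left (by nlinarith) (mul_nonneg hc hB)
    _ = _ := by ring

end Potential

/-! ### The registered helper -/

end Literature.Analysis.GaussianVortexArnold.StretchedVortexRows

end Part3

/-!
## Part 4 — port of `Summits/NavierStokesRegularity/NavierStokesRegularity/Theorems/FilamentSkeletonRssCoreLinearInvertibilityArnoldModeSplitToolsC.lean` (10 declarations kept)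

# Tools for stub `stub_arnoldModeSplit` (crux `CoreLinearInvertibility`, stmt-NavierStokesRegularity-17973,
# route `FilamentSkeletonRss`, line `Sketch`) — part C: the `k = ±1` circle moments of the logarithmic kernel

For the planar logarithmic kernel on the circle of radius `r > 0` and a source point `η`, `|η| ≠ r`:

  `∫_{-π}^{π} log |circlePt r θ − η| cos θ dθ = −π t(r, |η|) η₀/|η|`,
  `∫_{-π}^{π} log |circlePt r θ − η| sin θ dθ = −π t(r, |η|) η₁/|η|`,   `t(r, ρ) = min(r,ρ)/max(r,ρ)`

(`modeSplit_integral_log_circle_cos/sin`): indeed `|circlePt r θ − circlePt ρ φ| = max(r,ρ) |1 − t e^{i(θ−φ)}|`,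
so `log |circlePt r θ − η| = log max(r,ρ) + ℓ_t(θ − φ)` with the regularised circle kernel
`ℓ_t(v) = log |1 − t e^{iv}|` of `Literature.Analysis.Potential.CircleLogKernel`, whose first Fourier moments
are `∫ ℓ_t cos = −π t`, `∫ ℓ_t sin = 0` (loc. cit.). This is the mode `k = ±1` case of the multipole
expansion `log|ξ − η| = log max − Σ_{m ≥ 1} tᵐ cos m(θ − φ)/m` behind Gallay–Šverák's per-mode potential
formula (arXiv:2110.13739, §3, (Bkdef)). Also: a bound `∫ |log|x − y|| |f(y)| dy ≤ K(1 + |x|)` for a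
Gaussian-bounded continuous `f`, and the integrability on `(−π, π] × ℝ²` of
`(θ, y) ↦ w(θ) N(circlePt r θ − y) f(y)` (Fubini for circle integrals of `ψ_f = N ∗ f`). Folklore.

Not carried from this source module (not needed by the declarations re-homed here; their consumers are Summits-side): `stub_arnoldModeSplitToolsC`.
-/

section Part4

namespace Literature.Analysis.GaussianVortexArnold

open _root_.Set _root_.Function _root_.Filter _root_.MeasureTheory _root_.Topology _root_.Metric
open Literature.Analysis.FluidPDE Literature.Analysis.Potential
open Literature.Analysis.GaussianVortexArnold.StretchedVortexRows
open scoped _root_.Real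

/-! ### The distance between two circle points -/

/-- **`|circlePt r θ − circlePt ρ φ| = max(r,ρ) · |1 − t e^{i(θ−φ)}|`**, `t = min(r,ρ)/max(r,ρ)`
(`r > 0`; both squares equal `r² + ρ² − 2rρ cos(θ − φ)`). [folklore]
[cite: GallaySverak2021, §2 proof of Thm 2.5, the angular Fourier splitting (source of the ARGUMENT implemented; this declaration is the cell’s own lemma, NOT a printed statement)] -/
theorem modeSplit_norm_circlePt_sub_circlePt {r : ℝ} (hr : 0 < r) (ρ θ φ : ℝ) :
    ‖circlePt r θ - circlePt ρ φ‖ = max r ρ *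
      ‖1 - ((min r ρ / max r ρ : ℝ) : ℂ) * Complex.exp (((θ - φ : ℝ) : ℂ) * Complex.I)‖ := by
  have hM : 0 < max r ρ := lt_max_of_lt_left hr
  have hsq1 : ‖circlePt r θ - circlePt ρ φ‖ ^ 2 = r ^ 2 + ρ ^ 2 - 2 * r * ρ * Real.cos (θ - φ) := by
    rw [EuclideanSpace.norm_sq_eq]
    simp only [Fin.sum_univ_two, PiLp.sub_apply, circlePt_apply_zero, circlePt_apply_one,
      Real.norm_eq_abs, sq_abs, Real.cos_sub]
    linear_combination r ^ 2 * Real.sin_sq_add_cos_sq θ + ρ ^ 2 * Real.sin_sq_add_cos_sq φ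
  have hsq2 : (max r ρ * ‖1 - ((min r ρ / max r ρ : ℝ) : ℂ) *
      Complex.exp (((θ - φ : ℝ) : ℂ) * Complex.I)‖) ^ 2 = r ^ 2 + ρ ^ 2 - 2 * r * ρ * Real.cos (θ - φ) := by
    rw [mul_pow, norm_one_sub_mul_exp_sq]
    rcases le_total r ρ with h | h
    · have hρ0 : ρ ≠ 0 := (lt_of_lt_of_le hr h).ne'
      rw [max_eq_right h, min_eq_left h]
      field_simp
      ring
    · rw [max_eq_left h, min_eq_right h]
      field_simp
      ring
  exact (sq_eq_sq₀ (norm_nonneg _) (by positivity)).1 (hsq1.trans hsq2.symm)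

/-- **The logarithmic kernel on a circle**: for `r > 0` and `|η| ≠ r`,
`log |circlePt r θ − η| = log max(r, |η|) + ℓ_t(θ − arg η)`, `t = min(r,|η|)/max(r,|η|) < 1`,
`ℓ_t = circleLogKernelR t`. [folklore]
[cite: GallaySverak2021, §2 proof of Thm 2.5, the angular Fourier splitting (source of the ARGUMENT implemented; this declaration is the cell’s own lemma, NOT a printed statement)] -/
theorem modeSplit_log_norm_circlePt_sub {r : ℝ} (hr : 0 < r) {η : EuclideanSpace ℝ (Fin 2)} (hη : ‖η‖ ≠ r) (θ : ℝ) :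
    Real.log ‖circlePt r θ - η‖ = Real.log (max r ‖η‖) +
      circleLogKernelR (min r ‖η‖ / max r ‖η‖) (θ - Complex.arg (cplx η)) := by
  have hM : 0 < max r ‖η‖ := lt_max_of_lt_left hr
  have ht0 : 0 ≤ min r ‖η‖ / max r ‖η‖ := div_nonneg (le_min hr.le (norm_nonneg η)) hM.le
  have ht1 : min r ‖η‖ / max r ‖η‖ < 1 := (div_lt_one hM).2 (min_lt_max.2 (Ne.symm hη))
  have hpos : 0 < ‖1 - ((min r ‖η‖ / max r ‖η‖ : ℝ) : ℂ) *
      Complex.exp (((θ - Complex.arg (cplx η) : ℝ) : ℂ) * Complex.I)‖ :=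
    lt_of_lt_of_le (by linarith) (one_sub_le_norm_one_sub_mul_exp ht0 _)
  conv_lhs => rw [← circlePt_norm_arg η]
  rw [modeSplit_norm_circlePt_sub_circlePt hr, Real.log_mul hM.ne' hpos.ne', circleLogKernelR]

/-! ### First Fourier moments of the regularised circle kernel, shifted -/

/-- `∫_{-π}^{π} ℓ_t(β − u) cos β dβ = −π t cos u` (`0 ≤ t < 1`). [folklore]
[cite: GallaySverak2021, §2 proof of Thm 2.5, the angular Fourier splitting (source of the ARGUMENT implemented; this declaration is the cell’s own lemma, NOT a printed statement)] -/
theorem modeSplit_integral_circleLogKernelR_sub_mul_cos {t : ℝ} (ht0 : 0 ≤ t) (ht1 : t < 1) (u : ℝ) :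
    ∫ β in (-π)..π, circleLogKernelR t (β - u) * Real.cos β = -π * t * Real.cos u := by
  have h := integral_circleLogKernelR_sub_mul ht0 ht1 u 0 1
  simp only [zero_add, one_mul, mul_one] at h
  simp_rw [circleLogKernelR_sub_comm t _ u]
  exact h

/-- `∫_{-π}^{π} ℓ_t(β − u) sin β dβ = −π t sin u` (`0 ≤ t < 1`; shift by `u` using periodicity, then
`sin(v + u) = sin v cos u + cos v sin u`, `∫ ℓ_t sin = 0`, `∫ ℓ_t cos = −π t`). [folklore]
[cite: GallaySverak2021, §2 proof of Thm 2.5, the angular Fourier splitting (source of the ARGUMENT implemented; this declaration is the cell’s own lemma, NOT a printed statement)] -/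
theorem modeSplit_integral_circleLogKernelR_sub_mul_sin {t : ℝ} (ht0 : 0 ≤ t) (ht1 : t < 1) (u : ℝ) :
    ∫ β in (-π)..π, circleLogKernelR t (β - u) * Real.sin β = -π * t * Real.sin u := by
  -- adapted from `Literature.Analysis.Potential.integral_circleLogKernelR_sub_mul`
  set H : ℝ → ℝ := fun v => circleLogKernelR t v * Real.sin (v + u) with hH
  have h1 : (∫ β in (-π)..π, circleLogKernelR t (β - u) * Real.sin β) = ∫ β in (-π)..π, H (β - u) := by
    refine intervalIntegral.integral_congr fun β _ => ?_
    simp only [hH, sub_add_cancel]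
  have hp : Function.Periodic H (2 * π) := fun v => by
    simp only [hH, periodic_circleLogKernelR t v, add_right_comm v (2 * π) u, Real.sin_add_two_pi]
  rw [h1, intervalIntegral.integral_comp_sub_right H u, show π - u = (-π - u) + 2 * π by ring,
    hp.intervalIntegral_add_eq (-π - u) (-π), show -π + 2 * π = π by ring]
  have h2 : ∀ v, H v = Real.cos u * (circleLogKernelR t v * Real.sin v) +
      Real.sin u * (circleLogKernelR t v * Real.cos v) := fun v => by
    simp only [hH, Real.sin_add]; ring
  simp_rw [h2]
  have hi1 := intervalIntegrable_circleLogKernelR t (-π) π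
  have hi2 : IntervalIntegrable (fun v => circleLogKernelR t v * Real.cos v) volume (-π) π :=
    hi1.mul_continuousOn Real.continuous_cos.continuousOn
  have hi3 : IntervalIntegrable (fun v => circleLogKernelR t v * Real.sin v) volume (-π) π :=
    hi1.mul_continuousOn Real.continuous_sin.continuousOn
  rw [intervalIntegral.integral_add (hi3.const_mul _) (hi2.const_mul _),
    intervalIntegral.integral_const_mul, intervalIntegral.integral_const_mul,
    integral_circleLogKernelR_mul_sin, integral_circleLogKernelR_mul_cos ht0 ht1]
  ring

/-! ### The `k = ±1` circle moments of the logarithmic kernel -/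

/-- `η₀ = |η| cos(arg η)`, `η₁ = |η| sin(arg η)`. [folklore]
[cite: GallaySverak2021, §2 proof of Thm 2.5, the angular Fourier splitting (source of the ARGUMENT implemented; this declaration is the cell’s own lemma, NOT a printed statement)] -/
theorem modeSplit_coord_eq_norm_mul (η : EuclideanSpace ℝ (Fin 2)) :
    η 0 = ‖η‖ * Real.cos (Complex.arg (cplx η)) ∧ η 1 = ‖η‖ * Real.sin (Complex.arg (cplx η)) := by
  have h := circlePt_norm_arg η
  constructor
  · calc η 0 = circlePt ‖η‖ (Complex.arg (cplx η)) 0 := by rw [h]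
      _ = ‖η‖ * Real.cos (Complex.arg (cplx η)) := rfl
  · calc η 1 = circlePt ‖η‖ (Complex.arg (cplx η)) 1 := by rw [h]
      _ = ‖η‖ * Real.sin (Complex.arg (cplx η)) := rfl

/-- **`∫_{-π}^{π} log |circlePt r θ − η| cos θ dθ = −π t(r,|η|) η₀/|η|`** for `r > 0`, `|η| ≠ r`,
`t(r,ρ) = min(r,ρ)/max(r,ρ)`. [folklore]
[cite: GallaySverak2021, §2 proof of Thm 2.5, the angular Fourier splitting (source of the ARGUMENT implemented; this declaration is the cell’s own lemma, NOT a printed statement)] -/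
theorem modeSplit_integral_log_circle_cos {r : ℝ} (hr : 0 < r) {η : EuclideanSpace ℝ (Fin 2)} (hη : ‖η‖ ≠ r) :
    ∫ θ in (-π)..π, Real.log ‖circlePt r θ - η‖ * Real.cos θ =
      -π * (min r ‖η‖ / max r ‖η‖) * (η 0 / ‖η‖) := by
  set t := min r ‖η‖ / max r ‖η‖ with ht
  have hM : 0 < max r ‖η‖ := lt_max_of_lt_left hr
  have ht0 : 0 ≤ t := div_nonneg (le_min hr.le (norm_nonneg η)) hM.le
  have ht1 : t < 1 := (div_lt_one hM).2 (min_lt_max.2 (Ne.symm hη))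
  simp_rw [modeSplit_log_norm_circlePt_sub hr hη, add_mul]
  have i1 : IntervalIntegrable (fun θ => Real.log (max r ‖η‖) * Real.cos θ) volume (-π) π :=
    (continuous_const.mul Real.continuous_cos).intervalIntegrable _ _
  have i2 : IntervalIntegrable (fun θ => circleLogKernelR t (θ - Complex.arg (cplx η)) * Real.cos θ)
      volume (-π) π :=
    (intervalIntegrable_circleLogKernelR_sub t _ _ _).mul_continuousOn Real.continuous_cos.continuousOn
  rw [intervalIntegral.integral_add i1 i2, intervalIntegral.integral_const_mul, modeSplit_integral_cos,
    mul_zero, zero_add, modeSplit_integral_circleLogKernelR_sub_mul_cos ht0 ht1]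
  rcases (norm_nonneg η).eq_or_lt with h0 | hpos
  · have : t = 0 := by rw [ht, ← h0, min_eq_right hr.le, zero_div]
    rw [this]; ring
  · rw [(modeSplit_coord_eq_norm_mul η).1]
    field_simp

/-- **`∫_{-π}^{π} log |circlePt r θ − η| sin θ dθ = −π t(r,|η|) η₁/|η|`** for `r > 0`, `|η| ≠ r`. [folklore]
[cite: GallaySverak2021, §2 proof of Thm 2.5, the angular Fourier splitting (source of the ARGUMENT implemented; this declaration is the cell’s own lemma, NOT a printed statement)] -/
theorem modeSplit_integral_log_circle_sin {r : ℝ} (hr : 0 < r) {η : EuclideanSpace ℝ (Fin 2)} (hη : ‖η‖ ≠ r) :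
    ∫ θ in (-π)..π, Real.log ‖circlePt r θ - η‖ * Real.sin θ =
      -π * (min r ‖η‖ / max r ‖η‖) * (η 1 / ‖η‖) := by
  set t := min r ‖η‖ / max r ‖η‖ with ht
  have hM : 0 < max r ‖η‖ := lt_max_of_lt_left hr
  have ht0 : 0 ≤ t := div_nonneg (le_min hr.le (norm_nonneg η)) hM.le
  have ht1 : t < 1 := (div_lt_one hM).2 (min_lt_max.2 (Ne.symm hη))
  simp_rw [modeSplit_log_norm_circlePt_sub hr hη, add_mul]
  have i1 : IntervalIntegrable (fun θ => Real.log (max r ‖η‖) * Real.sin θ) volume (-π) π :=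
    (continuous_const.mul Real.continuous_sin).intervalIntegrable _ _
  have i2 : IntervalIntegrable (fun θ => circleLogKernelR t (θ - Complex.arg (cplx η)) * Real.sin θ)
      volume (-π) π :=
    (intervalIntegrable_circleLogKernelR_sub t _ _ _).mul_continuousOn Real.continuous_sin.continuousOn
  rw [intervalIntegral.integral_add i1 i2, intervalIntegral.integral_const_mul, modeSplit_integral_sin,
    mul_zero, zero_add, modeSplit_integral_circleLogKernelR_sub_mul_sin ht0 ht1]
  rcases (norm_nonneg η).eq_or_lt with h0 | hpos
  · have : t = 0 := by rw [ht, ← h0, min_eq_right hr.le, zero_div]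
    rw [this]; ring
  · rw [(modeSplit_coord_eq_norm_mul η).2]
    field_simp

/-- For `r, s > 0`: `min(r,s)/max(r,s) = min(r/s, s/r)`. [folklore]
[cite: GallaySverak2021, §2 proof of Thm 2.5, the angular Fourier splitting (source of the ARGUMENT implemented; this declaration is the cell’s own lemma, NOT a printed statement)] -/
theorem modeSplit_min_div_max {r s : ℝ} (hr : 0 < r) (hs : 0 < s) :
    min r s / max r s = min (r / s) (s / r) := by
  rcases le_total r s with h | h
  · rw [min_eq_left h, max_eq_right h, min_eq_left]
    exact ((div_le_one hs).2 h).trans ((one_le_div hr).2 h)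
  · rw [min_eq_right h, max_eq_left h, min_eq_right]
    exact ((div_le_one hr).2 h).trans ((one_le_div hs).2 h)

/-! ### The logarithmic kernel against a Gaussian-bounded density: a bound linear in `|x|` -/

/-- **`∫ |log |x − y|| |f(y)| dy ≤ K (1 + |x|)`** for a continuous `f` with `|f| ≤ B e^{−|y|²/8}`, with
integrability of the integrand (`|log t| ≤ t⁻¹ + t`, the uniform bound on `∫ |f(y)|/|x − y| dy`, and
`|x − y| ≤ |x| + |y|`). [folklore]
[cite: GallaySverak2021, §2 proof of Thm 2.5, the angular Fourier splitting (source of the ARGUMENT implemented; this declaration is the cell’s own lemma, NOT a printed statement)] -/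
theorem modeSplit_integral_abs_log_mul_le {f : EuclideanSpace ℝ (Fin 2) → ℝ} (hf : Continuous f) {B : ℝ}
    (hB : ∀ y, |f y| ≤ B * Real.exp (-(1 / 8) * ‖y‖ ^ 2)) :
    ∃ K : ℝ, 0 ≤ K ∧ ∀ x : EuclideanSpace ℝ (Fin 2), Integrable (fun y => |Real.log ‖x - y‖| * |f y|) ∧
      ∫ y, |Real.log ‖x - y‖| * |f y| ≤ K * (1 + ‖x‖) := by
  have hB0 : 0 ≤ B := (abs_nonneg _).trans ((hB 0).trans (le_of_eq (by simp)))
  have hfi : Integrable f := by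
    refine ((integrable_one_add_norm_pow_mul_exp_eighth 0).const_mul B).mono' hf.aestronglyMeasurable
      (Eventually.of_forall fun y => ?_)
    rw [Real.norm_eq_abs, pow_zero, one_mul]; exact hB y
  have hfy : Integrable fun y : EuclideanSpace ℝ (Fin 2) => ‖y‖ * |f y| := by
    refine ((integrable_one_add_norm_pow_mul_exp_eighth 1).const_mul B).mono'
      (continuous_norm.mul (continuous_abs.comp hf)).aestronglyMeasurable (Eventually.of_forall fun y => ?_)
    rw [Real.norm_of_nonneg (by positivity), pow_one]
    calc ‖y‖ * |f y| ≤ (1 + ‖y‖) * (B * Real.exp (-(1 / 8) * ‖y‖ ^ 2)) :=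
          mul_le_mul (by linarith [norm_nonneg y]) (hB y) (abs_nonneg _) (by positivity)
      _ = _ := by ring
  set I : ℝ := ∫ z, indicator (ball (0 : EuclideanSpace ℝ (Fin 2)) 1) (fun z => ‖z‖⁻¹) z with hI
  set F : ℝ := ∫ y, |f y| with hF
  set G : ℝ := ∫ y, ‖y‖ * |f y| with hG
  have hI0 : 0 ≤ I := integral_nonneg indicator_inv_norm_nonneg
  have hF0 : 0 ≤ F := integral_nonneg fun y => abs_nonneg _
  have hG0 : 0 ≤ G := integral_nonneg fun y => by positivity
  refine ⟨B * I + F + G, by positivity, fun x => ?_⟩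
  have hBle : ∀ y, |f y| ≤ B := fun y =>
    (hB y).trans (mul_le_of_le_one_right hB0 (Real.exp_le_one_iff.2 (by nlinarith [norm_nonneg y])))
  obtain ⟨h1, h1le⟩ := integral_mul_inv_norm_sub_le hfi.abs (fun y => abs_nonneg _) hBle x
  have hmeas : AEStronglyMeasurable (fun y => |Real.log ‖x - y‖| * |f y|) volume :=
    (((measurable_const.sub measurable_id).norm.log.abs).mul (hf.measurable.abs)).aestronglyMeasurable
  have hpt : ∀ y, |Real.log ‖x - y‖| * |f y| ≤
      |f y| * ‖x - y‖⁻¹ + (‖x‖ * |f y| + ‖y‖ * |f y|) := by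
    intro y
    have h0 : 0 ≤ |f y| := abs_nonneg _
    rcases (norm_nonneg (x - y)).eq_or_lt with hz | hz
    · rw [← hz, Real.log_zero, abs_zero, zero_mul]; positivity
    · have hl := abs_log_le_inv_add_self hz
      have hxy : ‖x - y‖ ≤ ‖x‖ + ‖y‖ := norm_sub_le x y
      calc |Real.log ‖x - y‖| * |f y| ≤ (‖x - y‖⁻¹ + ‖x - y‖) * |f y| :=
            mul_le_mul_of_nonneg_right hl h0
        _ ≤ (‖x - y‖⁻¹ + (‖x‖ + ‖y‖)) * |f y| := by gcongr
        _ = _ := by ring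
  have hdom : Integrable fun y => |f y| * ‖x - y‖⁻¹ + (‖x‖ * |f y| + ‖y‖ * |f y|) :=
    h1.add ((hfi.abs.const_mul _).add hfy)
  have hint : Integrable fun y => |Real.log ‖x - y‖| * |f y| :=
    hdom.mono' hmeas (Eventually.of_forall fun y => by
      rw [Real.norm_of_nonneg (by positivity)]; exact hpt y)
  refine ⟨hint, ?_⟩
  calc ∫ y, |Real.log ‖x - y‖| * |f y|
      ≤ ∫ y, |f y| * ‖x - y‖⁻¹ + (‖x‖ * |f y| + ‖y‖ * |f y|) := integral_mono hint hdom hpt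
    _ = (∫ y, |f y| * ‖x - y‖⁻¹) + (‖x‖ * F + G) := by
        have hi1 : Integrable fun y => ‖x‖ * |f y| := hfi.abs.const_mul _
        have hi2 : Integrable fun y => ‖x‖ * |f y| + ‖y‖ * |f y| := hi1.add hfy
        rw [integral_add h1 hi2, integral_add hi1 hfy, integral_const_mul]
    _ ≤ (B * I + F) + (‖x‖ * F + G) := by gcongr
    _ ≤ (B * I + F + G) * (1 + ‖x‖) := by
        nlinarith [norm_nonneg x, mul_nonneg (norm_nonneg x) (add_nonneg (mul_nonneg hB0 hI0) hG0)]

/-! ### Fubini on `(−π, π] × ℝ²` for circle integrals of the potential -/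

/-- **Integrability on `(−π, π] × ℝ²`** of `(θ, y) ↦ w(θ) N(circlePt r θ − y) f(y)`, `N = (2π)⁻¹ log |·|`,
for a continuous Gaussian-bounded `f` and a continuous weight `|w| ≤ 1` (the `y`-integrals of the
absolute value are bounded uniformly on the circle). [folklore]
[cite: GallaySverak2021, §2 proof of Thm 2.5, the angular Fourier splitting (source of the ARGUMENT implemented; this declaration is the cell’s own lemma, NOT a printed statement)] -/
theorem modeSplit_integrable_circle_logKernel {f : EuclideanSpace ℝ (Fin 2) → ℝ} (hf : Continuous f) {B : ℝ}
    (hB : ∀ y, |f y| ≤ B * Real.exp (-(1 / 8) * ‖y‖ ^ 2)) (r : ℝ) {w : ℝ → ℝ} (hw : Continuous w)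
    (hw1 : ∀ θ, |w θ| ≤ 1) :
    Integrable (uncurry fun (θ : ℝ) (y : EuclideanSpace ℝ (Fin 2)) =>
        w θ * ((2 * Real.pi)⁻¹ * Real.log ‖circlePt r θ - y‖ * f y))
      ((volume.restrict (Ioc (-π) π)).prod volume) := by
  obtain ⟨K, hK0, hK⟩ := modeSplit_integral_abs_log_mul_le hf hB
  have hmeas : Measurable (uncurry fun (θ : ℝ) (y : EuclideanSpace ℝ (Fin 2)) =>
      w θ * ((2 * Real.pi)⁻¹ * Real.log ‖circlePt r θ - y‖ * f y)) :=
    (hw.measurable.comp measurable_fst).mul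
      ((measurable_const.mul ((((continuous_circlePt r).measurable.comp measurable_fst).sub
        measurable_snd).norm.log)).mul (hf.measurable.comp measurable_snd))
  have hpt : ∀ (θ : ℝ) (y : EuclideanSpace ℝ (Fin 2)), ‖w θ * ((2 * Real.pi)⁻¹ * Real.log ‖circlePt r θ - y‖ * f y)‖ ≤
      (2 * π)⁻¹ * (|Real.log ‖circlePt r θ - y‖| * |f y|) := by
    intro θ y
    rw [Real.norm_eq_abs, abs_mul, abs_mul, abs_mul, abs_of_pos (by positivity : (0 : ℝ) < (2 * π)⁻¹)]
    calc |w θ| * ((2 * π)⁻¹ * |Real.log ‖circlePt r θ - y‖| * |f y|)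
        ≤ 1 * ((2 * π)⁻¹ * |Real.log ‖circlePt r θ - y‖| * |f y|) := by gcongr; exact hw1 θ
      _ = _ := by ring
  rw [integrable_prod_iff hmeas.aestronglyMeasurable]
  constructor
  · refine Eventually.of_forall fun θ => ?_
    exact ((hK (circlePt r θ)).1.const_mul ((2 * π)⁻¹)).mono'
      (hmeas.comp measurable_prodMk_left).aestronglyMeasurable (Eventually.of_forall fun y => hpt θ y)
  · refine (integrable_const ((2 * π)⁻¹ * (K * (1 + |r|)))).mono'
      hmeas.aestronglyMeasurable.norm.integral_prod_right' (Eventually.of_forall fun θ => ?_)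
    rw [Real.norm_of_nonneg (integral_nonneg fun y => norm_nonneg _)]
    calc ∫ y, ‖uncurry (fun (θ : ℝ) (y : EuclideanSpace ℝ (Fin 2)) =>
            w θ * ((2 * Real.pi)⁻¹ * Real.log ‖circlePt r θ - y‖ * f y)) (θ, y)‖
        ≤ ∫ y, (2 * π)⁻¹ * (|Real.log ‖circlePt r θ - y‖| * |f y|) :=
          integral_mono_of_nonneg (Eventually.of_forall fun y => norm_nonneg _)
            ((hK _).1.const_mul _) (Eventually.of_forall fun y => hpt θ y)
      _ = (2 * π)⁻¹ * ∫ y, |Real.log ‖circlePt r θ - y‖| * |f y| := integral_const_mul _ _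
      _ ≤ (2 * π)⁻¹ * (K * (1 + ‖circlePt r θ‖)) := by gcongr; exact (hK _).2
      _ = (2 * π)⁻¹ * (K * (1 + |r|)) := by rw [norm_circlePt]

/-! ### The registered tools stub -/

end Literature.Analysis.GaussianVortexArnold

end Part4

/-!
## Part 5 — port of `Summits/NavierStokesRegularity/NavierStokesRegularity/Theorems/FilamentSkeletonRssCoreLinearInvertibilityOddArnoldToolsB.lean` (3 declarations kept)

# Tools for stub `stub_oddSymmetrizerBoundedBelow` (crux `CoreLinearInvertibility`,
# stmt-NavierStokesRegularity-17973, route `FilamentSkeletonRss`, line `Sketch`) — part B: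
# the logarithmic potential of an `X_λ` density

For the planar logarithmic potential `ψ_a(x) = ∫ N(x − y) a(y) dy`, `N = (2π)⁻¹ log ‖·‖`, of a density
`a ∈ X_λ = L²(G_λ⁻¹ dx)` (`G_λ = gaussWeightLam λ`, `λ < 1`):

* `log² ‖z‖ ≤ 4 · 𝟙_{‖z‖<1} ‖z‖⁻¹ + ‖z‖²`, hence `∫ log² ‖x − y‖ G_λ(y) dy ≤ K (1 + ‖x‖)²`;
* **the pointwise bound** `|ψ_a(x)| ≤ K (1 + ‖x‖) ‖a‖_{X_λ}` (weighted Cauchy–Schwarz), with absolute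
  convergence of the defining integral, and consequently
  **`∫ Φ(|x|) ψ_a(x)² dx ≤ K' ‖a‖²_{X_λ}`** (`Φ = kerWeight ≤ e^{−r²/8}`): the operator
  `a ↦ Φ ψ_a` is bounded from `X_λ` to `L²(Φ⁻¹ dx)`;
* measurability of `ψ_a`, oddness of `ψ_a` for odd `a`, linearity in `a`, and continuity of `ψ_w`
  for a compactly supported `C¹` density (tree: `contDiff_one_logPotential_of_gaussBound`).

References: Th. Gallay, V. Šverák, arXiv:2110.13739, §2 (2.6)–(2.8) (the energy of an `X`
density); folklore potential theory.

Not carried from this source module (not needed by the declarations re-homed here; their consumers are Summits-side): `arnold_sq_log_norm_le`, `arnold_integral_sq_log_mul_gaussWeightLam_le`, `arnold_logPotential_bound`, `arnold_integral_kerWeight_mul_logPotential_sq_le`, `arnold_logPotential_const_mul`, `arnold_integrable_logKernel_mul_const_mul`, `arnold_abs_moment_le`, `stub_oddArnoldToolsB`.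
-/

section Part5

namespace Literature.Analysis.GaussianVortexArnold

open _root_.Set _root_.Function _root_.Filter _root_.MeasureTheory _root_.Topology _root_.Metric
open Literature.Analysis.FluidPDE

/-! ### The squared logarithmic kernel against the Gaussian weight -/

/-- **Measurability of the logarithmic potential** of a measurable density. [folklore]
[cite: GallaySverak2021, §2 Thm 2.5 with Rem. 2.7 (source of the ARGUMENT implemented; this declaration is the cell’s own lemma, NOT a printed statement)] -/
theorem arnold_aestronglyMeasurable_logPotential {a : EuclideanSpace ℝ (Fin 2) → ℝ}
    (ham : AEStronglyMeasurable a volume) :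
    AEStronglyMeasurable (fun x : EuclideanSpace ℝ (Fin 2) =>
      ∫ y, (2 * Real.pi)⁻¹ * Real.log ‖x - y‖ * a y) volume := by
  have h : AEStronglyMeasurable (fun p : EuclideanSpace ℝ (Fin 2) × EuclideanSpace ℝ (Fin 2) =>
      (2 * Real.pi)⁻¹ * Real.log ‖p.1 - p.2‖ * a p.2) (volume.prod volume) :=
    ((measurable_const.mul (measurable_fst.sub measurable_snd).norm.log).aestronglyMeasurable).mul
      ham.comp_snd
  exact h.integral_prod_right'

/-- **The potential of an odd density is odd**: `ψ_a(−x) = −ψ_a(x)` (substitute `y ↦ −y`; no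
integrability needed). [folklore]
[cite: GallaySverak2021, §2 Thm 2.5 with Rem. 2.7 (source of the ARGUMENT implemented; this declaration is the cell’s own lemma, NOT a printed statement)] -/
theorem arnold_logPotential_neg_of_odd {a : EuclideanSpace ℝ (Fin 2) → ℝ}
    (hodd : ∀ x, a (-x) = -a x) (x : EuclideanSpace ℝ (Fin 2)) :
    ∫ y, (2 * Real.pi)⁻¹ * Real.log ‖-x - y‖ * a y =
      -∫ y, (2 * Real.pi)⁻¹ * Real.log ‖x - y‖ * a y := by
  rw [← integral_neg, ← integral_neg_eq_self (fun y => (2 * Real.pi)⁻¹ * Real.log ‖-x - y‖ * a y)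
    volume]
  refine integral_congr_ae (Eventually.of_forall fun y => ?_)
  simp only
  rw [hodd, show -x - -y = -(x - y) by abel, norm_neg]
  ring

/-- Linearity of the potential in the density: sums. [folklore]
[cite: GallaySverak2021, §2 Thm 2.5 with Rem. 2.7 (source of the ARGUMENT implemented; this declaration is the cell’s own lemma, NOT a printed statement)] -/
theorem arnold_logPotential_add {a b : EuclideanSpace ℝ (Fin 2) → ℝ} {x : EuclideanSpace ℝ (Fin 2)}
    (ha : Integrable (fun y => (2 * Real.pi)⁻¹ * Real.log ‖x - y‖ * a y))
    (hb : Integrable (fun y => (2 * Real.pi)⁻¹ * Real.log ‖x - y‖ * b y)) :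
    ∫ y, (2 * Real.pi)⁻¹ * Real.log ‖x - y‖ * (a y + b y) =
      (∫ y, (2 * Real.pi)⁻¹ * Real.log ‖x - y‖ * a y) +
        ∫ y, (2 * Real.pi)⁻¹ * Real.log ‖x - y‖ * b y := by
  rw [← integral_add ha hb]
  exact integral_congr_ae (Eventually.of_forall fun y => by simp only; ring)

end Literature.Analysis.GaussianVortexArnold

end Part5

/-!
## Part 6 — port of `Summits/NavierStokesRegularity/NavierStokesRegularity/Theorems/FilamentSkeletonRssCoreLinearInvertibilityArnoldModeSplitToolsD.lean` (9 declarations kept)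

# Tools for stub `stub_arnoldModeSplit` (crux `CoreLinearInvertibility`, stmt-NavierStokesRegularity-17973,
# route `FilamentSkeletonRss`, line `Sketch`) — part D: the `k = ±1` circle coefficients of a potential

For the logarithmic potential `ψ_f(x) = ∫ N(x − y) f(y) dy`, `N = (2π)⁻¹ log |·|`, of a continuous
Gaussian-bounded density `f` on `ℝ²`, and `r > 0`:

  `∫_{-π}^{π} ψ_f(circlePt r θ) cos θ dθ = −(π/2) ∫₀^∞ min(r/s, s/r) a_f(s) s ds`,
  `∫_{-π}^{π} ψ_f(circlePt r θ) sin θ dθ = −(π/2) ∫₀^∞ min(r/s, s/r) b_f(s) s ds`,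

`a_f(s) = π⁻¹ ∫ f(circlePt s φ) cos φ dφ`, `b_f(s) = π⁻¹ ∫ f(circlePt s φ) sin φ dφ` — the `k = ±1`
case of Gallay–Šverák's per-mode formula `ψ̂_k(r) = −(2k)⁻¹ ∫₀^∞ min(r/s,s/r)^k f̂_k(s) s ds`
(arXiv:2110.13739, §3, (Bkdef)): Fubini on `(−π, π] × ℝ²` (part C), the circle moments of the kernel
(part C, off the null circle `|y| = r`), and polar coordinates in `y`.  Also: integrability of
`g ψ_f` for Gaussian-bounded `g`, `f`, and the **symmetry `∫ f ψ_g = ∫ g ψ_f`** (Fubini on `ℝ² × ℝ²`).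
Folklore.

Not carried from this source module (not needed by the declarations re-homed here; their consumers are Summits-side): `stub_arnoldModeSplitToolsD`.
-/

section Part6

namespace Literature.Analysis.GaussianVortexArnold

open _root_.Set _root_.Function _root_.Filter _root_.MeasureTheory _root_.Topology _root_.Metric
open Literature.Analysis.FluidPDE Literature.Analysis.Potential
open Literature.Analysis.GaussianVortexArnold.StretchedVortexRows
open scoped _root_.Real

/-! ### Integrability against the logarithmic kernel and of `g ψ_f` -/

/-- A continuous Gaussian-bounded density is integrable. [folklore]
[cite: GallaySverak2021, §2 proof of Thm 2.5, the angular Fourier splitting (source of the ARGUMENT implemented; this declaration is the cell’s own lemma, NOT a printed statement)] -/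
theorem modeSplit_integrable_of_gaussBound {f : EuclideanSpace ℝ (Fin 2) → ℝ} (hf : Continuous f) {B : ℝ}
    (hB : ∀ y, |f y| ≤ B * Real.exp (-(1 / 8) * ‖y‖ ^ 2)) : Integrable f := by
  refine ((integrable_one_add_norm_pow_mul_exp_eighth 0).const_mul B).mono' hf.aestronglyMeasurable
    (Eventually.of_forall fun y => ?_)
  rw [Real.norm_eq_abs, pow_zero, one_mul]; exact hB y

/-- `y ↦ N(x − y) f(y)` is integrable for a continuous Gaussian-bounded `f`. [folklore]
[cite: GallaySverak2021, §2 proof of Thm 2.5, the angular Fourier splitting (source of the ARGUMENT implemented; this declaration is the cell’s own lemma, NOT a printed statement)] -/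
theorem modeSplit_integrable_logKernel_mul {f : EuclideanSpace ℝ (Fin 2) → ℝ} (hf : Continuous f) {B : ℝ}
    (hB : ∀ y, |f y| ≤ B * Real.exp (-(1 / 8) * ‖y‖ ^ 2)) (x : EuclideanSpace ℝ (Fin 2)) :
    Integrable fun y => (2 * Real.pi)⁻¹ * Real.log ‖x - y‖ * f y := by
  obtain ⟨K, -, hK⟩ := modeSplit_integral_abs_log_mul_le hf hB
  refine ((hK x).1.const_mul (2 * π)⁻¹).mono'
    (((measurable_const.mul (measurable_const.sub measurable_id).norm.log).mul
      hf.measurable).aestronglyMeasurable) (Eventually.of_forall fun y => ?_)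
  rw [Real.norm_eq_abs, abs_mul, abs_mul, abs_of_pos (by positivity : (0 : ℝ) < (2 * π)⁻¹), mul_assoc]

/-- **`g ψ_f ∈ L¹`** for continuous Gaussian-bounded `f`, `g` (`|ψ_f(x)| ≤ C(1 + log(1+|x|)) ≤ C(1+|x|)`).
[folklore]
[cite: GallaySverak2021, §2 proof of Thm 2.5, the angular Fourier splitting (source of the ARGUMENT implemented; this declaration is the cell’s own lemma, NOT a printed statement)] -/
theorem modeSplit_integrable_mul_logPotential {f g : EuclideanSpace ℝ (Fin 2) → ℝ} (hf : Continuous f)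
    (hg : Continuous g) {Bf Bg : ℝ} (hBf : ∀ y, |f y| ≤ Bf * Real.exp (-(1 / 8) * ‖y‖ ^ 2))
    (hBg : ∀ x, |g x| ≤ Bg * Real.exp (-(1 / 8) * ‖x‖ ^ 2)) :
    Integrable fun x => g x * ∫ y, (2 * Real.pi)⁻¹ * Real.log ‖x - y‖ * f y := by
  obtain ⟨C, hC0, hC⟩ := abs_logPotential_le hBf
  have hBg0 : 0 ≤ Bg := (abs_nonneg _).trans ((hBg 0).trans (le_of_eq (by simp)))
  refine ((integrable_one_add_norm_pow_mul_exp_eighth 1).const_mul (Bg * C)).mono'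
    (hg.aestronglyMeasurable.mul (arnold_aestronglyMeasurable_logPotential hf.aestronglyMeasurable))
    (Eventually.of_forall fun x => ?_)
  rw [Real.norm_eq_abs, abs_mul, pow_one]
  have hlog : Real.log (1 + ‖x‖) ≤ ‖x‖ := by
    have := Real.log_le_sub_one_of_pos (by positivity : (0 : ℝ) < 1 + ‖x‖); linarith
  calc |g x| * |∫ y, (2 * Real.pi)⁻¹ * Real.log ‖x - y‖ * f y|
      ≤ (Bg * Real.exp (-(1 / 8) * ‖x‖ ^ 2)) * (C * (1 + Real.log (1 + ‖x‖))) :=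
        mul_le_mul (hBg x) (hC x) (abs_nonneg _) (by positivity)
    _ ≤ (Bg * Real.exp (-(1 / 8) * ‖x‖ ^ 2)) * (C * (1 + ‖x‖)) := by gcongr
    _ = Bg * C * ((1 + ‖x‖) * Real.exp (-(1 / 8) * ‖x‖ ^ 2)) := by ring

/-! ### The kernel moments against a density, in polar coordinates -/

/-- `∫ f(y) t(r,|y|) y₀/|y| dy = ∫₀^∞ s t(r,s) ∫ f(circlePt s φ) cos φ dφ ds` (polar coordinates). [folklore]
[cite: GallaySverak2021, §2 proof of Thm 2.5, the angular Fourier splitting (source of the ARGUMENT implemented; this declaration is the cell’s own lemma, NOT a printed statement)] -/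
theorem modeSplit_integral_mul_kernelMoment_cos {f : EuclideanSpace ℝ (Fin 2) → ℝ} (hf : Continuous f)
    (hfi : Integrable f) {r : ℝ} (hr : 0 < r) :
    ∫ y : EuclideanSpace ℝ (Fin 2), f y * ((min r ‖y‖ / max r ‖y‖) * (y 0 / ‖y‖)) =
      ∫ s in Ioi (0 : ℝ), s * (min r s / max r s) * ∫ φ in (-π)..π, f (circlePt s φ) * Real.cos φ := by
  have hπ : -π ≤ π := by linarith [Real.pi_pos]
  have hM : ∀ y : EuclideanSpace ℝ (Fin 2), max r ‖y‖ ≠ 0 := fun y => (lt_max_of_lt_left hr).ne'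
  have hint : Integrable fun y : EuclideanSpace ℝ (Fin 2) => f y * ((min r ‖y‖ / max r ‖y‖) * (y 0 / ‖y‖)) := by
    refine hfi.norm.mono' (hf.aestronglyMeasurable.mul
      ((((continuous_const.min continuous_norm).div (continuous_const.max continuous_norm)
        hM).measurable.mul ((PiLp.continuous_apply 2 _ 0).measurable.div
          continuous_norm.measurable)).aestronglyMeasurable)) (Eventually.of_forall fun y => ?_)
    rw [norm_mul, norm_mul]
    have ht : ‖min r ‖y‖ / max r ‖y‖‖ ≤ 1 := by
      rw [Real.norm_of_nonneg (div_nonneg (le_min hr.le (norm_nonneg y)) (le_max_of_le_right (norm_nonneg y)))]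
      exact div_le_one_of_le₀ min_le_max (le_max_of_le_right (norm_nonneg y))
    have hq : ‖y 0 / ‖y‖‖ ≤ 1 := by
      rw [norm_div, norm_norm]
      exact div_le_one_of_le₀ (PiLp.norm_apply_le y 0) (norm_nonneg _)
    calc ‖f y‖ * (‖min r ‖y‖ / max r ‖y‖‖ * ‖y 0 / ‖y‖‖) ≤ ‖f y‖ * (1 * 1) := by gcongr
      _ = ‖f y‖ := by ring
  rw [integral_eq_integral_circlePt hint]
  refine setIntegral_congr_fun measurableSet_Ioi fun s hs => ?_
  have hs : 0 < s := hs
  have h1 : ∀ φ : ℝ, s • (f (circlePt s φ) * ((min r ‖circlePt s φ‖ / max r ‖circlePt s φ‖) *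
      (circlePt s φ 0 / ‖circlePt s φ‖))) =
      s * (min r s / max r s) * (f (circlePt s φ) * Real.cos φ) := by
    intro φ
    rw [norm_circlePt, abs_of_pos hs, circlePt_apply_zero, smul_eq_mul]
    field_simp
  simp_rw [h1]
  rw [integral_const_mul, ← intervalIntegral.integral_of_le hπ]

/-- `∫ f(y) t(r,|y|) y₁/|y| dy = ∫₀^∞ s t(r,s) ∫ f(circlePt s φ) sin φ dφ ds`. [folklore]
[cite: GallaySverak2021, §2 proof of Thm 2.5, the angular Fourier splitting (source of the ARGUMENT implemented; this declaration is the cell’s own lemma, NOT a printed statement)] -/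
theorem modeSplit_integral_mul_kernelMoment_sin {f : EuclideanSpace ℝ (Fin 2) → ℝ} (hf : Continuous f)
    (hfi : Integrable f) {r : ℝ} (hr : 0 < r) :
    ∫ y : EuclideanSpace ℝ (Fin 2), f y * ((min r ‖y‖ / max r ‖y‖) * (y 1 / ‖y‖)) =
      ∫ s in Ioi (0 : ℝ), s * (min r s / max r s) * ∫ φ in (-π)..π, f (circlePt s φ) * Real.sin φ := by
  have hπ : -π ≤ π := by linarith [Real.pi_pos]
  have hM : ∀ y : EuclideanSpace ℝ (Fin 2), max r ‖y‖ ≠ 0 := fun y => (lt_max_of_lt_left hr).ne'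
  have hint : Integrable fun y : EuclideanSpace ℝ (Fin 2) => f y * ((min r ‖y‖ / max r ‖y‖) * (y 1 / ‖y‖)) := by
    refine hfi.norm.mono' (hf.aestronglyMeasurable.mul
      ((((continuous_const.min continuous_norm).div (continuous_const.max continuous_norm)
        hM).measurable.mul ((PiLp.continuous_apply 2 _ 1).measurable.div
          continuous_norm.measurable)).aestronglyMeasurable)) (Eventually.of_forall fun y => ?_)
    rw [norm_mul, norm_mul]
    have ht : ‖min r ‖y‖ / max r ‖y‖‖ ≤ 1 := by
      rw [Real.norm_of_nonneg (div_nonneg (le_min hr.le (norm_nonneg y)) (le_max_of_le_right (norm_nonneg y)))]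
      exact div_le_one_of_le₀ min_le_max (le_max_of_le_right (norm_nonneg y))
    have hq : ‖y 1 / ‖y‖‖ ≤ 1 := by
      rw [norm_div, norm_norm]
      exact div_le_one_of_le₀ (PiLp.norm_apply_le y 1) (norm_nonneg _)
    calc ‖f y‖ * (‖min r ‖y‖ / max r ‖y‖‖ * ‖y 1 / ‖y‖‖) ≤ ‖f y‖ * (1 * 1) := by gcongr
      _ = ‖f y‖ := by ring
  rw [integral_eq_integral_circlePt hint]
  refine setIntegral_congr_fun measurableSet_Ioi fun s hs => ?_
  have hs : 0 < s := hs
  have h1 : ∀ φ : ℝ, s • (f (circlePt s φ) * ((min r ‖circlePt s φ‖ / max r ‖circlePt s φ‖) *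
      (circlePt s φ 1 / ‖circlePt s φ‖))) =
      s * (min r s / max r s) * (f (circlePt s φ) * Real.sin φ) := by
    intro φ
    rw [norm_circlePt, abs_of_pos hs, circlePt_apply_one, smul_eq_mul]
    field_simp
  simp_rw [h1]
  rw [integral_const_mul, ← intervalIntegral.integral_of_le hπ]

/-! ### The `k = ±1` circle coefficients of `ψ_f` -/

/-- Fubini step: `∫_{-π}^{π} ψ_f(circlePt r θ) w(θ) dθ = ∫ f(y) (2π)⁻¹ ∫_{-π}^{π} log|circlePt r θ − y| w(θ) dθ dy`.
[folklore]
[cite: GallaySverak2021, §2 proof of Thm 2.5, the angular Fourier splitting (source of the ARGUMENT implemented; this declaration is the cell’s own lemma, NOT a printed statement)] -/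
theorem modeSplit_circleInt_logPotential_swap {f : EuclideanSpace ℝ (Fin 2) → ℝ} (hf : Continuous f) {B : ℝ}
    (hB : ∀ y, |f y| ≤ B * Real.exp (-(1 / 8) * ‖y‖ ^ 2)) (r : ℝ) {w : ℝ → ℝ} (hw : Continuous w)
    (hw1 : ∀ θ, |w θ| ≤ 1) :
    ∫ θ in (-π)..π, (∫ y, (2 * Real.pi)⁻¹ * Real.log ‖circlePt r θ - y‖ * f y) * w θ =
      ∫ y, f y * ((2 * π)⁻¹ * ∫ θ in (-π)..π, Real.log ‖circlePt r θ - y‖ * w θ) := by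
  have hπ : -π ≤ π := by linarith [Real.pi_pos]
  have hI := modeSplit_integrable_circle_logKernel hf hB r hw hw1
  have hswap := intervalIntegral_integral_swap (μ := volume) (a := -π) (b := π)
    (f := fun (θ : ℝ) (y : EuclideanSpace ℝ (Fin 2)) => w θ * ((2 * Real.pi)⁻¹ * Real.log ‖circlePt r θ - y‖ * f y))
    (by rwa [uIoc_of_le hπ])
  calc ∫ θ in (-π)..π, (∫ y, (2 * Real.pi)⁻¹ * Real.log ‖circlePt r θ - y‖ * f y) * w θ
      = ∫ θ in (-π)..π, ∫ y, w θ * ((2 * Real.pi)⁻¹ * Real.log ‖circlePt r θ - y‖ * f y) := by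
        refine intervalIntegral.integral_congr fun θ _ => ?_
        rw [integral_const_mul, mul_comm]
    _ = ∫ y, ∫ θ in (-π)..π, w θ * ((2 * Real.pi)⁻¹ * Real.log ‖circlePt r θ - y‖ * f y) := hswap
    _ = ∫ y, f y * ((2 * π)⁻¹ * ∫ θ in (-π)..π, Real.log ‖circlePt r θ - y‖ * w θ) := by
        refine integral_congr_ae (Eventually.of_forall fun y => ?_)
        simp only
        rw [← intervalIntegral.integral_const_mul, ← intervalIntegral.integral_const_mul]
        exact intervalIntegral.integral_congr fun θ _ => by ring

/-- **The cosine circle coefficient of `ψ_f`**: for `r > 0`,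
`∫_{-π}^{π} ψ_f(circlePt r θ) cos θ dθ = −(π/2) ∫₀^∞ min(r/s, s/r) a_f(s) s ds`. [folklore]
[cite: GallaySverak2021, §2 proof of Thm 2.5, the angular Fourier splitting (source of the ARGUMENT implemented; this declaration is the cell’s own lemma, NOT a printed statement)] -/
theorem modeSplit_circle_logPotential_cos {f : EuclideanSpace ℝ (Fin 2) → ℝ} (hf : Continuous f) {B : ℝ}
    (hB : ∀ y, |f y| ≤ B * Real.exp (-(1 / 8) * ‖y‖ ^ 2)) {r : ℝ} (hr : 0 < r) {af : ℝ → ℝ}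
    (haf : ∀ s, af s = (1 / Real.pi) * ∫ φ in (-Real.pi)..Real.pi, f (circlePt s φ) * Real.cos φ) :
    ∫ θ in (-π)..π, (∫ y, (2 * Real.pi)⁻¹ * Real.log ‖circlePt r θ - y‖ * f y) * Real.cos θ =
      -(π / 2) * ∫ s in Ioi (0 : ℝ), min (r / s) (s / r) * af s * s := by
  have hfi : Integrable f := modeSplit_integrable_of_gaussBound hf hB
  rw [modeSplit_circleInt_logPotential_swap hf hB r Real.continuous_cos Real.abs_cos_le_one]
  have hae : ∫ y, f y * ((2 * π)⁻¹ * ∫ θ in (-π)..π, Real.log ‖circlePt r θ - y‖ * Real.cos θ) =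
      ∫ y, -(1 / 2) * (f y * ((min r ‖y‖ / max r ‖y‖) * (y 0 / ‖y‖))) := by
    refine integral_congr_ae ?_
    have hae : ∀ᵐ y : EuclideanSpace ℝ (Fin 2) ∂volume, y ∉ sphere (0 : EuclideanSpace ℝ (Fin 2)) r :=
      measure_eq_zero_iff_ae_notMem.1 (Measure.addHaar_sphere volume (0 : EuclideanSpace ℝ (Fin 2)) r)
    filter_upwards [hae] with y hy
    rw [mem_sphere_zero_iff_norm] at hy
    rw [modeSplit_integral_log_circle_cos hr hy]
    field_simp
  rw [hae, integral_const_mul, modeSplit_integral_mul_kernelMoment_cos hf hfi hr,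
    show -(π / 2) * (∫ s in Ioi (0 : ℝ), min (r / s) (s / r) * af s * s) =
      -(1 / 2) * (π * ∫ s in Ioi (0 : ℝ), min (r / s) (s / r) * af s * s) by ring,
    ← integral_const_mul π]
  congr 1
  refine setIntegral_congr_fun measurableSet_Ioi fun s hs => ?_
  rw [modeSplit_circleInt_eq_pi_mul haf s, modeSplit_min_div_max hr hs]
  ring

/-- **The sine circle coefficient of `ψ_f`**: for `r > 0`,
`∫_{-π}^{π} ψ_f(circlePt r θ) sin θ dθ = −(π/2) ∫₀^∞ min(r/s, s/r) b_f(s) s ds`. [folklore]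
[cite: GallaySverak2021, §2 proof of Thm 2.5, the angular Fourier splitting (source of the ARGUMENT implemented; this declaration is the cell’s own lemma, NOT a printed statement)] -/
theorem modeSplit_circle_logPotential_sin {f : EuclideanSpace ℝ (Fin 2) → ℝ} (hf : Continuous f) {B : ℝ}
    (hB : ∀ y, |f y| ≤ B * Real.exp (-(1 / 8) * ‖y‖ ^ 2)) {r : ℝ} (hr : 0 < r) {bf : ℝ → ℝ}
    (hbf : ∀ s, bf s = (1 / Real.pi) * ∫ φ in (-Real.pi)..Real.pi, f (circlePt s φ) * Real.sin φ) :
    ∫ θ in (-π)..π, (∫ y, (2 * Real.pi)⁻¹ * Real.log ‖circlePt r θ - y‖ * f y) * Real.sin θ =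
      -(π / 2) * ∫ s in Ioi (0 : ℝ), min (r / s) (s / r) * bf s * s := by
  have hfi : Integrable f := modeSplit_integrable_of_gaussBound hf hB
  rw [modeSplit_circleInt_logPotential_swap hf hB r Real.continuous_sin Real.abs_sin_le_one]
  have hae : ∫ y, f y * ((2 * π)⁻¹ * ∫ θ in (-π)..π, Real.log ‖circlePt r θ - y‖ * Real.sin θ) =
      ∫ y, -(1 / 2) * (f y * ((min r ‖y‖ / max r ‖y‖) * (y 1 / ‖y‖))) := by
    refine integral_congr_ae ?_
    have hae : ∀ᵐ y : EuclideanSpace ℝ (Fin 2) ∂volume, y ∉ sphere (0 : EuclideanSpace ℝ (Fin 2)) r :=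
      measure_eq_zero_iff_ae_notMem.1 (Measure.addHaar_sphere volume (0 : EuclideanSpace ℝ (Fin 2)) r)
    filter_upwards [hae] with y hy
    rw [mem_sphere_zero_iff_norm] at hy
    rw [modeSplit_integral_log_circle_sin hr hy]
    field_simp
  rw [hae, integral_const_mul, modeSplit_integral_mul_kernelMoment_sin hf hfi hr,
    show -(π / 2) * (∫ s in Ioi (0 : ℝ), min (r / s) (s / r) * bf s * s) =
      -(1 / 2) * (π * ∫ s in Ioi (0 : ℝ), min (r / s) (s / r) * bf s * s) by ring,
    ← integral_const_mul π]
  congr 1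
  refine setIntegral_congr_fun measurableSet_Ioi fun s hs => ?_
  rw [modeSplit_circleInt_eq_pi_mul hbf s, modeSplit_min_div_max hr hs]
  ring

/-! ### Symmetry of the energy form -/

/-- **`∫ g ψ_f = ∫ f ψ_g`** for continuous Gaussian-bounded `f`, `g` (Fubini on `ℝ² × ℝ²`: the slices
`x ↦ ∫ |g(x) N(x − y) f(y)| dy ≤ (2π)⁻¹ |g(x)| K(1 + |x|)` are integrable). [folklore]
[cite: GallaySverak2021, §2 proof of Thm 2.5, the angular Fourier splitting (source of the ARGUMENT implemented; this declaration is the cell’s own lemma, NOT a printed statement)] -/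
theorem modeSplit_integral_mul_logPotential_comm {f g : EuclideanSpace ℝ (Fin 2) → ℝ} (hf : Continuous f)
    (hg : Continuous g) {Bf Bg : ℝ} (hBf : ∀ y, |f y| ≤ Bf * Real.exp (-(1 / 8) * ‖y‖ ^ 2))
    (hBg : ∀ x, |g x| ≤ Bg * Real.exp (-(1 / 8) * ‖x‖ ^ 2)) :
    ∫ x, g x * ∫ y, (2 * Real.pi)⁻¹ * Real.log ‖x - y‖ * f y =
      ∫ y, f y * ∫ x, (2 * Real.pi)⁻¹ * Real.log ‖y - x‖ * g x := by
  obtain ⟨K, hK0, hK⟩ := modeSplit_integral_abs_log_mul_le hf hBf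
  have hBg0 : 0 ≤ Bg := (abs_nonneg _).trans ((hBg 0).trans (le_of_eq (by simp)))
  set H : EuclideanSpace ℝ (Fin 2) → EuclideanSpace ℝ (Fin 2) → ℝ :=
    fun x y => g x * ((2 * Real.pi)⁻¹ * Real.log ‖x - y‖ * f y) with hH
  have hmeas : Measurable (uncurry H) :=
    (hg.measurable.comp measurable_fst).mul ((measurable_const.mul
      (measurable_fst.sub measurable_snd).norm.log).mul (hf.measurable.comp measurable_snd))
  have hnorm : ∀ x y, ‖H x y‖ = (2 * π)⁻¹ * |g x| * (|Real.log ‖x - y‖| * |f y|) := by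
    intro x y
    simp only [hH, Real.norm_eq_abs, abs_mul, abs_of_pos (by positivity : (0 : ℝ) < (2 * π)⁻¹)]
    ring
  have hint : Integrable (uncurry H) (volume.prod volume) := by
    rw [integrable_prod_iff hmeas.aestronglyMeasurable]
    constructor
    · refine Eventually.of_forall fun x => ?_
      exact ((hK x).1.const_mul ((2 * π)⁻¹ * |g x|)).mono'
        (hmeas.comp measurable_prodMk_left).aestronglyMeasurable
        (Eventually.of_forall fun y => (hnorm x y).le)
    · refine (((integrable_one_add_norm_pow_mul_exp_eighth 1).const_mul ((2 * π)⁻¹ * Bg * K))).mono'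
        hmeas.aestronglyMeasurable.norm.integral_prod_right' (Eventually.of_forall fun x => ?_)
      rw [Real.norm_of_nonneg (integral_nonneg fun y => norm_nonneg _)]
      calc ∫ y, ‖uncurry H (x, y)‖ = ∫ y, (2 * π)⁻¹ * |g x| * (|Real.log ‖x - y‖| * |f y|) :=
            integral_congr_ae (Eventually.of_forall fun y => hnorm x y)
        _ = (2 * π)⁻¹ * |g x| * ∫ y, |Real.log ‖x - y‖| * |f y| := integral_const_mul _ _
        _ ≤ (2 * π)⁻¹ * (Bg * Real.exp (-(1 / 8) * ‖x‖ ^ 2)) * (K * (1 + ‖x‖)) :=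
            mul_le_mul (mul_le_mul_of_nonneg_left (hBg x) (by positivity)) (hK x).2
              (integral_nonneg fun y => by positivity) (by positivity)
        _ = (2 * π)⁻¹ * Bg * K * ((1 + ‖x‖) ^ 1 * Real.exp (-(1 / 8) * ‖x‖ ^ 2)) := by ring
  have hswap := integral_integral_swap hint
  calc ∫ x, g x * ∫ y, (2 * Real.pi)⁻¹ * Real.log ‖x - y‖ * f y = ∫ x, ∫ y, H x y :=
        integral_congr_ae (Eventually.of_forall fun x => (integral_const_mul _ _).symm)
    _ = ∫ y, ∫ x, H x y := hswap
    _ = ∫ y, f y * ∫ x, (2 * Real.pi)⁻¹ * Real.log ‖y - x‖ * g x := by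
        refine integral_congr_ae (Eventually.of_forall fun y => ?_)
        simp only [hH]
        rw [← integral_const_mul]
        exact integral_congr_ae (Eventually.of_forall fun x => by dsimp only; rw [norm_sub_rev]; ring)

/-! ### The registered tools stub -/

end Literature.Analysis.GaussianVortexArnold

end Part6

/-!
## Part 7 — port of `Summits/NavierStokesRegularity/NavierStokesRegularity/Theorems/FilamentSkeletonRssCoreLinearInvertibilityArnoldModeSplit.lean` (3 declarations kept)

# Crux `CoreLinearInvertibility` (stmt-NavierStokesRegularity-17973), line `Sketch`, stub `stub_arnoldModeSplit`:
# splitting an odd Gaussian-class density into its `k = ±1` angular part and the rest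

For a continuous, odd, Gaussian-class density `ω` on `ℝ²` with vanishing first moments, with
`a(r) = π⁻¹∫ ω(circlePt r θ) cos θ dθ`, `b(r) = π⁻¹ ∫ ω(circlePt r θ) sin θ dθ`,
`ω₁(x) = (a(|x|)x₀ + b(|x|)x₁)/|x|` and `ω_r = ω − ω₁` (parts A–D of the tools), this file proves the
registered stub `stub_arnoldModeSplit` of the wave-3 interface of line `Sketch` (discharge of
`GallaySverak2021_thm25_gaussian`): continuity / Gaussian class / oddness of `a`, `b`, `ω_r`, the vanishing
of the `k = ±1` circle coefficients of `ω_r`, the moment constraints `∫ r² a = ∫ r² b = 0`, the orthogonality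
`∫ Φ⁻¹ ω² = π ∫ Φ⁻¹ (a² + b²) r dr + ∫ Φ⁻¹ ω_r²`, and the **per-mode potential formula**

  `∫ ω ψ_ω = −π ∫₀^∞ ((B₁a) a + (B₁b) b) r dr + ∫ ω_r ψ_{ω_r}`,  `(B₁c)(r) = ½ ∫₀^∞ min(r/s, s/r) c(s) s ds`,

`ψ_f = (2π)⁻¹ log|·| ∗ f`.  Proof of the last identity (no Fourier series, no derivative of `ψ`):
`ω ψ_ω − ω_r ψ_{ω_r} = ω₁ ψ_ω + ω_r ψ_{ω₁}` pointwise (linearity of `ψ`); by polar coordinates and the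
`k = ±1` circle coefficients of `ψ_f` (part D: `∫ ψ_f(circlePt r θ) cos θ dθ = −π (B₁a_f)(r)`),
`∫ ω₁ ψ_f = −π ∫ ((B₁a_f) a + (B₁b_f) b) r dr` for every Gaussian-class `f`; with `f = ω` this is the main
term, and `∫ ω_r ψ_{ω₁} = ∫ ω₁ ψ_{ω_r} = 0` by the symmetry of the energy form and `a_{ω_r} = b_{ω_r} = 0`.

Reference: Th. Gallay, V. Šverák, *Arnold's variational principle and its application to the stability of
planar vortices*, arXiv:2110.13739 (Analysis & PDE 17 (2024)), §3, proof of Thm. 2.5 ((Jk), (Bkdef) with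
`k = 1`). Everything here is folklore calculus.
-/

section Part7

namespace Literature.Analysis.GaussianVortexArnold

open _root_.Set _root_.Function _root_.Filter _root_.MeasureTheory _root_.Topology _root_.Metric
open Literature.Analysis.FluidPDE
open Literature.Analysis.GaussianVortexArnold.StretchedVortexRows
open scoped _root_.Real _root_.InnerProductSpace

section Energy

variable {om : EuclideanSpace ℝ (Fin 2) → ℝ} {a b : ℝ → ℝ} {om₁ omr : EuclideanSpace ℝ (Fin 2) → ℝ}

/-- **`∫ ω₁ ψ_f = −π ∫₀^∞ ((B₁a_f) a + (B₁b_f) b) r dr`** for the `k = ±1` part `ω₁` (continuous `a`, `b`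
vanishing at `0`, `ω₁` Gaussian-bounded) and any continuous Gaussian-bounded `f`
(`a_f`, `b_f` the circle coefficients of `f`, `(B₁c)(r) = ½∫₀^∞ min(r/s,s/r) c(s) s ds`): polar
coordinates, `ω₁(circlePt r θ) = a(r) cos θ + b(r) sin θ`, and the circle coefficients of `ψ_f`. [folklore]
[cite: GallaySverak2021, §2 proof of Thm 2.5, the angular Fourier splitting (source of the ARGUMENT implemented; this declaration is the cell’s own lemma, NOT a printed statement)] -/
theorem modeSplit_integral_om₁_mul_logPotential (hac : Continuous a) (hbc : Continuous b)
    (ha0 : a 0 = 0) (hb0 : b 0 = 0) (hom₁ : ∀ x, om₁ x = (a ‖x‖ * x 0 + b ‖x‖ * x 1) / ‖x‖)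
    {B₁ : ℝ} (hB₁ : ∀ x, |om₁ x| ≤ B₁ * Real.exp (-(1 / 8) * ‖x‖ ^ 2))
    {f : EuclideanSpace ℝ (Fin 2) → ℝ} (hf : Continuous f) {B : ℝ} (hB : ∀ y, |f y| ≤ B * Real.exp (-(1 / 8) * ‖y‖ ^ 2))
    {af bf : ℝ → ℝ}
    (haf : ∀ s, af s = (1 / Real.pi) * ∫ φ in (-Real.pi)..Real.pi, f (circlePt s φ) * Real.cos φ)
    (hbf : ∀ s, bf s = (1 / Real.pi) * ∫ φ in (-Real.pi)..Real.pi, f (circlePt s φ) * Real.sin φ) :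
    ∫ x, om₁ x * ∫ y, (2 * Real.pi)⁻¹ * Real.log ‖x - y‖ * f y =
      -(Real.pi * ∫ r in Set.Ioi (0 : ℝ),
          (((1 / 2 : ℝ) * ∫ s in Set.Ioi (0 : ℝ), min (r / s) (s / r) * af s * s) * a r +
            ((1 / 2 : ℝ) * ∫ s in Set.Ioi (0 : ℝ), min (r / s) (s / r) * bf s * s) * b r) * r) := by
  have hπ : -π ≤ π := by linarith [Real.pi_pos]
  have hom₁c : Continuous om₁ := modeSplit_continuous_om₁ hac hbc ha0 hb0 hom₁
  have hint : Integrable fun x => om₁ x * ∫ y, (2 * Real.pi)⁻¹ * Real.log ‖x - y‖ * f y :=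
    modeSplit_integrable_mul_logPotential hf hom₁c hB hB₁
  rw [integral_eq_integral_circlePt hint, ← integral_const_mul, ← integral_neg]
  refine setIntegral_congr_fun measurableSet_Ioi fun r hr => ?_
  have hr : 0 < r := hr
  have hIw : ∀ {w : ℝ → ℝ}, Continuous w → (∀ θ, |w θ| ≤ 1) →
      IntegrableOn (fun θ => (∫ y, (2 * Real.pi)⁻¹ * Real.log ‖circlePt r θ - y‖ * f y) * w θ)
        (Ioc (-π) π) := by
    intro w hw hw1
    refine ((modeSplit_integrable_circle_logKernel hf hB r hw hw1).integral_prod_left).congr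
      (Eventually.of_forall fun θ => ?_)
    simp only [uncurry_apply_pair]
    rw [integral_const_mul, mul_comm]
  have key : ∀ θ : ℝ, r • (om₁ (circlePt r θ) *
      ∫ y, (2 * Real.pi)⁻¹ * Real.log ‖circlePt r θ - y‖ * f y) =
      r * (a r * ((∫ y, (2 * Real.pi)⁻¹ * Real.log ‖circlePt r θ - y‖ * f y) * Real.cos θ) +
        b r * ((∫ y, (2 * Real.pi)⁻¹ * Real.log ‖circlePt r θ - y‖ * f y) * Real.sin θ)) := by
    intro θ
    rw [modeSplit_om₁_circlePt hom₁ hr, smul_eq_mul]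
    ring
  simp_rw [key]
  have i1 := (hIw Real.continuous_cos Real.abs_cos_le_one).const_mul (a r)
  have i2 := (hIw Real.continuous_sin Real.abs_sin_le_one).const_mul (b r)
  rw [integral_const_mul, integral_add i1 i2, integral_const_mul, integral_const_mul,
    ← intervalIntegral.integral_of_le hπ, ← intervalIntegral.integral_of_le hπ,
    modeSplit_circle_logPotential_cos hf hB hr haf, modeSplit_circle_logPotential_sin hf hB hr hbf]
  ring

/-- **The per-mode potential formula** `∫ ω ψ_ω = −π ∫₀^∞ ((B₁a) a + (B₁b) b) r dr + ∫ ω_r ψ_{ω_r}`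
(`ω ψ_ω − ω_r ψ_{ω_r} = ω₁ ψ_ω + ω_r ψ_{ω₁}`; `∫ ω₁ ψ_ω` is the main term; `∫ ω_r ψ_{ω₁} = ∫ ω₁ ψ_{ω_r} = 0`
since the circle coefficients of `ω_r` vanish). [folklore]
[cite: GallaySverak2021, §2 proof of Thm 2.5, the angular Fourier splitting (source of the ARGUMENT implemented; this declaration is the cell’s own lemma, NOT a printed statement)] -/
theorem modeSplit_energy_split (hom : Continuous om)
    (hgc : ∃ (C : ℝ) (N : ℕ), ∀ x, |om x| ≤ C * (1 + ‖x‖) ^ N * Real.exp (-(‖x‖ ^ 2 / 4)))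
    (ha : ∀ r, a r = (1 / Real.pi) * ∫ θ in (-Real.pi)..Real.pi, om (circlePt r θ) * Real.cos θ)
    (hb : ∀ r, b r = (1 / Real.pi) * ∫ θ in (-Real.pi)..Real.pi, om (circlePt r θ) * Real.sin θ)
    (hom₁ : ∀ x, om₁ x = (a ‖x‖ * x 0 + b ‖x‖ * x 1) / ‖x‖) (homr : ∀ x, omr x = om x - om₁ x) :
    ∫ x, om x * ∫ y, (2 * Real.pi)⁻¹ * Real.log ‖x - y‖ * om y =
      -(Real.pi * ∫ r in Set.Ioi (0 : ℝ),
          (((1 / 2 : ℝ) * ∫ s in Set.Ioi (0 : ℝ), min (r / s) (s / r) * a s * s) * a r +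
            ((1 / 2 : ℝ) * ∫ s in Set.Ioi (0 : ℝ), min (r / s) (s / r) * b s * s) * b r) * r) +
        ∫ x, omr x * ∫ y, (2 * Real.pi)⁻¹ * Real.log ‖x - y‖ * omr y := by
  obtain ⟨C, N, hC⟩ := hgc
  have hac : Continuous a := modeSplit_continuous_coeff hom Real.continuous_cos ha
  have hbc : Continuous b := modeSplit_continuous_coeff hom Real.continuous_sin hb
  have ha0 : a 0 = 0 := modeSplit_coeff_zero modeSplit_integral_cos ha
  have hb0 : b 0 = 0 := modeSplit_coeff_zero modeSplit_integral_sin hb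
  have hom₁c : Continuous om₁ := modeSplit_continuous_om₁ hac hbc ha0 hb0 hom₁
  have homrc : Continuous omr := modeSplit_continuous_omr hom hom₁c homr
  obtain ⟨Bo, -, hBo⟩ := arnold_gc_exp_eighth ⟨C, N, hC⟩
  obtain ⟨B₁, -, hB₁⟩ := arnold_gc_exp_eighth ⟨4 * C, N, modeSplit_om₁_gaussClass hC ha hb hom₁⟩
  obtain ⟨Br, -, hBr⟩ := arnold_gc_exp_eighth ⟨5 * C, N, modeSplit_omr_gaussClass hC ha hb hom₁ homr⟩
  -- linearity of the potential
  have hlin : ∀ x : EuclideanSpace ℝ (Fin 2), (∫ y, (2 * Real.pi)⁻¹ * Real.log ‖x - y‖ * om y) =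
      (∫ y, (2 * Real.pi)⁻¹ * Real.log ‖x - y‖ * om₁ y) +
        ∫ y, (2 * Real.pi)⁻¹ * Real.log ‖x - y‖ * omr y := by
    intro x
    rw [← arnold_logPotential_add (modeSplit_integrable_logKernel_mul hom₁c hB₁ x)
      (modeSplit_integrable_logKernel_mul homrc hBr x)]
    exact integral_congr_ae (Eventually.of_forall fun y => by dsimp only; rw [homr]; ring)
  have hpt : ∀ x : EuclideanSpace ℝ (Fin 2), om x * (∫ y, (2 * Real.pi)⁻¹ * Real.log ‖x - y‖ * om y) -
      omr x * (∫ y, (2 * Real.pi)⁻¹ * Real.log ‖x - y‖ * omr y) =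
      om₁ x * (∫ y, (2 * Real.pi)⁻¹ * Real.log ‖x - y‖ * om y) +
        omr x * ∫ y, (2 * Real.pi)⁻¹ * Real.log ‖x - y‖ * om₁ y := by
    intro x
    have e1 : om x = om₁ x + omr x := by rw [homr]; ring
    rw [hlin x, e1]
    ring
  have i1 := modeSplit_integrable_mul_logPotential hom hom hBo hBo
  have i2 := modeSplit_integrable_mul_logPotential homrc homrc hBr hBr
  have i3 := modeSplit_integrable_mul_logPotential hom hom₁c hBo hB₁
  have i4 := modeSplit_integrable_mul_logPotential hom₁c homrc hB₁ hBr
  have hI : (∫ x, om x * ∫ y, (2 * Real.pi)⁻¹ * Real.log ‖x - y‖ * om y) -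
      (∫ x, omr x * ∫ y, (2 * Real.pi)⁻¹ * Real.log ‖x - y‖ * omr y) =
      (∫ x, om₁ x * ∫ y, (2 * Real.pi)⁻¹ * Real.log ‖x - y‖ * om y) +
        ∫ x, omr x * ∫ y, (2 * Real.pi)⁻¹ * Real.log ‖x - y‖ * om₁ y := by
    rw [← integral_sub i1 i2, ← integral_add i3 i4]
    exact integral_congr_ae (Eventually.of_forall hpt)
  -- the cross term vanishes
  have hsym := modeSplit_integral_mul_logPotential_comm hom₁c homrc hB₁ hBr
  have hzero : ∫ y, om₁ y * ∫ x, (2 * Real.pi)⁻¹ * Real.log ‖y - x‖ * omr x = 0 := by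
    rw [modeSplit_integral_om₁_mul_logPotential hac hbc ha0 hb0 hom₁ hB₁ homrc hBr
      (af := fun s => (1 / Real.pi) * ∫ φ in (-Real.pi)..Real.pi, omr (circlePt s φ) * Real.cos φ)
      (bf := fun s => (1 / Real.pi) * ∫ φ in (-Real.pi)..Real.pi, omr (circlePt s φ) * Real.sin φ)
      (fun s => rfl) (fun s => rfl)]
    have hA : ∀ r : ℝ, ∫ s in Set.Ioi (0 : ℝ), min (r / s) (s / r) *
        ((1 / Real.pi) * ∫ φ in (-Real.pi)..Real.pi, omr (circlePt s φ) * Real.cos φ) * s = 0 :=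
      fun r => setIntegral_eq_zero_of_forall_eq_zero fun s hs => by
        rw [modeSplit_omr_circle_cos hom ha hom₁ homr hs]; ring
    have hB : ∀ r : ℝ, ∫ s in Set.Ioi (0 : ℝ), min (r / s) (s / r) *
        ((1 / Real.pi) * ∫ φ in (-Real.pi)..Real.pi, omr (circlePt s φ) * Real.sin φ) * s = 0 :=
      fun r => setIntegral_eq_zero_of_forall_eq_zero fun s hs => by
        rw [modeSplit_omr_circle_sin hom hb hom₁ homr hs]; ring
    simp_rw [hA, hB]
    simp
  rw [hsym, hzero, add_zero, modeSplit_integral_om₁_mul_logPotential hac hbc ha0 hb0 hom₁ hB₁ hom hBo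
    ha hb] at hI
  linarith

end Energy

/-! ### The registered stub -/

/-- (A2) **Registered stub `stub_arnoldModeSplit`** (crux `CoreLinearInvertibility`, line `Sketch`,
stmt-NavierStokesRegularity-17973): splitting an odd Gaussian-class density into its `k = ±1` angular part
`ω₁ = (a(|x|) x₀ + b(|x|) x₁)/|x|` and the rest `ω_r`: regularity and Gaussian class of `a`, `b`, `ω_r`,
vanishing `k = ±1` circle coefficients of `ω_r`, the moment constraints on `a`, `b`, orthogonality in
`L²(Φ⁻¹)`, and the per-mode potential formula `∫ ω ψ_ω = −π ∫ ((B₁a) a + (B₁b) b) r + ∫ ω_r ψ_{ω_r}`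
(Gallay–Šverák, arXiv:2110.13739, §3, (Jk)/(Bkdef) for `k = 1`). [folklore]
[cite: GallaySverak2021, §2 proof of Thm 2.5, the angular Fourier splitting (source of the ARGUMENT implemented; this declaration is the cell’s own lemma, NOT a printed statement)] -/
theorem stub_arnoldModeSplit :
    ∀ (om : EuclideanSpace ℝ (Fin 2) → ℝ) (a b : ℝ → ℝ) (om₁ omr : EuclideanSpace ℝ (Fin 2) → ℝ),
    Continuous om →
    (∃ (C : ℝ) (N : ℕ), ∀ x, |om x| ≤ C * (1 + ‖x‖) ^ N * Real.exp (-(‖x‖ ^ 2 / 4))) →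
    (∀ x, om (-x) = -om x) → ∫ x, x 0 * om x = 0 → ∫ x, x 1 * om x = 0 →
    (∀ r, a r = (1 / Real.pi) * ∫ θ in (-Real.pi)..Real.pi, om (circlePt r θ) * Real.cos θ) →
    (∀ r, b r = (1 / Real.pi) * ∫ θ in (-Real.pi)..Real.pi, om (circlePt r θ) * Real.sin θ) →
    (∀ x, om₁ x = (a ‖x‖ * x 0 + b ‖x‖ * x 1) / ‖x‖) →
    (∀ x, omr x = om x - om₁ x) →
    ContinuousOn a (Set.Ici 0) ∧ ContinuousOn b (Set.Ici 0) ∧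
    (∃ (C : ℝ) (N : ℕ), ∀ r : ℝ, 0 ≤ r →
      |a r| ≤ C * (1 + r) ^ N * Real.exp (-(r ^ 2 / 4)) ∧
      |b r| ≤ C * (1 + r) ^ N * Real.exp (-(r ^ 2 / 4))) ∧
    Continuous omr ∧
    (∃ (C : ℝ) (N : ℕ), ∀ x, |omr x| ≤ C * (1 + ‖x‖) ^ N * Real.exp (-(‖x‖ ^ 2 / 4))) ∧
    (∀ x, omr (-x) = -omr x) ∧
    (∀ r : ℝ, 0 < r →
      ∫ θ in (-Real.pi)..Real.pi, omr (circlePt r θ) * Real.cos θ = 0 ∧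
      ∫ θ in (-Real.pi)..Real.pi, omr (circlePt r θ) * Real.sin θ = 0) ∧
    ∫ r in Set.Ioi (0 : ℝ), r ^ 2 * a r = 0 ∧ ∫ r in Set.Ioi (0 : ℝ), r ^ 2 * b r = 0 ∧
    ∫ x, (kerWeight ‖x‖)⁻¹ * om x ^ 2 =
      Real.pi * (∫ r in Set.Ioi (0 : ℝ), (kerWeight r)⁻¹ * (a r ^ 2 + b r ^ 2) * r) +
        ∫ x, (kerWeight ‖x‖)⁻¹ * omr x ^ 2 ∧
    ∫ x, om x * ∫ y, (2 * Real.pi)⁻¹ * Real.log ‖x - y‖ * om y =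
      -(Real.pi * ∫ r in Set.Ioi (0 : ℝ),
          (((1 / 2 : ℝ) * ∫ s in Set.Ioi (0 : ℝ), min (r / s) (s / r) * a s * s) * a r +
            ((1 / 2 : ℝ) * ∫ s in Set.Ioi (0 : ℝ), min (r / s) (s / r) * b s * s) * b r) * r) +
        ∫ x, omr x * ∫ y, (2 * Real.pi)⁻¹ * Real.log ‖x - y‖ * omr y := by
  intro om a b om₁ omr hom hgc hodd hm0 hm1 ha hb hom₁ homr
  obtain ⟨C, N, hC⟩ := hgc
  have hac : Continuous a := modeSplit_continuous_coeff hom Real.continuous_cos ha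
  have hbc : Continuous b := modeSplit_continuous_coeff hom Real.continuous_sin hb
  have ha0 : a 0 = 0 := modeSplit_coeff_zero modeSplit_integral_cos ha
  have hb0 : b 0 = 0 := modeSplit_coeff_zero modeSplit_integral_sin hb
  have hom₁c : Continuous om₁ := modeSplit_continuous_om₁ hac hbc ha0 hb0 hom₁
  have homrc : Continuous omr := modeSplit_continuous_omr hom hom₁c homr
  have hmom := modeSplit_moment_constraints hom ⟨C, N, hC⟩ hm0 hm1 ha hb
  exact ⟨hac.continuousOn, hbc.continuousOn, modeSplit_coeff_gaussClass ⟨C, N, hC⟩ ha hb, homrc,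
    ⟨5 * C, N, modeSplit_omr_gaussClass hC ha hb hom₁ homr⟩, modeSplit_omr_odd hodd hom₁ homr,
    fun r hr => ⟨modeSplit_omr_circle_cos hom ha hom₁ homr hr, modeSplit_omr_circle_sin hom hb hom₁ homr hr⟩,
    hmom.1, hmom.2, modeSplit_weighted_sq_split hom ⟨C, N, hC⟩ ha hb hom₁ homr,
    modeSplit_energy_split hom ⟨C, N, hC⟩ ha hb hom₁ homr⟩

end Literature.Analysis.GaussianVortexArnold

end Part7

/-!
## Part 8 — port of `Summits/AnomalousDissipation/AnomalousDissipation/Theorems/MarginalStabilityChainStretchedVortexRowsStubLogPotentialGradient.lean` (7 declarations kept)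

# Helper `logPotential_gradient_eq` toward stub `stub_coreInverse` of the line
# `braid-closed-large-circulation-gluing` (crux stmt-AnomalousDissipation-3009, `MarginalStabilityChain.StretchedVortexRows`)

The gradient of the logarithmic potential `ψ = N ∗ g`, `N = (2π)⁻¹ log ‖·‖`, of a `C¹` Gaussian-class density on
`ℝ² = EuclideanSpace ℝ (Fin 2)` (wave 3, toward `logPotential_neutral_energy`): starting from the derivative-on-`g` formula
`Dψ(ξ)[v] = ∫ N(ξ − η) Dg(η)[v] dη` of the toolkit file, ONE SINGULAR INTEGRATION BY PARTS moves the derivative onto the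
kernel, `∇ψ(ξ) = ∫ g(η) DN(ξ − η) dη` with `DN(z) = (2π‖z‖²)⁻¹ z ∈ L¹_loc`:

* the regularised kernel `N_ε(z) = (4π)⁻¹ log(‖z‖² + ε²)` is smooth, `DN_ε(z) = (2π)⁻¹ z/(‖z‖² + ε²)`, `|DN_ε| ≤ |DN|`,
  `|N_ε| ≤ 2|N| + (4π)⁻¹‖z‖²` off the origin (`0 < ε ≤ 1`); `∫ N_ε(ξ − η) ∂_v g(η) dη = ∫ ⟪DN_ε(ξ − η), v⟫ g(η) dη`
  (whole-plane integration by parts, all products Gaussian-integrable); `ε → 0` on both sides by dominated convergence.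

Not carried from this source module (not needed by the declarations re-homed here; their consumers are Summits-side): `fderiv_logReg_sub`, `abs_inner_div_normSq_add_sq_le`, `integrable_logReg_mul`, `integrable_kernelReg_mul`, `integrable_kernel_mul`, `continuous_and_bound_fderiv_apply`, `integral_logReg_mul_fderiv`, `integral_logKernel_mul_fderiv_eq`, `logPotential_gradient_eq`.
-/

section Part8

open scoped RealInnerProductSpace _root_.Topology
open _root_.MeasureTheory WithLp _root_.Function _root_.Metric _root_.Filter _root_.Set

namespace Literature.Analysis.GaussianVortexArnold.StretchedVortexRows

open Literature.Analysis.FluidPDE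

/-! ### The regularised logarithmic kernel `N_ε(z) = (4π)⁻¹ log(‖z‖² + ε²)` -/

section RegLog
variable {ε : ℝ} (hε : 0 < ε)
include hε

/-- `DN_ε(z) = (2π)⁻¹ (‖z‖² + ε²)⁻¹ ⟪z, ·⟫`. [folklore]
[cite: GallaySverak2021, §2 and §4.1 (context: potential theory of the planar Biot–Savart / logarithmic potential used in the proof of Thm 2.5; this declaration is the cell’s own lemma, NOT a printed statement)] -/
theorem hasFDerivAt_logReg (z : EuclideanSpace ℝ (Fin 2)) :
    HasFDerivAt (fun w : EuclideanSpace ℝ (Fin 2) => (4 * Real.pi)⁻¹ * Real.log (‖w‖ ^ 2 + ε ^ 2))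
      (((2 * Real.pi)⁻¹ * (‖z‖ ^ 2 + ε ^ 2)⁻¹) • innerSL ℝ z) z := by
  have hpos : 0 < ‖z‖ ^ 2 + ε ^ 2 := by positivity
  have h := ((hasFDerivAt_normSq_add_sq (ε := ε) z).log hpos.ne').const_mul (4 * Real.pi)⁻¹
  refine h.congr_fderiv ?_
  ext v
  simp only [FunLike.coe_smul, Pi.smul_apply, smul_eq_mul, innerSL_apply_apply]
  ring

/-- `η ↦ N_ε(ξ − η)` is differentiable. [folklore]
[cite: GallaySverak2021, §2 and §4.1 (context: potential theory of the planar Biot–Savart / logarithmic potential used in the proof of Thm 2.5; this declaration is the cell’s own lemma, NOT a printed statement)] -/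
theorem differentiable_logReg_sub (ξ : EuclideanSpace ℝ (Fin 2)) :
    Differentiable ℝ fun η : EuclideanSpace ℝ (Fin 2) => (4 * Real.pi)⁻¹ * Real.log (‖ξ - η‖ ^ 2 + ε ^ 2) :=
  fun η => ((hasFDerivAt_logReg hε (ξ - η)).comp η ((hasFDerivAt_id η).const_sub ξ)).differentiableAt

/-- `|log(‖z‖² + ε²)| ≤ |log ε²| + ‖z‖²/ε²`. [folklore]
[cite: GallaySverak2021, §2 and §4.1 (context: potential theory of the planar Biot–Savart / logarithmic potential used in the proof of Thm 2.5; this declaration is the cell’s own lemma, NOT a printed statement)] -/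
theorem abs_log_normSq_add_sq_le (z : EuclideanSpace ℝ (Fin 2)) :
    |Real.log (‖z‖ ^ 2 + ε ^ 2)| ≤ |Real.log (ε ^ 2)| + ‖z‖ ^ 2 / ε ^ 2 := by
  have hε2 : 0 < ε ^ 2 := by positivity
  have h1 : Real.log (ε ^ 2) ≤ Real.log (‖z‖ ^ 2 + ε ^ 2) :=
    Real.log_le_log hε2 (by nlinarith [sq_nonneg ‖z‖])
  have h2 : Real.log (‖z‖ ^ 2 + ε ^ 2) ≤ Real.log (ε ^ 2) + ‖z‖ ^ 2 / ε ^ 2 := by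
    have he : ‖z‖ ^ 2 + ε ^ 2 = ε ^ 2 * (1 + ‖z‖ ^ 2 / ε ^ 2) := by field_simp; ring
    rw [he, Real.log_mul hε2.ne' (by positivity)]
    have := Real.log_le_sub_one_of_pos (by positivity : (0:ℝ) < 1 + ‖z‖ ^ 2 / ε ^ 2)
    linarith
  have h3 : 0 ≤ ‖z‖ ^ 2 / ε ^ 2 := by positivity
  rw [abs_le]
  constructor
  · linarith [neg_abs_le (Real.log (ε ^ 2))]
  · linarith [le_abs_self (Real.log (ε ^ 2))]

end RegLog

/-- For `0 < ε ≤ 1` and `z ≠ 0`: `|log(‖z‖² + ε²)| ≤ 2 |log ‖z‖| + ‖z‖²` (uniform in `ε`). [folklore]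
[cite: GallaySverak2021, §2 and §4.1 (context: potential theory of the planar Biot–Savart / logarithmic potential used in the proof of Thm 2.5; this declaration is the cell’s own lemma, NOT a printed statement)] -/
theorem abs_log_normSq_add_sq_le_unif {ε : ℝ} (hε : 0 < ε) (hε1 : ε ≤ 1) {z : EuclideanSpace ℝ (Fin 2)}
    (hz : z ≠ 0) : |Real.log (‖z‖ ^ 2 + ε ^ 2)| ≤ 2 * |Real.log ‖z‖| + ‖z‖ ^ 2 := by
  have hn : 0 < ‖z‖ := norm_pos_iff.2 hz
  have h0 : 0 ≤ |Real.log ‖z‖| := abs_nonneg _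
  by_cases h : 1 ≤ ‖z‖ ^ 2 + ε ^ 2
  · rw [abs_of_nonneg (Real.log_nonneg h)]
    have := Real.log_le_sub_one_of_pos (by positivity : 0 < ‖z‖ ^ 2 + ε ^ 2)
    nlinarith
  · rw [not_le] at h
    have hneg : Real.log (‖z‖ ^ 2 + ε ^ 2) < 0 := Real.log_neg (by positivity) h
    rw [abs_of_neg hneg]
    have h1 : Real.log (‖z‖ ^ 2) ≤ Real.log (‖z‖ ^ 2 + ε ^ 2) :=
      Real.log_le_log (by positivity) (by nlinarith [sq_nonneg ε])
    rw [Real.log_pow, Nat.cast_ofNat] at h1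
    have h2 : Real.log ‖z‖ ≤ 0 := Real.log_nonpos hn.le (by nlinarith [sq_nonneg ε])
    rw [abs_of_nonpos h2]
    nlinarith [sq_nonneg ‖z‖]

/-! ### Integrability against Gaussian-bounded densities -/
/-- `‖ξ − η‖⁻¹ e^{−‖η‖²/8}` is integrable in `η` (`‖z‖⁻¹ ≤ 𝟙_{‖z‖<1}‖z‖⁻¹ + 1`). [folklore]
[cite: GallaySverak2021, §2 and §4.1 (context: potential theory of the planar Biot–Savart / logarithmic potential used in the proof of Thm 2.5; this declaration is the cell’s own lemma, NOT a printed statement)] -/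
theorem integrable_inv_norm_sub_mul_exp (ξ : EuclideanSpace ℝ (Fin 2)) :
    Integrable fun η : EuclideanSpace ℝ (Fin 2) => ‖ξ - η‖⁻¹ * Real.exp (-(1 / 8) * ‖η‖ ^ 2) := by
  have h1 : Integrable fun η : EuclideanSpace ℝ (Fin 2) =>
      (ball (0 : EuclideanSpace ℝ (Fin 2)) 1).indicator (fun z => ‖z‖⁻¹) (ξ - η) :=
    integrable_indicator_inv_norm.comp_sub_left ξ
  have h2 := integrable_one_add_norm_pow_mul_exp_eighth 0
  simp only [pow_zero, one_mul] at h2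
  refine (h1.add h2).mono' ?_ (Eventually.of_forall fun η => ?_)
  · exact ((measurable_norm.comp (measurable_const.sub measurable_id)).inv.mul
      (by fun_prop : Measurable fun η : EuclideanSpace ℝ (Fin 2) => Real.exp (-(1 / 8) * ‖η‖ ^ 2))).aestronglyMeasurable
  rw [Real.norm_of_nonneg (by positivity), Pi.add_apply]
  have he : Real.exp (-(1 / 8) * ‖η‖ ^ 2) ≤ 1 := Real.exp_le_one_iff.2 (by nlinarith [norm_nonneg η])
  have he0 : 0 ≤ Real.exp (-(1 / 8) * ‖η‖ ^ 2) := (Real.exp_pos _).le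
  by_cases hb : ξ - η ∈ ball (0 : EuclideanSpace ℝ (Fin 2)) 1
  · rw [indicator_of_mem hb]
    nlinarith [inv_nonneg.2 (norm_nonneg (ξ - η))]
  · rw [indicator_of_notMem hb, zero_add]
    have h3 : ‖ξ - η‖⁻¹ ≤ 1 := inv_le_one_of_one_le₀ (by simpa [mem_ball_zero_iff] using hb)
    nlinarith [inv_nonneg.2 (norm_nonneg (ξ - η))]

section Density

variable {B : ℝ} {h : EuclideanSpace ℝ (Fin 2) → ℝ} (hh : Continuous h)
  (hb : ∀ η, |h η| ≤ B * Real.exp (-(1 / 8) * ‖η‖ ^ 2))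
include hh hb

end Density

/-! ### Integration by parts against the regularised kernel, and the limit `ε → 0` -/

section IBP
variable {B : ℝ} {f : EuclideanSpace ℝ (Fin 2) → ℝ} (hf : ContDiff ℝ 1 f)
  (hf0 : ∀ η, |f η| ≤ B * Real.exp (-(1 / 8) * ‖η‖ ^ 2))
  (hf1 : ∀ η, ‖fderiv ℝ f η‖ ≤ B * Real.exp (-(1 / 8) * ‖η‖ ^ 2))
include hf hf0 hf1

end IBP

/-! ### The registered helper: the gradient of the logarithmic potential -/
/-- The vector kernel `DN(z) = (2π‖z‖²)⁻¹ z` has norm `(2π)⁻¹ ‖z‖⁻¹` (`0` at the origin). [folklore]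
[cite: GallaySverak2021, §2 and §4.1 (context: potential theory of the planar Biot–Savart / logarithmic potential used in the proof of Thm 2.5; this declaration is the cell’s own lemma, NOT a printed statement)] -/
theorem norm_gradLogKernel (z : EuclideanSpace ℝ (Fin 2)) :
    ‖(2 * Real.pi * ‖z‖ ^ 2)⁻¹ • z‖ = (2 * Real.pi)⁻¹ * ‖z‖⁻¹ := by
  rw [norm_smul, norm_inv, Real.norm_of_nonneg (by positivity)]
  rcases eq_or_ne ‖z‖ 0 with h | h
  · simp [h]
  · field_simp

/-- The Biot–Savart-type integrand `g(η) DN(ξ − η)` of a continuous Gaussian-bounded density is integrable. [folklore]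
[cite: GallaySverak2021, §2 and §4.1 (context: potential theory of the planar Biot–Savart / logarithmic potential used in the proof of Thm 2.5; this declaration is the cell’s own lemma, NOT a printed statement)] -/
theorem integrable_smul_gradLogKernel {B : ℝ} {g : EuclideanSpace ℝ (Fin 2) → ℝ} (hg : Continuous g)
    (hg0 : ∀ η, |g η| ≤ B * Real.exp (-(1 / 8) * ‖η‖ ^ 2)) (ξ : EuclideanSpace ℝ (Fin 2)) :
    Integrable fun η : EuclideanSpace ℝ (Fin 2) => g η • ((2 * Real.pi * ‖ξ - η‖ ^ 2)⁻¹ • (ξ - η)) := by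
  have hB : 0 ≤ B := (abs_nonneg _).trans ((hg0 0).trans (le_of_eq (by simp)))
  refine ((integrable_inv_norm_sub_mul_exp ξ).const_mul ((2 * Real.pi)⁻¹ * B)).mono' ?_
    (Eventually.of_forall fun η => ?_)
  · exact (hg.measurable.smul ((((measurable_const.mul ((measurable_norm.comp
      (measurable_const.sub measurable_id)).pow_const 2)).inv).smul
      (measurable_const.sub measurable_id)))).aestronglyMeasurable
  rw [norm_smul, norm_gradLogKernel, Real.norm_eq_abs]
  calc |g η| * ((2 * Real.pi)⁻¹ * ‖ξ - η‖⁻¹) ≤ B * Real.exp (-(1 / 8) * ‖η‖ ^ 2) * ((2 * Real.pi)⁻¹ * ‖ξ - η‖⁻¹) :=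
        mul_le_mul_of_nonneg_right (hg0 η) (by positivity)
    _ = _ := by ring

end Literature.Analysis.GaussianVortexArnold.StretchedVortexRows

end Part8

/-!
## Part 9 — port of `Summits/AnomalousDissipation/AnomalousDissipation/Theorems/MarginalStabilityChainStretchedVortexRowsStubLogPotentialGreen.lean` (4 declarations kept)

# Helper `logPotential_weak_poisson` toward stub `stub_coreInverse` of the line
# `braid-closed-large-circulation-gluing` (crux stmt-AnomalousDissipation-3009, `MarginalStabilityChain.StretchedVortexRows`)

The weak Poisson equation for the logarithmic potential `ψ = N ∗ g`, `N = (2π)⁻¹ log ‖·‖`, of a `C¹` Gaussian-class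
density on `ℝ² = EuclideanSpace ℝ (Fin 2)` (wave 3, toward `logPotential_neutral_energy`):

* polar coordinates for Bochner integrals on `EuclideanSpace ℝ (Fin 2)` (Mathlib's `integral_comp_polarCoord_symm`
  transported along the volume-preserving `ℝ² ≃ ℝ × ℝ`);
* **Green's identity in gradient form**, `∫ ⟪DN(ξ − η), ∇φ(ξ)⟫ dξ = −φ(η)` for `φ ∈ C¹_c` (`DN(z) = (2π‖z‖²)⁻¹ z`): in
  polar coordinates about `η` the integrand times the Jacobian is `(2π)⁻¹ ∂_r φ(η + r u(θ))`, whose radial integral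
  is `−(2π)⁻¹ φ(η)` for every angle (no regularisation needed);
* **`∫ ⟪∇ψ, ∇φ⟫ = −∫ g φ`** for every `φ ∈ C¹_c(ℝ²)`: `∇ψ = ∫ g(η) DN(· − η) dη` (helper `logPotential_gradient_eq`),
  Fubini (absolute convergence uniform in `ξ`: `‖DN‖ ∈ L¹_loc`, `g` Gaussian), and the Green identity.

Not carried from this source module (not needed by the declarations re-homed here; their consumers are Summits-side): `integral_inner_gradient_logPotential_gradient`, `logPotential_weak_poisson`.
-/

section Part9

open scoped RealInnerProductSpace _root_.Topology
open _root_.MeasureTheory WithLp _root_.Function _root_.Metric _root_.Filter _root_.Set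

namespace Literature.Analysis.GaussianVortexArnold.StretchedVortexRows

open Literature.Analysis.FluidPDE

/-! ### Polar coordinates on `EuclideanSpace ℝ (Fin 2)`, Bochner form -/

/-- **Polar coordinates on `ℝ²`**: `∫ f = ∫_{r>0, θ∈(−π,π)} r · f(r cos θ, r sin θ)` for every `f : ℝ² → F` (Mathlib's
`integral_comp_polarCoord_symm` on `ℝ × ℝ`, transported along the volume-preserving `ℝ² ≃ ℝ × ℝ`). [folklore]
[cite: GallaySverak2021, §2 and §4.1 (context: potential theory of the planar Biot–Savart / logarithmic potential used in the proof of Thm 2.5; this declaration is the cell’s own lemma, NOT a printed statement)] -/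
theorem integral_eq_integral_polar {F : Type*} [NormedAddCommGroup F] [NormedSpace ℝ F]
    (f : EuclideanSpace ℝ (Fin 2) → F) :
    ∫ ξ, f ξ = ∫ p in Ioi (0:ℝ) ×ˢ Ioo (-Real.pi) Real.pi,
      p.1 • f (toLp 2 ![p.1 * Real.cos p.2, p.1 * Real.sin p.2]) := by
  set T : EuclideanSpace ℝ (Fin 2) ≃ᵐ ℝ × ℝ :=
    (MeasurableEquiv.toLp 2 (Fin 2 → ℝ)).symm.trans MeasurableEquiv.finTwoArrow with hT
  have hTmp : MeasurePreserving T volume volume :=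
    (EuclideanSpace.volume_preserving_symm_measurableEquiv_toLp (Fin 2)).trans (volume_preserving_finTwoArrow ℝ)
  have h1 : ∫ ξ, f ξ = ∫ q : ℝ × ℝ, f (T.symm q) := (hTmp.symm.integral_comp T.symm.measurableEmbedding f).symm
  rw [h1, ← integral_comp_polarCoord_symm]
  rfl

/-! ### The Green identity in gradient form: `∫ ⟪DN(ξ − η), ∇φ(ξ)⟫ dξ = −φ(η)` -/

/-- The unit circle map `u(θ) = (cos θ, sin θ)` is continuous, has norm one, and `(r cos θ, r sin θ) = r u(θ)`. [folklore]
[cite: GallaySverak2021, §2 and §4.1 (context: potential theory of the planar Biot–Savart / logarithmic potential used in the proof of Thm 2.5; this declaration is the cell’s own lemma, NOT a printed statement)] -/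
theorem circleDir_props :
    (Continuous fun θ : ℝ => (toLp 2 ![Real.cos θ, Real.sin θ] : EuclideanSpace ℝ (Fin 2))) ∧
      (∀ θ : ℝ, ‖(toLp 2 ![Real.cos θ, Real.sin θ] : EuclideanSpace ℝ (Fin 2))‖ = 1) ∧
      ∀ r θ : ℝ, (toLp 2 ![r * Real.cos θ, r * Real.sin θ] : EuclideanSpace ℝ (Fin 2)) =
        r • toLp 2 ![Real.cos θ, Real.sin θ] := by
  refine ⟨(PiLp.continuous_toLp 2 _).comp (continuous_pi fun i => ?_), fun θ => ?_, fun r θ => ?_⟩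
  · fin_cases i
    · exact Real.continuous_cos
    · exact Real.continuous_sin
  · have h2 : ‖(toLp 2 ![Real.cos θ, Real.sin θ] : EuclideanSpace ℝ (Fin 2))‖ ^ 2 = 1 := by
      rw [EuclideanSpace.real_norm_sq_eq, Fin.sum_univ_two]
      simp [Real.cos_sq_add_sin_sq]
    have h0 := norm_nonneg (toLp 2 ![Real.cos θ, Real.sin θ] : EuclideanSpace ℝ (Fin 2))
    nlinarith
  · ext i
    fin_cases i <;> simp

/-- **Green's identity for the logarithmic kernel, gradient form**: for `φ ∈ C¹_c(ℝ²)` and every `η`,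
`∫ (2π‖ξ−η‖²)⁻¹ ⟪∇φ(ξ), ξ − η⟫ dξ = −φ(η)`, i.e. `∫ ⟪DN(ξ − η), ∇φ(ξ)⟫ dξ = −φ(η)` with `DN(z) = (2π‖z‖²)⁻¹ z`
(`ΔN = δ` in the weak sense). Proof by polar coordinates about `η`: the integrand times the Jacobian `r` is
`(2π)⁻¹ ∂_r[φ(η + r u(θ))]`, whose radial integral is `−(2π)⁻¹ φ(η)` for every angle. [folklore]
[cite: GallaySverak2021, §2 and §4.1 (context: potential theory of the planar Biot–Savart / logarithmic potential used in the proof of Thm 2.5; this declaration is the cell’s own lemma, NOT a printed statement)] -/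
theorem integral_gradLogKernel_inner_gradient {φ : EuclideanSpace ℝ (Fin 2) → ℝ} (hφ : ContDiff ℝ 1 φ)
    (hφc : HasCompactSupport φ) (η : EuclideanSpace ℝ (Fin 2)) :
    ∫ ξ, (2 * Real.pi * ‖ξ - η‖ ^ 2)⁻¹ * ⟪gradient φ ξ, ξ - η⟫ = -φ η := by
  obtain ⟨huc, hun', hru'⟩ := circleDir_props
  set u : ℝ → EuclideanSpace ℝ (Fin 2) := fun θ => toLp 2 ![Real.cos θ, Real.sin θ] with hu
  have hun : ∀ θ : ℝ, ‖u θ‖ = 1 := hun'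
  have hru : ∀ r θ : ℝ, (toLp 2 ![r * Real.cos θ, r * Real.sin θ] : EuclideanSpace ℝ (Fin 2)) = r • u θ := hru'
  have hφd : Differentiable ℝ φ := hφ.differentiable one_ne_zero
  have hgc : Continuous (gradient φ) :=
    (InnerProductSpace.toDual ℝ (EuclideanSpace ℝ (Fin 2))).symm.continuous.comp (hφ.continuous_fderiv one_ne_zero)
  -- support
  obtain ⟨R, hR⟩ := hφc.isCompact.isBounded.subset_closedBall 0
  set R₀ : ℝ := max R 0 + 1 with hR₀
  have hR₀pos : 0 < R₀ := by simp only [hR₀]; positivity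
  have hzero : ∀ x : EuclideanSpace ℝ (Fin 2), R₀ ≤ ‖x‖ → φ x = 0 ∧ gradient φ x = 0 := by
    intro x hx
    have hx' : x ∉ tsupport φ := fun h => by
      have := mem_closedBall_zero_iff.1 (hR h)
      simp only [hR₀] at hx
      linarith [le_max_left R 0]
    refine ⟨image_eq_zero_of_notMem_tsupport hx', ?_⟩
    have : fderiv ℝ φ x = 0 := image_eq_zero_of_notMem_tsupport fun h => hx' (tsupport_fderiv_subset ℝ h)
    rw [gradient, this, map_zero]
  set R₁ : ℝ := R₀ + ‖η‖ with hR₁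
  have hR₁ : 0 ≤ R₁ := by positivity
  have hfar : ∀ r θ : ℝ, R₁ ≤ r → φ (r • u θ + η) = 0 ∧ gradient φ (r • u θ + η) = 0 := by
    intro r θ hr
    refine hzero _ ?_
    have h1 : ‖r • u θ‖ = r := by
      rw [norm_smul, hun, mul_one, Real.norm_eq_abs, abs_of_nonneg (by linarith [norm_nonneg η])]
    have h2 := norm_sub_le (r • u θ + η) η
    rw [add_sub_cancel_right, h1] at h2
    linarith
  -- Step 1: translate to `η = 0` and pass to polar coordinates
  have h1 : ∫ ξ, (2 * Real.pi * ‖ξ - η‖ ^ 2)⁻¹ * ⟪gradient φ ξ, ξ - η⟫ =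
      ∫ z, (2 * Real.pi * ‖z‖ ^ 2)⁻¹ * ⟪gradient φ (z + η), z⟫ := by
    rw [← integral_add_right_eq_self _ η]
    simp only [add_sub_cancel_right]
  rw [h1, integral_eq_integral_polar]
  set G : ℝ × ℝ → ℝ := fun p => (2 * Real.pi)⁻¹ * ⟪gradient φ (p.1 • u p.2 + η), u p.2⟫ with hG
  have h3 : ∀ p ∈ Ioi (0:ℝ) ×ˢ Ioo (-Real.pi) Real.pi,
      p.1 • ((2 * Real.pi * ‖(toLp 2 ![p.1 * Real.cos p.2, p.1 * Real.sin p.2] : EuclideanSpace ℝ (Fin 2))‖ ^ 2)⁻¹ *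
        ⟪gradient φ ((toLp 2 ![p.1 * Real.cos p.2, p.1 * Real.sin p.2] : EuclideanSpace ℝ (Fin 2)) + η),
          (toLp 2 ![p.1 * Real.cos p.2, p.1 * Real.sin p.2] : EuclideanSpace ℝ (Fin 2))⟫) = G p := by
    rintro ⟨r, θ⟩ ⟨hr, -⟩
    have hr' : (0:ℝ) < r := hr
    simp only [hG, hru, norm_smul, hun, mul_one, Real.norm_eq_abs, abs_of_pos hr', inner_smul_right, smul_eq_mul]
    field_simp
  rw [setIntegral_congr_fun (measurableSet_Ioi.prod measurableSet_Ioo) h3]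
  -- Step 2: integrability on the target and iterated integration
  have hGc : Continuous G := by
    refine continuous_const.mul (Continuous.inner (hgc.comp ?_) (huc.comp continuous_snd))
    exact (continuous_fst.smul (huc.comp continuous_snd)).add continuous_const
  have hG0 : ∀ p : ℝ × ℝ, R₁ ≤ p.1 → G p = 0 := fun p hp => by
    simp only [hG, (hfar p.1 p.2 hp).2, inner_zero_left, mul_zero]
  have hGi : IntegrableOn G (Ioi (0:ℝ) ×ˢ Ioo (-Real.pi) Real.pi) := by
    have hK : IntegrableOn G (Icc 0 R₁ ×ˢ Icc (-Real.pi) Real.pi) :=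
      hGc.continuousOn.integrableOn_compact (isCompact_Icc.prod isCompact_Icc)
    have hZ : IntegrableOn G (Ici R₁ ×ˢ (univ : Set ℝ)) :=
      integrableOn_zero.congr_fun (fun p hp => (hG0 p hp.1).symm) (measurableSet_Ici.prod MeasurableSet.univ)
    refine (hK.union hZ).mono_set ?_
    rintro ⟨r, θ⟩ ⟨hr, hθ⟩
    by_cases h : r ≤ R₁
    · exact Or.inl ⟨⟨le_of_lt hr, h⟩, Ioo_subset_Icc_self hθ⟩
    · exact Or.inr ⟨le_of_lt (not_le.1 h), mem_univ _⟩
  rw [Measure.volume_eq_prod, ← Measure.prod_restrict]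
  have hGi' : Integrable G ((volume.restrict (Ioi (0:ℝ))).prod (volume.restrict (Ioo (-Real.pi) Real.pi))) := by
    rw [Measure.prod_restrict, ← Measure.volume_eq_prod]; exact hGi
  rw [integral_prod_symm G hGi']
  -- Step 3: the radial integral is `−(2π)⁻¹ φ(η)` for every angle
  have hinner : ∀ θ : ℝ, ∫ r in Ioi (0:ℝ), G (r, θ) = -((2 * Real.pi)⁻¹ * φ η) := by
    intro θ
    have hγ : ∀ r : ℝ, HasDerivAt (fun r : ℝ => r • u θ + η) (u θ) r := fun r => by
      have h := ((hasDerivAt_id r).smul_const (u θ)).add_const η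
      rw [one_smul] at h
      exact h
    have hderiv : ∀ r : ℝ, HasDerivAt (fun r : ℝ => (2 * Real.pi)⁻¹ * φ (r • u θ + η)) (G (r, θ)) r := by
      intro r
      have h := ((hφd (r • u θ + η)).hasFDerivAt.comp_hasDerivAt r (hγ r)).const_mul (2 * Real.pi)⁻¹
      refine h.congr_deriv ?_
      simp only [hG, gradient, InnerProductSpace.toDual_symm_apply]
    have hcont : Continuous fun r : ℝ => (2 * Real.pi)⁻¹ * φ (r • u θ + η) :=
      continuous_const.mul (hφ.continuous.comp ((continuous_id.smul continuous_const).add continuous_const))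
    have hGθ : Continuous fun r : ℝ => G (r, θ) := hGc.comp (continuous_id.prodMk continuous_const)
    have hint : IntegrableOn (fun r : ℝ => G (r, θ)) (Ioi 0) := by
      have hK : IntegrableOn (fun r : ℝ => G (r, θ)) (Icc 0 R₁) := hGθ.continuousOn.integrableOn_Icc
      have hZ : IntegrableOn (fun r : ℝ => G (r, θ)) (Ici R₁) :=
        integrableOn_zero.congr_fun (fun r hr => (hG0 (r, θ) hr).symm) measurableSet_Ici
      refine (hK.union hZ).mono_set fun r hr => ?_
      by_cases h : r ≤ R₁
      · exact Or.inl ⟨le_of_lt hr, h⟩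
      · exact Or.inr (le_of_lt (not_le.1 h))
    have hlim : Tendsto (fun r : ℝ => (2 * Real.pi)⁻¹ * φ (r • u θ + η)) atTop (𝓝 0) := by
      refine tendsto_const_nhds.congr' ?_
      filter_upwards [eventually_ge_atTop R₁] with r hr
      rw [(hfar r θ hr).1, mul_zero]
    rw [integral_Ioi_of_hasDerivAt_of_tendsto hcont.continuousWithinAt (fun r _ => hderiv r) hint hlim]
    simp
  simp_rw [hinner]
  rw [setIntegral_const, Real.volume_real_Ioo_of_le (by linarith [Real.pi_pos]), smul_eq_mul]
  field_simp
  ring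

/-! ### The weak Poisson equation `∫ ⟪∇ψ, ∇φ⟫ = −∫ g φ` -/

section Weak

variable {B : ℝ} {g : EuclideanSpace ℝ (Fin 2) → ℝ} (hg : ContDiff ℝ 1 g)
  (hg0 : ∀ η, |g η| ≤ B * Real.exp (-(1 / 8) * ‖η‖ ^ 2))
  (hg1 : ∀ η, ‖fderiv ℝ g η‖ ≤ B * Real.exp (-(1 / 8) * ‖η‖ ^ 2))

include hg0 in
/-- Uniform bound for the absolutely convergent gradient integrals: `∫ ‖g(η) DN(ξ − η)‖ dη ≤ M` for all `ξ`. [folklore]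
[cite: GallaySverak2021, §2 and §4.1 (context: potential theory of the planar Biot–Savart / logarithmic potential used in the proof of Thm 2.5; this declaration is the cell’s own lemma, NOT a printed statement)] -/
theorem exists_integral_norm_smul_gradLogKernel_le (hgc : Continuous g) :
    ∃ M : ℝ, ∀ ξ : EuclideanSpace ℝ (Fin 2),
      ∫ η, ‖g η • ((2 * Real.pi * ‖ξ - η‖ ^ 2)⁻¹ • (ξ - η))‖ ≤ M := by
  have hB : 0 ≤ B := (abs_nonneg _).trans ((hg0 0).trans (le_of_eq (by simp)))
  have hI := integrable_one_add_norm_pow_mul_exp_eighth 0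
  simp only [pow_zero, one_mul] at hI
  refine ⟨(2 * Real.pi)⁻¹ * B *
    ((∫ z, (ball (0 : EuclideanSpace ℝ (Fin 2)) 1).indicator (fun z => ‖z‖⁻¹) z) +
      ∫ η : EuclideanSpace ℝ (Fin 2), Real.exp (-(1 / 8) * ‖η‖ ^ 2)), fun ξ => ?_⟩
  have h1 : Integrable fun η : EuclideanSpace ℝ (Fin 2) =>
      (ball (0 : EuclideanSpace ℝ (Fin 2)) 1).indicator (fun z => ‖z‖⁻¹) (ξ - η) :=
    integrable_indicator_inv_norm.comp_sub_left ξ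
  have hle : ∀ η, ‖g η • ((2 * Real.pi * ‖ξ - η‖ ^ 2)⁻¹ • (ξ - η))‖ ≤ (2 * Real.pi)⁻¹ * B *
      ((ball (0 : EuclideanSpace ℝ (Fin 2)) 1).indicator (fun z => ‖z‖⁻¹) (ξ - η) +
        Real.exp (-(1 / 8) * ‖η‖ ^ 2)) := by
    intro η
    rw [norm_smul, norm_gradLogKernel, Real.norm_eq_abs]
    have he : Real.exp (-(1 / 8) * ‖η‖ ^ 2) ≤ 1 := Real.exp_le_one_iff.2 (by nlinarith [norm_nonneg η])
    have he0 : 0 ≤ Real.exp (-(1 / 8) * ‖η‖ ^ 2) := (Real.exp_pos _).le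
    have hi0 : 0 ≤ ‖ξ - η‖⁻¹ := inv_nonneg.2 (norm_nonneg _)
    have key : ‖ξ - η‖⁻¹ * Real.exp (-(1 / 8) * ‖η‖ ^ 2) ≤
        (ball (0 : EuclideanSpace ℝ (Fin 2)) 1).indicator (fun z => ‖z‖⁻¹) (ξ - η) + Real.exp (-(1 / 8) * ‖η‖ ^ 2) := by
      by_cases hb : ξ - η ∈ ball (0 : EuclideanSpace ℝ (Fin 2)) 1
      · rw [indicator_of_mem hb]; nlinarith
      · rw [indicator_of_notMem hb, zero_add]
        have h3 : ‖ξ - η‖⁻¹ ≤ 1 := inv_le_one_of_one_le₀ (by simpa [mem_ball_zero_iff] using hb)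
        nlinarith
    calc |g η| * ((2 * Real.pi)⁻¹ * ‖ξ - η‖⁻¹)
        ≤ B * Real.exp (-(1 / 8) * ‖η‖ ^ 2) * ((2 * Real.pi)⁻¹ * ‖ξ - η‖⁻¹) :=
          mul_le_mul_of_nonneg_right (hg0 η) (by positivity)
      _ = (2 * Real.pi)⁻¹ * B * (‖ξ - η‖⁻¹ * Real.exp (-(1 / 8) * ‖η‖ ^ 2)) := by ring
      _ ≤ _ := mul_le_mul_of_nonneg_left key (by positivity)
  calc ∫ η, ‖g η • ((2 * Real.pi * ‖ξ - η‖ ^ 2)⁻¹ • (ξ - η))‖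
      ≤ ∫ η, (2 * Real.pi)⁻¹ * B * ((ball (0 : EuclideanSpace ℝ (Fin 2)) 1).indicator (fun z => ‖z‖⁻¹) (ξ - η) +
          Real.exp (-(1 / 8) * ‖η‖ ^ 2)) :=
        integral_mono (integrable_smul_gradLogKernel hgc hg0 ξ).norm ((h1.add hI).const_mul _) hle
    _ = _ := by
        rw [integral_const_mul, integral_add h1 hI,
          integral_sub_left_eq_self ((ball (0 : EuclideanSpace ℝ (Fin 2)) 1).indicator fun z => ‖z‖⁻¹) volume ξ]

end Weak

/-! ### The registered helper -/

end Literature.Analysis.GaussianVortexArnold.StretchedVortexRows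

end Part9

/-!
## Part 10 — port of `Summits/AnomalousDissipation/AnomalousDissipation/Theorems/MarginalStabilityChainStretchedVortexRowsStubLogPotentialDecay.lean` (6 declarations kept)

# Helper `logPotential_gradient_decay` toward stub `stub_coreInverse` of the line
# `braid-closed-large-circulation-gluing` (crux stmt-AnomalousDissipation-3009, `MarginalStabilityChain.StretchedVortexRows`)

Far-field decay of the gradient of the logarithmic potential `ψ = N ∗ g` of a NEUTRAL Gaussian-class density on
`ℝ² = EuclideanSpace ℝ (Fin 2)` (wave 3, toward `logPotential_neutral_energy`): `‖∇ψ(ξ)‖ ≤ C/(1 + ‖ξ‖)²`, whence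
`‖∇ψ‖² ∈ L¹(ℝ²)`.

* the kernel `DN(z) = (2π‖z‖²)⁻¹ z` is differentiable off the origin with `‖D(DN)(z)‖ ≤ 3 (2π‖z‖²)⁻¹`, so by the
  mean value inequality on the ball `B(ξ, ‖ξ‖/2)`: `‖DN(ξ − η) − DN(ξ)‖ ≤ 12 (2π‖ξ‖²)⁻¹ ‖η‖` for `‖η‖ < ‖ξ‖/2`;
* NEUTRALITY `∫ g = 0` gives `∇ψ(ξ) = ∫ g(η) (DN(ξ − η) − DN(ξ)) dη`; the near region contributes `O(‖ξ‖⁻²)`, the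
  far region `‖η‖ ≥ ‖ξ‖/2` is Gaussian-small (`e^{−‖η‖²/8} ≤ e^{−‖ξ‖²/64} e^{−‖η‖²/16}`, `e^{−‖ξ‖²/64} ≤ 64/‖ξ‖²`);
* the near field `‖ξ‖ < 1` is covered by the uniform bound `∫ ‖g(η) DN(ξ − η)‖ dη ≤ M`.

Not carried from this source module (not needed by the declarations re-homed here; their consumers are Summits-side): `logPotential_gradient_decay`.
-/

section Part10

open scoped RealInnerProductSpace _root_.Topology
open _root_.MeasureTheory WithLp _root_.Function _root_.Metric _root_.Filter _root_.Set

namespace Literature.Analysis.GaussianVortexArnold.StretchedVortexRows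

open Literature.Analysis.FluidPDE

/-! ### Calculus of the kernel `DN(z) = (2π‖z‖²)⁻¹ z` away from the origin -/

/-- `DN` is differentiable off the origin with `‖D(DN)(z)‖ ≤ 3 (2π‖z‖²)⁻¹`
(`D(z/‖z‖²)[v] = v/‖z‖² − 2⟪z, v⟫ z/‖z‖⁴`). [folklore]
[cite: GallaySverak2021, §2 and §4.1 (context: potential theory of the planar Biot–Savart / logarithmic potential used in the proof of Thm 2.5; this declaration is the cell’s own lemma, NOT a printed statement)] -/
theorem exists_hasFDerivAt_gradLogKernel {z : EuclideanSpace ℝ (Fin 2)} (hz : z ≠ 0) :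
    ∃ L : EuclideanSpace ℝ (Fin 2) →L[ℝ] EuclideanSpace ℝ (Fin 2),
      HasFDerivAt (fun w : EuclideanSpace ℝ (Fin 2) => (2 * Real.pi * ‖w‖ ^ 2)⁻¹ • w) L z ∧
        ‖L‖ ≤ 3 * (2 * Real.pi * ‖z‖ ^ 2)⁻¹ := by
  have hn : 0 < ‖z‖ := norm_pos_iff.2 hz
  have hs : HasFDerivAt (fun w : EuclideanSpace ℝ (Fin 2) => 2 * Real.pi * ‖w‖ ^ 2)
      ((2 * Real.pi) • ((2:ℝ) • innerSL ℝ z)) z := by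
    refine ((hasStrictFDerivAt_norm_sq z).hasFDerivAt.const_mul (2 * Real.pi)).congr_fderiv ?_
    ext v
    simp [two_smul, two_mul]
  have hs0 : 0 < 2 * Real.pi * ‖z‖ ^ 2 := by positivity
  have hc := (hasDerivAt_inv hs0.ne').comp_hasFDerivAt z hs
  refine ⟨_, hc.smul (hasFDerivAt_id z), ?_⟩
  refine ContinuousLinearMap.opNorm_le_bound _ (by positivity) fun v => ?_
  have happ : ((2 * Real.pi * ‖z‖ ^ 2)⁻¹ • ContinuousLinearMap.id ℝ (EuclideanSpace ℝ (Fin 2)) +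
      ((-((2 * Real.pi * ‖z‖ ^ 2) ^ 2)⁻¹) • ((2 * Real.pi) • ((2:ℝ) • innerSL ℝ z))).smulRight
        ((id : EuclideanSpace ℝ (Fin 2) → EuclideanSpace ℝ (Fin 2)) z)) v =
      (2 * Real.pi * ‖z‖ ^ 2)⁻¹ • v + (-((2 * Real.pi * ‖z‖ ^ 2) ^ 2)⁻¹ * (2 * Real.pi * (2 * ⟪z, v⟫))) • z := by
    simp only [_root_.add_apply, ContinuousLinearMap.smulRight_apply, FunLike.coe_smul,
      Pi.smul_apply, ContinuousLinearMap.id_apply, innerSL_apply_apply, smul_eq_mul, id]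
  show ‖((2 * Real.pi * ‖z‖ ^ 2)⁻¹ • ContinuousLinearMap.id ℝ (EuclideanSpace ℝ (Fin 2)) +
      ((-((2 * Real.pi * ‖z‖ ^ 2) ^ 2)⁻¹) • ((2 * Real.pi) • ((2:ℝ) • innerSL ℝ z))).smulRight
        ((id : EuclideanSpace ℝ (Fin 2) → EuclideanSpace ℝ (Fin 2)) z)) v‖ ≤
    3 * (2 * Real.pi * ‖z‖ ^ 2)⁻¹ * ‖v‖
  rw [happ]
  have h1 : ‖(2 * Real.pi * ‖z‖ ^ 2)⁻¹ • v‖ = (2 * Real.pi * ‖z‖ ^ 2)⁻¹ * ‖v‖ := by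
    rw [norm_smul, Real.norm_of_nonneg (inv_nonneg.2 hs0.le)]
  have h2 : ‖(-((2 * Real.pi * ‖z‖ ^ 2) ^ 2)⁻¹ * (2 * Real.pi * (2 * ⟪z, v⟫))) • z‖ ≤
      2 * (2 * Real.pi * ‖z‖ ^ 2)⁻¹ * ‖v‖ := by
    rw [norm_smul, Real.norm_eq_abs, abs_mul, abs_neg, abs_inv, abs_of_pos (by positivity : (0:ℝ) < _ ^ 2)]
    have hi := abs_real_inner_le_norm z v
    rw [abs_mul, abs_of_pos (by positivity : (0:ℝ) < 2 * Real.pi), abs_mul, abs_two]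
    calc ((2 * Real.pi * ‖z‖ ^ 2) ^ 2)⁻¹ * (2 * Real.pi * (2 * |⟪z, v⟫|)) * ‖z‖
        ≤ ((2 * Real.pi * ‖z‖ ^ 2) ^ 2)⁻¹ * (2 * Real.pi * (2 * (‖z‖ * ‖v‖))) * ‖z‖ := by gcongr
      _ = 2 * (2 * Real.pi * ‖z‖ ^ 2)⁻¹ * ‖v‖ := by field_simp
  calc _ ≤ ‖(2 * Real.pi * ‖z‖ ^ 2)⁻¹ • v‖ +
        ‖(-((2 * Real.pi * ‖z‖ ^ 2) ^ 2)⁻¹ * (2 * Real.pi * (2 * ⟪z, v⟫))) • z‖ := norm_add_le _ _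
    _ ≤ (2 * Real.pi * ‖z‖ ^ 2)⁻¹ * ‖v‖ + 2 * (2 * Real.pi * ‖z‖ ^ 2)⁻¹ * ‖v‖ := by rw [h1]; gcongr
    _ = 3 * (2 * Real.pi * ‖z‖ ^ 2)⁻¹ * ‖v‖ := by ring

/-- **Mean-value bound for the kernel**: `‖DN(ξ − η) − DN(ξ)‖ ≤ 12 (2π‖ξ‖²)⁻¹ ‖η‖` for `‖η‖ < ‖ξ‖/2`
(the segment stays in `‖·‖ > ‖ξ‖/2`, where `‖D(DN)‖ ≤ 3 (2π(‖ξ‖/2)²)⁻¹`). [folklore]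
[cite: GallaySverak2021, §2 and §4.1 (context: potential theory of the planar Biot–Savart / logarithmic potential used in the proof of Thm 2.5; this declaration is the cell’s own lemma, NOT a printed statement)] -/
theorem norm_gradLogKernel_sub_le {ξ η : EuclideanSpace ℝ (Fin 2)} (hξ : ξ ≠ 0) (hη : ‖η‖ < ‖ξ‖ / 2) :
    ‖(2 * Real.pi * ‖ξ - η‖ ^ 2)⁻¹ • (ξ - η) - (2 * Real.pi * ‖ξ‖ ^ 2)⁻¹ • ξ‖ ≤
      12 * (2 * Real.pi * ‖ξ‖ ^ 2)⁻¹ * ‖η‖ := by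
  have hn : 0 < ‖ξ‖ := norm_pos_iff.2 hξ
  have hmem : ∀ x ∈ ball ξ (‖ξ‖ / 2), ‖ξ‖ / 2 < ‖x‖ := fun x hx => by
    rw [mem_ball_iff_norm] at hx
    have := norm_le_norm_add_norm_sub' ξ x
    rw [norm_sub_rev] at this
    linarith
  have hdiff : ∀ x ∈ ball ξ (‖ξ‖ / 2),
      DifferentiableAt ℝ (fun w : EuclideanSpace ℝ (Fin 2) => (2 * Real.pi * ‖w‖ ^ 2)⁻¹ • w) x := fun x hx => by
    have hx0 : x ≠ 0 := norm_pos_iff.1 (by linarith [hmem x hx])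
    obtain ⟨L, hL, -⟩ := exists_hasFDerivAt_gradLogKernel hx0
    exact hL.differentiableAt
  have hbound : ∀ x ∈ ball ξ (‖ξ‖ / 2),
      ‖fderiv ℝ (fun w : EuclideanSpace ℝ (Fin 2) => (2 * Real.pi * ‖w‖ ^ 2)⁻¹ • w) x‖ ≤
        3 * (2 * Real.pi * (‖ξ‖ / 2) ^ 2)⁻¹ := fun x hx => by
    have hx := hmem x hx
    have hx0 : x ≠ 0 := norm_pos_iff.1 (by linarith)
    obtain ⟨L, hL, hLb⟩ := exists_hasFDerivAt_gradLogKernel hx0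
    rw [hL.fderiv]
    refine hLb.trans ?_
    gcongr
  have key := (convex_ball ξ (‖ξ‖ / 2)).norm_image_sub_le_of_norm_fderiv_le hdiff hbound
    (mem_ball_self (by positivity)) (y := ξ - η) (by
      rw [mem_ball_iff_norm, sub_sub_cancel_left, norm_neg]; exact hη)
  rw [sub_sub_cancel_left, norm_neg] at key
  refine key.trans (le_of_eq ?_)
  field_simp
  ring

/-! ### Far-field decay of `∫ g(η) DN(ξ − η) dη` for a NEUTRAL Gaussian-bounded density -/

section Decay

variable {B : ℝ} {g : EuclideanSpace ℝ (Fin 2) → ℝ} (hgc : Continuous g)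
  (hg0 : ∀ η, |g η| ≤ B * Real.exp (-(1 / 8) * ‖η‖ ^ 2)) (hneutral : ∫ η, g η = 0)
include hgc hg0 in
/-- A continuous Gaussian-bounded density is integrable. [folklore]
[cite: GallaySverak2021, §2 and §4.1 (context: potential theory of the planar Biot–Savart / logarithmic potential used in the proof of Thm 2.5; this declaration is the cell’s own lemma, NOT a printed statement)] -/
theorem integrable_of_gaussBound : Integrable g := by
  have h0 := integrable_one_add_norm_pow_mul_exp_eighth 0
  simp only [pow_zero, one_mul] at h0
  exact (h0.const_mul B).mono' hgc.aestronglyMeasurable (Eventually.of_forall fun η => by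
    rw [Real.norm_eq_abs]; exact hg0 η)

/-- The shell estimate `‖ξ − η‖⁻¹ e^{−‖η‖²/16} ≤ 𝟙_{‖ξ−η‖<1}‖ξ − η‖⁻¹ + e^{−‖η‖²/16}`. [folklore]
[cite: GallaySverak2021, §2 and §4.1 (context: potential theory of the planar Biot–Savart / logarithmic potential used in the proof of Thm 2.5; this declaration is the cell’s own lemma, NOT a printed statement)] -/
theorem inv_norm_sub_mul_exp_le (ξ η : EuclideanSpace ℝ (Fin 2)) :
    ‖ξ - η‖⁻¹ * Real.exp (-(1 / 16) * ‖η‖ ^ 2) ≤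
      (ball (0 : EuclideanSpace ℝ (Fin 2)) 1).indicator (fun z => ‖z‖⁻¹) (ξ - η) +
        Real.exp (-(1 / 16) * ‖η‖ ^ 2) := by
  have he : Real.exp (-(1 / 16) * ‖η‖ ^ 2) ≤ 1 := Real.exp_le_one_iff.2 (by nlinarith [norm_nonneg η])
  have he0 : 0 ≤ Real.exp (-(1 / 16) * ‖η‖ ^ 2) := (Real.exp_pos _).le
  have hi0 : 0 ≤ ‖ξ - η‖⁻¹ := inv_nonneg.2 (norm_nonneg _)
  by_cases hb : ξ - η ∈ ball (0 : EuclideanSpace ℝ (Fin 2)) 1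
  · rw [indicator_of_mem hb]; nlinarith
  · rw [indicator_of_notMem hb, zero_add]
    have h3 : ‖ξ - η‖⁻¹ ≤ 1 := inv_le_one_of_one_le₀ (by simpa [mem_ball_zero_iff] using hb)
    nlinarith

include hgc hg0 hneutral in
/-- **Far-field decay from neutrality**: for `1 ≤ ‖ξ‖`, `‖∫ g(η) DN(ξ − η) dη‖ ≤ K/‖ξ‖²`. With `∫ g = 0`,
`∫ g(η) DN(ξ−η) dη = ∫ g(η) (DN(ξ−η) − DN(ξ)) dη`; on `‖η‖ < ‖ξ‖/2` the mean-value bound gives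
`O(‖η‖/‖ξ‖²)`, on `‖η‖ ≥ ‖ξ‖/2` the Gaussian tail `e^{−‖η‖²/8} ≤ e^{−‖ξ‖²/64} e^{−‖η‖²/16}` gives `O(e^{−‖ξ‖²/64})`.
[folklore]
[cite: GallaySverak2021, §2 and §4.1 (context: potential theory of the planar Biot–Savart / logarithmic potential used in the proof of Thm 2.5; this declaration is the cell’s own lemma, NOT a printed statement)] -/
theorem norm_gradLogConv_le_far :
    ∃ K : ℝ, 0 ≤ K ∧ ∀ ξ : EuclideanSpace ℝ (Fin 2), 1 ≤ ‖ξ‖ →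
      ‖∫ η, g η • ((2 * Real.pi * ‖ξ - η‖ ^ 2)⁻¹ • (ξ - η))‖ ≤ K / ‖ξ‖ ^ 2 := by
  have hB : 0 ≤ B := (abs_nonneg _).trans ((hg0 0).trans (le_of_eq (by simp)))
  have hI₁ := integrable_one_add_norm_pow_mul_exp_eighth 1
  have hI16 := integrable_one_add_norm_pow_mul_exp_sixteenth 0
  obtain ⟨I₁, hI₁def⟩ : ∃ I : ℝ, I = ∫ η : EuclideanSpace ℝ (Fin 2),
      (1 + ‖η‖) ^ 1 * Real.exp (-(1 / 8) * ‖η‖ ^ 2) := ⟨_, rfl⟩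
  obtain ⟨Iind, hIind⟩ : ∃ I : ℝ, I = ∫ z, (ball (0 : EuclideanSpace ℝ (Fin 2)) 1).indicator (fun z => ‖z‖⁻¹) z :=
    ⟨_, rfl⟩
  obtain ⟨I16, hI16def⟩ : ∃ I : ℝ, I = ∫ η : EuclideanSpace ℝ (Fin 2),
      (1 + ‖η‖) ^ 0 * Real.exp (-(1 / 16) * ‖η‖ ^ 2) := ⟨_, rfl⟩
  have hI₁0 : 0 ≤ I₁ := hI₁def ▸ integral_nonneg fun η => by positivity
  have hIind0 : 0 ≤ Iind := hIind ▸ integral_nonneg indicator_inv_norm_nonneg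
  have hI160 : 0 ≤ I16 := hI16def ▸ integral_nonneg fun η => by positivity
  obtain ⟨K₁, hK₁⟩ : ∃ K : ℝ, K = B * (12 * (2 * Real.pi)⁻¹) * I₁ := ⟨_, rfl⟩
  obtain ⟨K₂, hK₂⟩ : ∃ K : ℝ, K = B * (2 * Real.pi)⁻¹ * (Iind + 2 * I16) := ⟨_, rfl⟩
  have hK₁0 : 0 ≤ K₁ := by rw [hK₁]; positivity
  have hK₂0 : 0 ≤ K₂ := by rw [hK₂]; positivity
  refine ⟨K₁ + 64 * K₂, by positivity, fun ξ hξ => ?_⟩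
  have hξn : 0 < ‖ξ‖ := by linarith
  have hξ0 : ξ ≠ 0 := norm_pos_iff.1 hξn
  have hint := integrable_smul_gradLogKernel hgc hg0 ξ
  have hgi : Integrable g := integrable_of_gaussBound hgc hg0
  -- neutrality
  have hV : ∫ η, g η • ((2 * Real.pi * ‖ξ - η‖ ^ 2)⁻¹ • (ξ - η)) =
      ∫ η, g η • (((2 * Real.pi * ‖ξ - η‖ ^ 2)⁻¹ • (ξ - η)) - (2 * Real.pi * ‖ξ‖ ^ 2)⁻¹ • ξ) := by
    have h1 : Integrable fun η => g η • ((2 * Real.pi * ‖ξ‖ ^ 2)⁻¹ • ξ) := hgi.smul_const _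
    have h2 : (fun η => g η • (((2 * Real.pi * ‖ξ - η‖ ^ 2)⁻¹ • (ξ - η)) - (2 * Real.pi * ‖ξ‖ ^ 2)⁻¹ • ξ)) =
        fun η => g η • ((2 * Real.pi * ‖ξ - η‖ ^ 2)⁻¹ • (ξ - η)) - g η • ((2 * Real.pi * ‖ξ‖ ^ 2)⁻¹ • ξ) :=
      funext fun η => smul_sub _ _ _
    rw [h2, integral_sub hint h1, integral_smul_const, hneutral, zero_smul, sub_zero]
  rw [hV]
  -- the pointwise majorant
  obtain ⟨bound, hbdef⟩ : ∃ b : EuclideanSpace ℝ (Fin 2) → ℝ, b = fun η =>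
    (‖ξ‖ ^ 2)⁻¹ * (B * (12 * (2 * Real.pi)⁻¹) * ((1 + ‖η‖) ^ 1 * Real.exp (-(1 / 8) * ‖η‖ ^ 2))) +
      Real.exp (-(1 / 64) * ‖ξ‖ ^ 2) * (B * (2 * Real.pi)⁻¹ *
        ((ball (0 : EuclideanSpace ℝ (Fin 2)) 1).indicator (fun z => ‖z‖⁻¹) (ξ - η) +
          2 * ((1 + ‖η‖) ^ 0 * Real.exp (-(1 / 16) * ‖η‖ ^ 2)))) := ⟨_, rfl⟩
  have hb1 : ∀ η : EuclideanSpace ℝ (Fin 2), 0 ≤ (‖ξ‖ ^ 2)⁻¹ * (B * (12 * (2 * Real.pi)⁻¹) *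
      ((1 + ‖η‖) ^ 1 * Real.exp (-(1 / 8) * ‖η‖ ^ 2))) := fun η => by positivity
  have hb2 : ∀ η, 0 ≤ Real.exp (-(1 / 64) * ‖ξ‖ ^ 2) * (B * (2 * Real.pi)⁻¹ *
      ((ball (0 : EuclideanSpace ℝ (Fin 2)) 1).indicator (fun z => ‖z‖⁻¹) (ξ - η) +
        2 * ((1 + ‖η‖) ^ 0 * Real.exp (-(1 / 16) * ‖η‖ ^ 2)))) := fun η =>
    mul_nonneg (Real.exp_pos _).le (mul_nonneg (mul_nonneg hB (by positivity))
      (add_nonneg (indicator_inv_norm_nonneg _) (by positivity)))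
  have hbound : ∀ η, ‖g η • (((2 * Real.pi * ‖ξ - η‖ ^ 2)⁻¹ • (ξ - η)) - (2 * Real.pi * ‖ξ‖ ^ 2)⁻¹ • ξ)‖ ≤
      bound η := by
    intro η
    rw [hbdef, norm_smul, Real.norm_eq_abs]
    by_cases hη : ‖η‖ < ‖ξ‖ / 2
    · have hk := norm_gradLogKernel_sub_le hξ0 hη
      calc |g η| * ‖((2 * Real.pi * ‖ξ - η‖ ^ 2)⁻¹ • (ξ - η)) - (2 * Real.pi * ‖ξ‖ ^ 2)⁻¹ • ξ‖
          ≤ (B * Real.exp (-(1 / 8) * ‖η‖ ^ 2)) * (12 * (2 * Real.pi * ‖ξ‖ ^ 2)⁻¹ * ‖η‖) :=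
            mul_le_mul (hg0 η) hk (norm_nonneg _) (by positivity)
        _ ≤ (B * Real.exp (-(1 / 8) * ‖η‖ ^ 2)) * (12 * (2 * Real.pi * ‖ξ‖ ^ 2)⁻¹ * (1 + ‖η‖) ^ 1) := by
            gcongr; rw [pow_one]; linarith [norm_nonneg η]
        _ = (‖ξ‖ ^ 2)⁻¹ * (B * (12 * (2 * Real.pi)⁻¹) * ((1 + ‖η‖) ^ 1 * Real.exp (-(1 / 8) * ‖η‖ ^ 2))) := by
            field_simp
        _ ≤ _ := le_add_of_nonneg_right (hb2 η)
    · rw [not_lt] at hη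
      have hk : ‖((2 * Real.pi * ‖ξ - η‖ ^ 2)⁻¹ • (ξ - η)) - (2 * Real.pi * ‖ξ‖ ^ 2)⁻¹ • ξ‖ ≤
          (2 * Real.pi)⁻¹ * ‖ξ - η‖⁻¹ + (2 * Real.pi)⁻¹ * ‖ξ‖⁻¹ := by
        refine (norm_sub_le _ _).trans (le_of_eq ?_)
        rw [norm_gradLogKernel, norm_gradLogKernel]
      have hgauss : Real.exp (-(1 / 8) * ‖η‖ ^ 2) ≤ Real.exp (-(1 / 64) * ‖ξ‖ ^ 2) * Real.exp (-(1 / 16) * ‖η‖ ^ 2) := by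
        rw [← Real.exp_add]
        exact Real.exp_le_exp.2 (by nlinarith [norm_nonneg ξ, norm_nonneg η])
      have hkey := inv_norm_sub_mul_exp_le ξ η
      have hξinv : ‖ξ‖⁻¹ ≤ 1 := inv_le_one_of_one_le₀ hξ
      have he0 : 0 ≤ Real.exp (-(1 / 16) * ‖η‖ ^ 2) := (Real.exp_pos _).le
      calc |g η| * ‖((2 * Real.pi * ‖ξ - η‖ ^ 2)⁻¹ • (ξ - η)) - (2 * Real.pi * ‖ξ‖ ^ 2)⁻¹ • ξ‖
          ≤ (B * (Real.exp (-(1 / 64) * ‖ξ‖ ^ 2) * Real.exp (-(1 / 16) * ‖η‖ ^ 2))) *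
              ((2 * Real.pi)⁻¹ * ‖ξ - η‖⁻¹ + (2 * Real.pi)⁻¹ * ‖ξ‖⁻¹) :=
            mul_le_mul ((hg0 η).trans (mul_le_mul_of_nonneg_left hgauss hB)) hk (norm_nonneg _) (by positivity)
        _ = Real.exp (-(1 / 64) * ‖ξ‖ ^ 2) * (B * (2 * Real.pi)⁻¹ *
              (‖ξ - η‖⁻¹ * Real.exp (-(1 / 16) * ‖η‖ ^ 2) + ‖ξ‖⁻¹ * Real.exp (-(1 / 16) * ‖η‖ ^ 2))) := by ring
        _ ≤ Real.exp (-(1 / 64) * ‖ξ‖ ^ 2) * (B * (2 * Real.pi)⁻¹ *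
              ((ball (0 : EuclideanSpace ℝ (Fin 2)) 1).indicator (fun z => ‖z‖⁻¹) (ξ - η) +
                Real.exp (-(1 / 16) * ‖η‖ ^ 2) + 1 * Real.exp (-(1 / 16) * ‖η‖ ^ 2))) := by
            gcongr
        _ = Real.exp (-(1 / 64) * ‖ξ‖ ^ 2) * (B * (2 * Real.pi)⁻¹ *
              ((ball (0 : EuclideanSpace ℝ (Fin 2)) 1).indicator (fun z => ‖z‖⁻¹) (ξ - η) +
                2 * ((1 + ‖η‖) ^ 0 * Real.exp (-(1 / 16) * ‖η‖ ^ 2)))) := by ring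
        _ ≤ _ := le_add_of_nonneg_left (hb1 η)
  -- integrate the majorant
  have hi1 : Integrable fun η : EuclideanSpace ℝ (Fin 2) =>
      (ball (0 : EuclideanSpace ℝ (Fin 2)) 1).indicator (fun z => ‖z‖⁻¹) (ξ - η) :=
    integrable_indicator_inv_norm.comp_sub_left ξ
  have hi2 : Integrable fun η : EuclideanSpace ℝ (Fin 2) =>
      2 * ((1 + ‖η‖) ^ 0 * Real.exp (-(1 / 16) * ‖η‖ ^ 2)) := hI16.const_mul 2
  have hi12 : Integrable fun η : EuclideanSpace ℝ (Fin 2) =>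
      (ball (0 : EuclideanSpace ℝ (Fin 2)) 1).indicator (fun z => ‖z‖⁻¹) (ξ - η) +
        2 * ((1 + ‖η‖) ^ 0 * Real.exp (-(1 / 16) * ‖η‖ ^ 2)) := hi1.add hi2
  have hiA : Integrable fun η : EuclideanSpace ℝ (Fin 2) =>
      (‖ξ‖ ^ 2)⁻¹ * (B * (12 * (2 * Real.pi)⁻¹) * ((1 + ‖η‖) ^ 1 * Real.exp (-(1 / 8) * ‖η‖ ^ 2))) :=
    (hI₁.const_mul _).const_mul _
  have hiB : Integrable fun η : EuclideanSpace ℝ (Fin 2) =>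
      Real.exp (-(1 / 64) * ‖ξ‖ ^ 2) * (B * (2 * Real.pi)⁻¹ *
        ((ball (0 : EuclideanSpace ℝ (Fin 2)) 1).indicator (fun z => ‖z‖⁻¹) (ξ - η) +
          2 * ((1 + ‖η‖) ^ 0 * Real.exp (-(1 / 16) * ‖η‖ ^ 2)))) := (hi12.const_mul _).const_mul _
  have hbi : Integrable bound := by rw [hbdef]; exact hiA.add hiB
  have hbI : ∫ η, bound η = (‖ξ‖ ^ 2)⁻¹ * K₁ + Real.exp (-(1 / 64) * ‖ξ‖ ^ 2) * K₂ := by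
    rw [hbdef, hK₁, hK₂, hI₁def, hIind, hI16def]
    rw [integral_add hiA hiB, integral_const_mul, integral_const_mul, integral_const_mul, integral_const_mul,
      integral_add hi1 hi2, integral_const_mul,
      integral_sub_left_eq_self ((ball (0 : EuclideanSpace ℝ (Fin 2)) 1).indicator fun z => ‖z‖⁻¹) volume ξ]
  have hexp : Real.exp (-(1 / 64) * ‖ξ‖ ^ 2) ≤ 64 / ‖ξ‖ ^ 2 := by
    have h1 : (1 / 64) * ‖ξ‖ ^ 2 ≤ Real.exp ((1 / 64) * ‖ξ‖ ^ 2) := by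
      linarith [Real.add_one_le_exp ((1 / 64) * ‖ξ‖ ^ 2)]
    rw [neg_mul, Real.exp_neg]
    calc (Real.exp ((1 / 64) * ‖ξ‖ ^ 2))⁻¹ ≤ ((1 / 64) * ‖ξ‖ ^ 2)⁻¹ := inv_anti₀ (by positivity) h1
      _ = 64 / ‖ξ‖ ^ 2 := by field_simp
  calc ‖∫ η, g η • (((2 * Real.pi * ‖ξ - η‖ ^ 2)⁻¹ • (ξ - η)) - (2 * Real.pi * ‖ξ‖ ^ 2)⁻¹ • ξ)‖
      ≤ ∫ η, bound η := norm_integral_le_of_norm_le hbi (Eventually.of_forall hbound)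
    _ = (‖ξ‖ ^ 2)⁻¹ * K₁ + Real.exp (-(1 / 64) * ‖ξ‖ ^ 2) * K₂ := hbI
    _ ≤ (‖ξ‖ ^ 2)⁻¹ * K₁ + 64 / ‖ξ‖ ^ 2 * K₂ := by linarith [mul_le_mul_of_nonneg_right hexp hK₂0]
    _ = (K₁ + 64 * K₂) / ‖ξ‖ ^ 2 := by field_simp

include hgc hg0 hneutral in
/-- **Global decay**: `‖∫ g(η) DN(ξ − η) dη‖ ≤ C/(1 + ‖ξ‖)²` for a neutral Gaussian-bounded density
(far field from `norm_gradLogConv_le_far`, near field from the uniform bound). [folklore]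
[cite: GallaySverak2021, §2 and §4.1 (context: potential theory of the planar Biot–Savart / logarithmic potential used in the proof of Thm 2.5; this declaration is the cell’s own lemma, NOT a printed statement)] -/
theorem norm_gradLogConv_le :
    ∃ C : ℝ, ∀ ξ : EuclideanSpace ℝ (Fin 2),
      ‖∫ η, g η • ((2 * Real.pi * ‖ξ - η‖ ^ 2)⁻¹ • (ξ - η))‖ ≤ C / (1 + ‖ξ‖) ^ 2 := by
  obtain ⟨K, hK0, hK⟩ := norm_gradLogConv_le_far hgc hg0 hneutral
  obtain ⟨M, hM⟩ := exists_integral_norm_smul_gradLogKernel_le hg0 hgc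
  refine ⟨4 * K + 4 * max M 0, fun ξ => ?_⟩
  have hVle : ‖∫ η, g η • ((2 * Real.pi * ‖ξ - η‖ ^ 2)⁻¹ • (ξ - η))‖ ≤ max M 0 :=
    ((norm_integral_le_integral_norm _).trans (hM ξ)).trans (le_max_left _ _)
  have hM0 : 0 ≤ max M 0 := le_max_right _ _
  have hpos : (0:ℝ) < (1 + ‖ξ‖) ^ 2 := by positivity
  by_cases hξ : 1 ≤ ‖ξ‖
  · calc ‖∫ η, g η • ((2 * Real.pi * ‖ξ - η‖ ^ 2)⁻¹ • (ξ - η))‖ ≤ K / ‖ξ‖ ^ 2 := hK ξ hξ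
      _ ≤ 4 * K / (1 + ‖ξ‖) ^ 2 := by
          rw [div_le_div_iff₀ (by positivity) hpos]
          have h4 : (1 + ‖ξ‖) ^ 2 ≤ 4 * ‖ξ‖ ^ 2 := by nlinarith
          nlinarith [mul_le_mul_of_nonneg_left h4 hK0]
      _ ≤ (4 * K + 4 * max M 0) / (1 + ‖ξ‖) ^ 2 := by
          gcongr; linarith
  · rw [not_le] at hξ
    calc ‖∫ η, g η • ((2 * Real.pi * ‖ξ - η‖ ^ 2)⁻¹ • (ξ - η))‖ ≤ max M 0 := hVle
      _ ≤ 4 * max M 0 / (1 + ‖ξ‖) ^ 2 := by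
          rw [le_div_iff₀ hpos]
          have h4 : (1 + ‖ξ‖) ^ 2 ≤ 4 := by nlinarith [norm_nonneg ξ]
          nlinarith [mul_le_mul_of_nonneg_left h4 hM0]
      _ ≤ (4 * K + 4 * max M 0) / (1 + ‖ξ‖) ^ 2 := by
          gcongr; linarith

end Decay

/-! ### The registered helper -/

end Literature.Analysis.GaussianVortexArnold.StretchedVortexRows

end Part10

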